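import Literature.Computability.Complexity.RandomKSatThresholdReduction
import Literature.Computability.Complexity.BourgainSharpThreshold
import Mathlib.Data.Fin.Tuple.Basic
import Mathlib.Data.Nat.Choose.Bounds
import Mathlib.Data.Fintype.BigOperators
import Mathlib.Logic.Equiv.Basic
import Mathlib.Logic.Equiv.Prod
import Mathlib.Data.Fin.Embedding
import Mathlib.Analysis.SpecialFunctions.Exp
import Mathlib.Analysis.Complex.ExponentialBounds
import Mathlib.Analysis.SpecificLimits.Basic
import Literature.Computability.Complexity.RandomKSatUniformlyPos
import HarnessLib

/-!
# Friedgut's sharp-threshold theorem for random `k`-SAT (`k ≥ 3`) and the discharge of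
# Achlioptas–Peres 2004, Theorem 2

This file proves `AchlioptasPeres2004_threshold_lower_bound_holds :
AchlioptasPeres2004_threshold_lower_bound` (`RandomKSatThreshold.lean`; D. Achlioptas, Y. Peres,
J. Amer. Math. Soc. 17 (2004), Thm. 2). The second-moment half (uniformly positive probability for
`k ≥ 1024`) is `achlioptasPeres2004_uniformlyPos` (`RandomKSatUniformlyPos.lean`); the missing
ingredient of the printed proof, **Friedgut's theorem** (AP Thm. 3 = E. Friedgut, J. Amer. Math.
Soc. 12 (1999), Thm. 1.3, with J. Bourgain's appendix), is proved here for `k ≥ 3`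
(`RandomKSat.friedgut_sharp_threshold`) from Bourgain's sharp threshold theorem
(`BourgainSharpThreshold.lean`) applied DIRECTLY to the with-replacement model `F_k(n, M)` — the
uniform measure on literal arrays is a finite uniform product space, so no Russo formula / binomial
model is needed. The file is organised in six parts (each with its own section docstring):

1. influences and boosters in `F_k(n, M)` (`totalInfl_unsatInd_le`, `ksat_dichotomy`);
2. rarity of small unsatisfiable sub-formulas for `k ≥ 3` (`avg_ite_exists_small_unsat_le`);
3. unit literals of clauses meeting a fixed variable set and one slot of Friedgut's Lemma 5.7
   (`single_slot_le`);
4. the planted-booster refutation (hybrid argument, planting, pooling: `satExt_ge_of_planted`);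
5. the two crude bounds `P(n,m) ≤ 2ⁿ(1-2^{-k})^m` and `P(n,m) ≥ 1 - m²/n`;
6. the window lemma `not_coarse`, the median density `mHalf`, Friedgut's theorem, and the
   discharge `AchlioptasPeres2004_threshold_lower_bound_holds`.

## References

* D. Achlioptas, Y. Peres, *The threshold for random `k`-SAT is `2^k log 2 - O(k)`*, J. Amer.
  Math. Soc. 17 (2004) 947–973, Thm. 2, Thm. 3, Cor. 1; arXiv:cs/0305009 [AchlioptasPeres2004].
* E. Friedgut (appendix by J. Bourgain), *Sharp thresholds of graph properties, and the `k`-sat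
  problem*, J. Amer. Math. Soc. 12 (1999) 1017–1054, Thm. 1.3, §5 (Cor. 5.3, Claims 5.4–5.5,
  Lemmas 5.6–5.7), Appendix Prop. 1 [Friedgut1999].
* R. O'Donnell, *Analysis of Boolean Functions*, CUP 2014, §10.5 [ODonnell2014].
-/

/-!
# Random `k`-SAT in the literal-array model as a product space: influences and boosters

First step of Friedgut's theorem on the sharpness of the satisfiability threshold
(E. Friedgut, J. Amer. Math. Soc. 12 (1999), Thm. 1.3 and §5), carried out DIRECTLY in the
with-replacement model `F_k(n, M)` of `RandomKSatThreshold.lean` — the uniform measure on literal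
arrays `Fin M → (Fin k → Fin n × Bool)` IS a finite uniform product space (`ι = Fin M` clause
slots, `Ω` = clauses), so Bourgain's sharp threshold theorem (`BourgainSharpThreshold.lean`)
applies to `f = ±1_{UNSAT}` without Russo's formula or a binomial model:

* `totalInfl_unsatInd_le` — `I[f_{M+1}] ≤ 4 (M+1) (P(M) - P(M+1))` (`P = litArraySatProb k n`):
  the influence of a clause slot is at most `4×` the drop of the satisfiability probability
  caused by one extra clause;
* `variance_unsatInd` — `Var f_M = 4 P(M)(1 - P(M))`;
* `proj_unsatInd` — `f^{⊆T}(x) = 1 - 2·satExt x T`, `satExt x T = Pr[x_T ∪ (M-|T|) fresh clauses sat]`,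
  and `satExt_le` — `satExt x T ≤ P(M - |T|)` (dropping clauses only helps);
* `ksat_dichotomy` — Bourgain's theorem read in `k`-SAT terms (Friedgut 1999, §5, the use of
  Thm. 5.2 / Bourgain's Prop. 1): if `I ≤ K`, `Var ≥ v₀` and removing `L = ⌈4K/v₀⌉` clauses changes
  `P` by less than `τ/2`, then EITHER unsatisfiable sub-formulas of `≤ L` clauses appear with
  probability `≥ τ/2`, OR some satisfiable `H` of `≤ L` clauses planted into `F_k(n, M - |H|)` lowers
  the satisfiability probability to `≤ P(M) - τ/2`.

## References

* E. Friedgut (appendix by J. Bourgain), *Sharp thresholds of graph properties, and the `k`-sat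
  problem*, J. Amer. Math. Soc. 12 (1999) 1017–1054, §5 and Appendix Prop. 1 [Friedgut1999].
* R. O'Donnell, *Analysis of Boolean Functions*, CUP 2014, §10.5 [ODonnell2014].
-/

noncomputable section

namespace Literature.Computability.Complexity

namespace RandomKSat

open Finset ProductSpace
open scoped Classical

variable {k n : ℕ}

/-! ### Satisfiability of clause families over any index type -/

/-- Satisfiability of a family of `k`-clauses indexed by any type (`LitArraySat` is the case
`ι = Fin m`). [cite: AchlioptasPeres2004, §1 (p. 1)] -/
def FamilySat {ι : Type*} (Φ : ι → Fin k → Fin n × Bool) : Prop :=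
  ∃ σ : Fin n → Bool, ∀ i, ∃ j, σ (Φ i j).1 = (Φ i j).2

/-- `LitArraySat` is `FamilySat` over `Fin m`. [cite: AchlioptasPeres2004, §1 (p. 1)] -/
theorem litArraySat_iff_familySat {m : ℕ} (Φ : Fin m → Fin k → Fin n × Bool) :
    LitArraySat Φ ↔ FamilySat Φ := Iff.rfl

/-- A sub-family (or reindexing) of a satisfiable family is satisfiable. [folklore] -/
theorem FamilySat.comp {ι ι' : Type*} {Φ : ι → Fin k → Fin n × Bool} (h : FamilySat Φ) (g : ι' → ι) :
    FamilySat (Φ ∘ g) := by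
  obtain ⟨σ, hσ⟩ := h
  exact ⟨σ, fun i => hσ (g i)⟩

/-- Satisfiability is invariant under reindexing by an equivalence. [folklore] -/
theorem familySat_comp_equiv {ι ι' : Type*} (Φ : ι → Fin k → Fin n × Bool) (e : ι' ≃ ι) :
    FamilySat (Φ ∘ e) ↔ FamilySat Φ := by
  refine ⟨fun h => ?_, fun h => h.comp e⟩
  have := h.comp e.symm
  rwa [Function.comp_assoc, Equiv.self_comp_symm, Function.comp_id] at this

/-- The empty family is satisfiable. [folklore] -/
theorem familySat_of_isEmpty {ι : Type*} [IsEmpty ι] (Φ : ι → Fin k → Fin n × Bool) : FamilySat Φ :=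
  ⟨fun _ => false, fun i => isEmptyElim i⟩

/-- A function of the second factor averages over the product to its average. [folklore] -/
theorem avg_prod_snd {α β : Type*} [Fintype α] [Fintype β] [Nonempty α] (g : β → ℝ) :
    avg (fun p : α × β => g p.2) = avg g := by
  rw [avg_prod_comm (fun (_ : α) (b : β) => g b)]
  exact avg_congr fun b => avg_const (g b)

/-- **The satisfiability probability of a uniform family over any finite index type is
`litArraySatProb k n |ι|`.** [cite: AchlioptasPeres2004, §1 (p. 1)] -/
theorem avg_ite_familySat (ι : Type*) [Fintype ι] [DecidableEq ι] :
    avg (fun Φ : ι → Fin k → Fin n × Bool => if FamilySat Φ then (1 : ℝ) else 0) =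
      litArraySatProb k n (Fintype.card ι) := by
  classical
  set m := Fintype.card ι
  set e : ι ≃ Fin m := Fintype.equivFin ι
  have h1 : litArraySatProb k n m =
      avg (fun Ψ : Fin m → Fin k → Fin n × Bool => if FamilySat Ψ then (1 : ℝ) else 0) := by
    unfold litArraySatProb avg
    congr 1
    rw [Finset.natCast_card_filter]
    rfl
  rw [h1]
  -- reindex `Ψ ↦ Ψ ∘ e`
  set Φe : (Fin m → Fin k → Fin n × Bool) ≃ (ι → Fin k → Fin n × Bool) :=
    e.symm.arrowCongr (Equiv.refl _) with hΦe
  rw [← avg_comp_equiv Φe (fun Φ : ι → Fin k → Fin n × Bool => if FamilySat Φ then (1 : ℝ) else 0)]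
  refine avg_congr fun Ψ => ?_
  have : FamilySat (Φe Ψ) ↔ FamilySat Ψ := by
    rw [hΦe]
    exact familySat_comp_equiv Ψ e
  simp only [this]

/-! ### The `±1`-indicator of unsatisfiability -/

/-- `f = +1` on unsatisfiable arrays, `-1` on satisfiable ones. [cite: Friedgut1999, §5] -/
def unsatInd (k n M : ℕ) (Φ : Fin M → Fin k → Fin n × Bool) : ℝ := if LitArraySat Φ then -1 else 1

/-- `f` is `±1`-valued. [cite: Friedgut1999, §5] -/
theorem unsatInd_pm (k n M : ℕ) (Φ : Fin M → Fin k → Fin n × Bool) :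
    unsatInd k n M Φ = 1 ∨ unsatInd k n M Φ = -1 := by
  unfold unsatInd; split_ifs <;> simp

/-- `f = 1 - 2·1_{SAT}`. [cite: Friedgut1999, §5] -/
theorem unsatInd_eq (k n M : ℕ) (Φ : Fin M → Fin k → Fin n × Bool) :
    unsatInd k n M Φ = 1 - 2 * (if LitArraySat Φ then (1 : ℝ) else 0) := by
  unfold unsatInd; split_ifs <;> norm_num

/-- `Pr[F_k(n, M) sat]` as an average of the indicator. [cite: AchlioptasPeres2004, §1 (p. 1)] -/
theorem avg_ite_litArraySat (k n M : ℕ) :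
    avg (fun Φ : Fin M → Fin k → Fin n × Bool => if LitArraySat Φ then (1 : ℝ) else 0) =
      litArraySatProb k n M := by
  have := avg_ite_familySat (k := k) (n := n) (Fin M)
  simp only [Fintype.card_fin] at this
  rw [← this]
  rfl

/-- `E f = 1 - 2 P(M)` (over a nonempty array type, i.e. `n ≥ 1` or `kM = 0`). [cite: Friedgut1999, §5] -/
theorem avg_unsatInd (k n M : ℕ) [Nonempty (Fin M → Fin k → Fin n × Bool)] :
    avg (unsatInd k n M) = 1 - 2 * litArraySatProb k n M := by
  have e : unsatInd k n M = fun Φ => 1 - 2 * (if LitArraySat Φ then (1 : ℝ) else 0) :=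
    funext (unsatInd_eq k n M)
  rw [e, avg_sub, avg_mul_left, avg_ite_litArraySat, avg_const]

/-- **`Var f = 4 P(M) (1 - P(M))`.** [cite: Friedgut1999, §5] -/
theorem variance_unsatInd (k n M : ℕ) [Nonempty (Fin M → Fin k → Fin n × Bool)] :
    variance (unsatInd k n M) = 4 * litArraySatProb k n M * (1 - litArraySatProb k n M) := by
  unfold variance
  have : (fun Φ => unsatInd k n M Φ ^ 2) = fun _ => (1 : ℝ) := by
    funext Φ; rcases unsatInd_pm k n M Φ with h | h <;> simp [h]
  rw [this, avg_const, avg_unsatInd]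
  ring

/-! ### Restrictions `f^{⊆T}`: planting the clauses `x_T` -/

/-- `satExt x T = Pr_y[x|_T ∪ y|_{Tᶜ} is satisfiable]`: the satisfiability probability when the
clauses of `x` in the slots `T` are kept and the others are resampled.
[cite: Friedgut1999, Thm. 5.2 (conditioning on the appearance of a specific copy)] -/
def satExt {M : ℕ} (x : Fin M → Fin k → Fin n × Bool) (T : Finset (Fin M)) : ℝ :=
  avg fun y : Fin M → Fin k → Fin n × Bool => if LitArraySat (T.piecewise x y) then (1 : ℝ) else 0

/-- `f^{⊆T}(x) = 1 - 2 satExt x T`. [cite: ODonnell2014, Def. 10.46] -/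
theorem proj_unsatInd {M : ℕ} (T : Finset (Fin M)) (x : Fin M → Fin k → Fin n × Bool) :
    proj T (unsatInd k n M) x = 1 - 2 * satExt x T := by
  unfold proj satExt
  have e : ∀ y, unsatInd k n M (T.piecewise x y) = 1 - 2 * (if LitArraySat (T.piecewise x y) then (1 : ℝ) else 0) :=
    fun y => unsatInd_eq k n M _
  simp_rw [e]
  have hne : Nonempty (Fin M → Fin k → Fin n × Bool) := ⟨x⟩
  rw [avg_sub, avg_const, avg_mul_left]

/-- `0 ≤ satExt ≤ 1`. [folklore] -/
theorem satExt_nonneg {M : ℕ} (x : Fin M → Fin k → Fin n × Bool) (T : Finset (Fin M)) :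
    0 ≤ satExt x T := avg_nonneg fun y => by positivity

/-- **Planting only removes clauses from the count: `satExt x T ≤ P(M - |T|)`** — if
`x|_T ∪ y|_{Tᶜ}` is satisfiable then so is the sub-family `y|_{Tᶜ}`, a uniform family of
`M - |T|` clauses. [cite: Friedgut1999, §5 (proof of Cor. 5.3)] -/
theorem satExt_le {M : ℕ} (x : Fin M → Fin k → Fin n × Bool) (T : Finset (Fin M)) :
    satExt x T ≤ litArraySatProb k n (M - T.card) := by
  classical
  unfold satExt
  -- restrict to the slots outside `T`
  have h1 : ∀ y : Fin M → Fin k → Fin n × Bool,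
      (if LitArraySat (T.piecewise x y) then (1 : ℝ) else 0) ≤
      (if FamilySat (fun j : {j : Fin M // ¬ j ∈ T} => y j.1) then (1 : ℝ) else 0) := by
    intro y
    split_ifs with h h'
    · exact le_rfl
    · exfalso
      apply h'
      have := (show FamilySat (T.piecewise x y) from h).comp (fun j : {j : Fin M // ¬ j ∈ T} => j.1)
      have e : (T.piecewise x y) ∘ (fun j : {j : Fin M // ¬ j ∈ T} => j.1) =
          fun j : {j : Fin M // ¬ j ∈ T} => y j.1 := by
        funext j
        simp [Function.comp, Finset.piecewise, j.2]
      rwa [e] at this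
    · positivity
    · exact le_rfl
  refine (avg_mono h1).trans (le_of_eq ?_)
  -- the restriction is uniform on `{j // j ∉ T} → clauses`
  have hα : Nonempty ({j : Fin M // j ∈ T} → Fin k → Fin n × Bool) := ⟨fun j => x j.1⟩
  set E := Equiv.piEquivPiSubtypeProd (fun j : Fin M => j ∈ T) (fun _ => Fin k → Fin n × Bool) with hE
  have h2 : avg (fun y : Fin M → Fin k → Fin n × Bool =>
      if FamilySat (fun j : {j : Fin M // ¬ j ∈ T} => y j.1) then (1 : ℝ) else 0) =
      avg (fun p : ({j : Fin M // j ∈ T} → Fin k → Fin n × Bool) ×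
        ({j : Fin M // ¬ j ∈ T} → Fin k → Fin n × Bool) => if FamilySat p.2 then (1 : ℝ) else 0) := by
    rw [← avg_comp_equiv E]
    rfl
  rw [h2, avg_prod_snd (fun q : {j : Fin M // ¬ j ∈ T} → Fin k → Fin n × Bool =>
    if FamilySat q then (1 : ℝ) else 0), avg_ite_familySat]
  congr 1
  rw [Fintype.card_subtype_compl, Fintype.card_fin, Fintype.card_coe]

/-- Consequently no restriction can raise the satisfiability probability by more than dropping
`L` clauses does: `satExt x T ≤ P(M - L)` for `|T| ≤ L`. [cite: Friedgut1999, §5] -/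
theorem satExt_le_of_card_le {M L : ℕ} (x : Fin M → Fin k → Fin n × Bool) {T : Finset (Fin M)}
    (hT : T.card ≤ L) : satExt x T ≤ litArraySatProb k n (M - L) :=
  (satExt_le x T).trans (litArraySatProb_antitone k n (Nat.sub_le_sub_left hT M))

/-! ### Influences of clause slots -/

/-- For `±1`-valued `f`: `Inf_i[f] = 1 - E[(E_i f)²]`. [cite: ODonnell2014, Prop. 8.24] -/
theorem infl_eq_one_sub {ι Ω : Type*} [Fintype ι] [DecidableEq ι] [Fintype Ω] [Nonempty Ω]
    (i : ι) {f : (ι → Ω) → ℝ} (hf : ∀ x, f x = 1 ∨ f x = -1) :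
    infl i f = 1 - avg (fun x => proj ({i}ᶜ) f x ^ 2) := by
  unfold infl coordL
  have hdep : ∀ x x' : ι → Ω, (∀ j ∈ ({i}ᶜ : Finset ι), x j = x' j) →
      proj ({i}ᶜ) f x = proj ({i}ᶜ) f x' := fun x x' h => proj_congr _ f h
  have h1 : avg (fun x => f x * proj ({i}ᶜ) f x) = avg (fun x => proj ({i}ᶜ) f x ^ 2) := by
    rw [← avg_proj ({i}ᶜ) (fun x => f x * proj ({i}ᶜ) f x), proj_mul_of_dep _ _ _ hdep]
    exact avg_congr fun x => by ring
  have e : ∀ x, (f x - proj ({i}ᶜ) f x) ^ 2 = 1 - 2 * (f x * proj ({i}ᶜ) f x) + proj ({i}ᶜ) f x ^ 2 := by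
    intro x
    have : f x ^ 2 = 1 := by rcases hf x with h | h <;> simp [h]
    nlinarith [this]
  simp_rw [e]
  rw [avg_add, avg_sub, avg_const, avg_mul_left, h1]
  ring

/-- **The influence of a clause slot is at most `4 (P(M) - P(M+1))`** (Friedgut 1999, §5 /
Russo-type identity in the with-replacement model): on the fiber through `x`, with
`s = Pr_ω[x with slot i := ω is sat]`, `Var_i = 4 s (1 - s) ≤ 4 (1[x ∖ slot i sat] - s)`, and the
two terms average to `P(M)` and `P(M+1)`. [cite: Friedgut1999, §5] -/
theorem infl_unsatInd_le (k n M : ℕ) [NeZero n] (i : Fin (M + 1)) :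
    infl i (unsatInd k n (M + 1)) ≤ 4 * (litArraySatProb k n M - litArraySatProb k n (M + 1)) := by
  classical
  set C := Fin k → Fin n × Bool
  have hne : Nonempty C := inferInstance
  set f := unsatInd k n (M + 1) with hf
  have hpm := unsatInd_pm k n (M + 1)
  -- the fiber quantities
  set s : (Fin (M + 1) → C) → ℝ := fun x =>
    avg (fun ω : C => if LitArraySat (Function.update x i ω) then (1 : ℝ) else 0) with hs
  set d : (Fin (M + 1) → C) → ℝ := fun x =>
    if FamilySat (fun j : Fin M => x (i.succAbove j)) then (1 : ℝ) else 0 with hd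
  have hμ : ∀ x, proj ({i}ᶜ) f x = 1 - 2 * s x := by
    intro x
    rw [proj_compl_singleton_eq_avg_update]
    simp only [hf, unsatInd_eq, hs]
    rw [avg_sub, avg_const, avg_mul_left]
  have hs0 : ∀ x, 0 ≤ s x := fun x => avg_nonneg fun ω => by positivity
  have hsd : ∀ x, s x ≤ d x := by
    intro x
    refine avg_le_of_le fun ω => ?_
    simp only [hd]
    split_ifs with h1 h2
    · exact le_rfl
    · exfalso; apply h2
      have := (show FamilySat (Function.update x i ω) from h1).comp (fun j : Fin M => i.succAbove j)
      have e : Function.update x i ω ∘ (fun j : Fin M => i.succAbove j) = fun j : Fin M => x (i.succAbove j) := by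
        funext j
        simp [Function.comp, Fin.succAbove_ne]
      rwa [e] at this
    · positivity
    · exact le_rfl
  have hd01 : ∀ x, d x = 0 ∨ d x = 1 := fun x => by simp only [hd]; split_ifs <;> simp
  -- pointwise: `1 - μ² = 4 s (1 - s) ≤ 4 (d - s)`
  have hpt : ∀ x, 1 - proj ({i}ᶜ) f x ^ 2 ≤ 4 * (d x - s x) := by
    intro x
    rw [hμ x]
    rcases hd01 x with h | h
    · have : s x = 0 := le_antisymm (h ▸ hsd x) (hs0 x)
      rw [this, h]; norm_num
    · rw [h]; nlinarith [sq_nonneg (1 - s x)]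
  -- average: `E d = P(M)`, `E s = P(M+1)`
  have hEd : avg d = litArraySatProb k n M := by
    rw [← avg_comp_equiv (Fin.insertNthEquiv (fun _ : Fin (M + 1) => C) i) d]
    have : (fun a : C × (Fin M → C) => d (Fin.insertNthEquiv (fun _ : Fin (M + 1) => C) i a)) =
        fun a => if FamilySat a.2 then (1 : ℝ) else 0 := by
      funext a
      simp only [hd]
      have harg : (fun j : Fin M => (Fin.insertNthEquiv (fun _ : Fin (M + 1) => C) i a) (i.succAbove j)) = a.2 := by
        funext j
        simp [Fin.insertNthEquiv, Fin.insertNth_apply_succAbove]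
      rw [harg]
    rw [this, avg_prod_snd (fun q : Fin M → C => if FamilySat q then (1 : ℝ) else 0), avg_ite_familySat,
      Fintype.card_fin]
  have hEs : avg s = litArraySatProb k n (M + 1) := by
    rw [hs, ← avg_eq_avg_avg_update i (fun y : Fin (M + 1) → C => if LitArraySat y then (1 : ℝ) else 0)]
    exact avg_ite_litArraySat k n (M + 1)
  calc infl i f = 1 - avg (fun x => proj ({i}ᶜ) f x ^ 2) := infl_eq_one_sub i hpm
    _ = avg (fun x => 1 - proj ({i}ᶜ) f x ^ 2) := by rw [avg_sub, avg_const]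
    _ ≤ avg (fun x => 4 * (d x - s x)) := avg_mono hpt
    _ = 4 * (litArraySatProb k n M - litArraySatProb k n (M + 1)) := by
        rw [avg_mul_left, avg_sub, hEd, hEs]

/-- **`I[f_{M+1}] ≤ 4 (M+1) (P(M) - P(M+1))`.** [cite: Friedgut1999, §5] -/
theorem totalInfl_unsatInd_le (k n M : ℕ) [NeZero n] :
    totalInfl (unsatInd k n (M + 1)) ≤ 4 * (M + 1) * (litArraySatProb k n M - litArraySatProb k n (M + 1)) := by
  unfold totalInfl
  calc ∑ i, infl i (unsatInd k n (M + 1)) ≤ ∑ _i : Fin (M + 1), 4 * (litArraySatProb k n M - litArraySatProb k n (M + 1)) :=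
        Finset.sum_le_sum fun i _ => infl_unsatInd_le k n M i
    _ = 4 * (M + 1) * (litArraySatProb k n M - litArraySatProb k n (M + 1)) := by
        rw [Finset.sum_const, Finset.card_univ, Fintype.card_fin, nsmul_eq_mul]; push_cast; ring

/-! ### Bourgain's theorem in `k`-SAT terms -/

/-- If an indicator-average is positive, the event happens somewhere. [folklore] -/
theorem exists_of_avg_ite_pos {α : Type*} [Fintype α] {p : α → Prop} [DecidablePred p]
    (h : 0 < avg (fun a => if p a then (1 : ℝ) else 0)) : ∃ a, p a := by
  by_contra hcon
  push Not at hcon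
  have : avg (fun a => if p a then (1 : ℝ) else 0) = 0 := by
    rw [show (fun a => if p a then (1 : ℝ) else 0) = fun _ => 0 from funext fun a => if_neg (hcon a)]
    exact avg_zero
  linarith

/-- **The `k`-SAT dichotomy from Bourgain's theorem** (Friedgut 1999, §5: the application of
Thm. 5.2 / Bourgain's Prop. 1 to the property "unsatisfiable"; O'Donnell 2014, §10.5 and Exercise
10.40): for every `K` and `v₀ > 0` there are `τ > 0` and `L = ⌈4K/v₀⌉` such that for all `k, n ≥ 1, M`
with `I[f_M] ≤ K`, `Var[f_M] ≥ v₀` and `P(M - L) < P(M) + τ/2` (so that restrictions cannot boost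
satisfiability: `satExt ≤ P(M - L)`), EITHER
(Alt 1) with probability `≥ τ/2` the random formula has an unsatisfiable sub-formula of `≤ L`
clauses, OR (Alt 2) there is a formula `x` and slots `T`, `|T| ≤ L`, with `x|_T` satisfiable and
`satExt x T ≤ P(M) - τ/2` (planting the satisfiable `x|_T` lowers the satisfiability probability).
[cite: Friedgut1999, §5 (Thm. 5.2 and the proof of Cor. 5.3)] -/
theorem ksat_dichotomy (K v0 : ℝ) (hv0 : 0 < v0) :
    ∃ τ : ℝ, 0 < τ ∧ ∀ (k n M : ℕ) [NeZero n],
      totalInfl (unsatInd k n M) ≤ K → v0 ≤ variance (unsatInd k n M) →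
      litArraySatProb k n (M - ⌈4 * K / v0⌉₊) < litArraySatProb k n M + τ / 2 →
      (τ / 2 ≤ avg (fun x : Fin M → Fin k → Fin n × Bool =>
        if ∃ T : Finset (Fin M), T.card ≤ ⌈4 * K / v0⌉₊ ∧ ¬ FamilySat (fun j : T => x j.1)
        then (1 : ℝ) else 0)) ∨
      (∃ (x : Fin M → Fin k → Fin n × Bool) (T : Finset (Fin M)), T.card ≤ ⌈4 * K / v0⌉₊ ∧
        FamilySat (fun j : T => x j.1) ∧ satExt x T ≤ litArraySatProb k n M - τ / 2) := by
  classical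
  obtain ⟨τ, hτ, hB⟩ := bourgain_sharp_threshold K v0 hv0
  refine ⟨τ, hτ, ?_⟩
  intro k n M _ hI hvar hdrop
  set L : ℕ := ⌈4 * K / v0⌉₊ with hL
  set C := Fin k → Fin n × Bool
  have hne : Nonempty C := inferInstance
  set f := unsatInd k n M with hf
  set P := litArraySatProb k n M with hP
  have hpm := unsatInd_pm k n M
  have havg : avg f = 1 - 2 * P := avg_unsatInd k n M
  rcases hB f hpm hI hvar with hpos | hneg
  · -- boosters toward UNSAT: `proj T f x - avg f ≥ τ` iff `satExt x T ≤ P - τ/2`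
    have hequiv : ∀ (x : Fin M → C) (T : Finset (Fin M)), τ ≤ proj T f x - avg f ↔ satExt x T ≤ P - τ / 2 := by
      intro x T
      rw [proj_unsatInd, havg]
      constructor <;> intro h <;> linarith
    by_cases hAlt1 : τ / 2 ≤ avg (fun x : Fin M → C =>
        if ∃ T : Finset (Fin M), T.card ≤ L ∧ ¬ FamilySat (fun j : T => x j.1) then (1 : ℝ) else 0)
    · exact Or.inl hAlt1
    · right
      push Not at hAlt1
      -- the event "booster and no small unsat sub-formula" has positive probability
      have hsplit : ∀ x : Fin M → C,
          (if ∃ T : Finset (Fin M), T.card ≤ L ∧ τ ≤ proj T f x - avg f then (1 : ℝ) else 0) ≤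
          (if ∃ T : Finset (Fin M), T.card ≤ L ∧ ¬ FamilySat (fun j : T => x j.1) then (1 : ℝ) else 0) +
          (if (∃ T : Finset (Fin M), T.card ≤ L ∧ τ ≤ proj T f x - avg f) ∧
              ¬ (∃ T : Finset (Fin M), T.card ≤ L ∧ ¬ FamilySat (fun j : T => x j.1)) then (1 : ℝ) else 0) := by
        intro x
        split_ifs with h1 h2 h3 h3 <;> norm_num
        · exact h3 ⟨h1, h2⟩
      have h2 := hpos.trans (avg_mono hsplit)
      rw [avg_add] at h2
      have hpos' : 0 < avg (fun x : Fin M → C =>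
          if (∃ T : Finset (Fin M), T.card ≤ L ∧ τ ≤ proj T f x - avg f) ∧
            ¬ (∃ T : Finset (Fin M), T.card ≤ L ∧ ¬ FamilySat (fun j : T => x j.1)) then (1 : ℝ) else 0) := by
        linarith
      obtain ⟨x, ⟨T, hTL, hTτ⟩, hno⟩ := exists_of_avg_ite_pos hpos'
      push Not at hno
      exact ⟨x, T, hTL, hno T hTL, (hequiv x T).1 hTτ⟩
  · -- boosters toward SAT are impossible: `satExt x T ≤ P(M - L) < P + τ/2`
    exfalso
    have hpos' : 0 < avg (fun x : Fin M → C =>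
        if ∃ T : Finset (Fin M), T.card ≤ L ∧ τ ≤ avg f - proj T f x then (1 : ℝ) else 0) := hτ.trans_le hneg
    obtain ⟨x, T, hTL, hTτ⟩ := exists_of_avg_ite_pos hpos'
    rw [proj_unsatInd, havg] at hTτ
    have h1 : satExt x T ≤ litArraySatProb k n (M - L) := satExt_le_of_card_le x hTL
    linarith

end RandomKSat

end Literature.Computability.Complexity

end

/-!
# Random `k`-SAT, `k ≥ 3`: unsatisfiable sub-formulas of bounded size are rare at linear density

Refutation of the first alternative of the Bourgain dichotomy (`RandomKSat.ksat_dichotomy`) for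
`k ≥ 3` — the analogue of the first step of the proof of Friedgut 1999, Cor. 5.3 ("if `F̄` has a
subformula `R̄` that itself is a tautology … if such a formula `R` uses `r` variables it must
have at least `r + 1` clauses. The expected number of formulas of such an isomorphism type … tends
to zero"), with Tarsi's lemma replaced by the cruder fact that suffices for `k ≥ 3`: in a MINIMAL
unsatisfiable clause family every variable occurs at least twice (`two_le_card_fiber_of_minimal`),
so it spans at most `kc/2` variables; the probability that some `c ≤ L` clauses of `F_k(n, M)`,
`M ≤ C n`, span at most `kc/2` variables is `O_{k,L,C}(1/n)` (`avg_ite_exists_small_unsat_le`).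

## References

* E. Friedgut, *Sharp thresholds of graph properties, and the `k`-sat problem*, J. Amer. Math.
  Soc. 12 (1999), §5, proof of Cor. 5.3 [Friedgut1999].
* R. Aharoni, N. Linial, *Minimal non-two-colorable hypergraphs and minimal unsatisfiable
  formulas*, J. Combin. Theory Ser. A 43 (1986) (Tarsi's lemma; not needed for `k ≥ 3`).
-/

noncomputable section

namespace Literature.Computability.Complexity

namespace RandomKSat

open Finset ProductSpace
open scoped Classical

variable {k n M : ℕ}

/-! ### Minimal unsatisfiable sub-families -/

/-- The variables spanned by the clauses of `x` in the slots `T`. [cite: Friedgut1999, §5] -/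
def spanVars (x : Fin M → Fin k → Fin n × Bool) (T : Finset (Fin M)) : Finset (Fin n) :=
  (T ×ˢ (Finset.univ : Finset (Fin k))).image fun p => (x p.1 p.2).1

/-- An unsatisfiable sub-family contains a minimal (hence nonempty) unsatisfiable sub-family.
[folklore] -/
theorem exists_minimal_unsat (x : Fin M → Fin k → Fin n × Bool) {T : Finset (Fin M)}
    (hT : ¬ FamilySat (fun j : T => x j.1)) :
    ∃ T' ⊆ T, T'.Nonempty ∧ ¬ FamilySat (fun j : T' => x j.1) ∧
      ∀ T'' : Finset (Fin M), T'' ⊂ T' → FamilySat (fun j : T'' => x j.1) := by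
  set bad : Finset (Finset (Fin M)) := T.powerset.filter fun S => ¬ FamilySat (fun j : S => x j.1) with hbad
  have hne : bad.Nonempty := ⟨T, Finset.mem_filter.2 ⟨Finset.mem_powerset_self T, hT⟩⟩
  obtain ⟨T', hT'bad, hmin⟩ := Finset.exists_min_image bad Finset.card hne
  obtain ⟨hT'T, hT'unsat⟩ := Finset.mem_filter.1 hT'bad
  rw [Finset.mem_powerset] at hT'T
  refine ⟨T', hT'T, ?_, hT'unsat, ?_⟩
  · rw [Finset.nonempty_iff_ne_empty]
    rintro rfl
    apply hT'unsat
    exact familySat_of_isEmpty _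
  · intro T'' hT''
    by_contra hsat
    have hmem : T'' ∈ bad := Finset.mem_filter.2 ⟨Finset.mem_powerset.2 (hT''.1.trans hT'T), hsat⟩
    have := hmin T'' hmem
    exact absurd (Finset.card_lt_card hT'') (not_lt.2 this)

/-- **In a minimal unsatisfiable family every variable occurs at least twice** (otherwise satisfy
the rest and then set the private variable of the remaining clause). [folklore] -/
theorem two_le_card_fiber_of_minimal (x : Fin M → Fin k → Fin n × Bool) {T' : Finset (Fin M)}
    (hunsat : ¬ FamilySat (fun j : T' => x j.1))
    (hmin : ∀ T'' : Finset (Fin M), T'' ⊂ T' → FamilySat (fun j : T'' => x j.1))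
    {v : Fin n} (hv : v ∈ spanVars x T') :
    2 ≤ ((T' ×ˢ (Finset.univ : Finset (Fin k))).filter fun p => (x p.1 p.2).1 = v).card := by
  by_contra hlt
  push Not at hlt
  -- the fiber is a singleton `{(i₀, j₀)}`
  obtain ⟨p₀, hp₀, hp₀v⟩ := Finset.mem_image.1 hv
  have hp₀mem : p₀ ∈ (T' ×ˢ (Finset.univ : Finset (Fin k))).filter fun p => (x p.1 p.2).1 = v :=
    Finset.mem_filter.2 ⟨hp₀, hp₀v⟩
  have hcard1 : ((T' ×ˢ (Finset.univ : Finset (Fin k))).filter fun p => (x p.1 p.2).1 = v).card = 1 := by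
    have h1 : 1 ≤ ((T' ×ˢ (Finset.univ : Finset (Fin k))).filter fun p => (x p.1 p.2).1 = v).card :=
      Finset.card_pos.2 ⟨p₀, hp₀mem⟩
    omega
  obtain ⟨q, hq⟩ := Finset.card_eq_one.1 hcard1
  have huniq : ∀ p ∈ T' ×ˢ (Finset.univ : Finset (Fin k)), (x p.1 p.2).1 = v → p = p₀ := by
    intro p hp hpv
    have h1 : p ∈ ({q} : Finset (Fin M × Fin k)) := hq ▸ Finset.mem_filter.2 ⟨hp, hpv⟩
    have h2 : p₀ ∈ ({q} : Finset (Fin M × Fin k)) := hq ▸ hp₀mem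
    rw [Finset.mem_singleton] at h1 h2
    rw [h1, h2]
  have hi₀ : p₀.1 ∈ T' := (Finset.mem_product.1 hp₀).1
  -- satisfy `T' ∖ {i₀}` and then fix the variable `v`
  obtain ⟨σ, hσ⟩ := hmin (T'.erase p₀.1) (Finset.erase_ssubset hi₀)
  apply hunsat
  refine ⟨Function.update σ v (x p₀.1 p₀.2).2, ?_⟩
  rintro ⟨i, hi⟩
  by_cases hii : i = p₀.1
  · refine ⟨p₀.2, ?_⟩
    simp only [hii]
    rw [hp₀v, Function.update_self]
  · obtain ⟨j, hj⟩ := hσ ⟨i, Finset.mem_erase.2 ⟨hii, hi⟩⟩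
    refine ⟨j, ?_⟩
    simp only at hj ⊢
    have hne : (x i j).1 ≠ v := by
      intro h
      have := huniq (i, j) (Finset.mem_product.2 ⟨hi, Finset.mem_univ _⟩) h
      exact hii (congrArg Prod.fst this)
    rw [Function.update_of_ne hne]
    exact hj

/-- Hence a minimal unsatisfiable family of `c` clauses spans at most `kc/2` variables.
[cite: Friedgut1999, §5 (proof of Cor. 5.3)] -/
theorem two_mul_card_spanVars_le (x : Fin M → Fin k → Fin n × Bool) {T' : Finset (Fin M)}
    (hunsat : ¬ FamilySat (fun j : T' => x j.1))
    (hmin : ∀ T'' : Finset (Fin M), T'' ⊂ T' → FamilySat (fun j : T'' => x j.1)) :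
    2 * (spanVars x T').card ≤ k * T'.card := by
  have h := Finset.card_eq_sum_card_image (fun p : Fin M × Fin k => (x p.1 p.2).1)
    (T' ×ˢ (Finset.univ : Finset (Fin k)))
  rw [Finset.card_product, Finset.card_univ, Fintype.card_fin] at h
  have h2 : ∑ v ∈ spanVars x T', 2 ≤
      ∑ v ∈ spanVars x T', ((T' ×ˢ (Finset.univ : Finset (Fin k))).filter fun p => (x p.1 p.2).1 = v).card :=
    Finset.sum_le_sum fun v hv => two_le_card_fiber_of_minimal x hunsat hmin hv
  rw [Finset.sum_const, smul_eq_mul] at h2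
  unfold spanVars at h2 ⊢
  rw [← h] at h2
  linarith

/-! ### Rectangle events and their probability -/

/-- The clauses all of whose variables lie in `A`. [cite: Friedgut1999, §5] -/
def clausesIn (k : ℕ) (A : Finset (Fin n)) : Finset (Fin k → Fin n × Bool) :=
  Fintype.piFinset fun _ : Fin k => A ×ˢ (Finset.univ : Finset Bool)

/-- `|clausesIn A| = (2|A|)^k`. [folklore] -/
theorem card_clausesIn (k : ℕ) (A : Finset (Fin n)) : (clausesIn k A).card = (2 * A.card) ^ k := by
  unfold clausesIn
  rw [Fintype.card_piFinset, Finset.prod_const, Finset.card_univ, Fintype.card_fin, Finset.card_product,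
    Finset.card_univ, Fintype.card_bool, mul_comm]

/-- **Probability of a rectangle**: the clauses in the slots of `T'` all have their variables in
`A` with probability `(|A|/n)^{k|T'|}`. [folklore] -/
theorem avg_ite_rect (hn : 0 < n) (T' : Finset (Fin M)) (A : Finset (Fin n)) :
    avg (fun x : Fin M → Fin k → Fin n × Bool =>
      if ∀ i ∈ T', ∀ j, (x i j).1 ∈ A then (1 : ℝ) else 0) = ((A.card : ℝ) / n) ^ (k * T'.card) := by
  set R : Finset (Fin M → Fin k → Fin n × Bool) :=
    Fintype.piFinset fun i => if i ∈ T' then clausesIn k A else Finset.univ with hR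
  have hmem : ∀ x : Fin M → Fin k → Fin n × Bool, x ∈ R ↔ ∀ i ∈ T', ∀ j, (x i j).1 ∈ A := by
    intro x
    rw [hR, Fintype.mem_piFinset]
    constructor
    · intro h i hi j
      have := h i
      rw [if_pos hi] at this
      unfold clausesIn at this
      rw [Fintype.mem_piFinset] at this
      exact (Finset.mem_product.1 (this j)).1
    · intro h i
      split_ifs with hi
      · unfold clausesIn
        rw [Fintype.mem_piFinset]
        intro j
        exact Finset.mem_product.2 ⟨h i hi j, Finset.mem_univ _⟩
      · exact Finset.mem_univ _
  have hsum : ∑ x : Fin M → Fin k → Fin n × Bool, (if ∀ i ∈ T', ∀ j, (x i j).1 ∈ A then (1 : ℝ) else 0) = R.card := by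
    rw [Finset.sum_boole]
    congr 2
    ext x
    simp only [Finset.mem_filter, Finset.mem_univ, true_and]
    exact (hmem x).symm
  have hcardR : (R.card : ℝ) = ((2 * A.card : ℕ) : ℝ) ^ (k * T'.card) * ((2 * n : ℕ) : ℝ) ^ (k * (M - T'.card)) := by
    rw [hR, Fintype.card_piFinset]
    have e : ∀ i : Fin M, ((if i ∈ T' then clausesIn k A else Finset.univ).card : ℕ) =
        if i ∈ T' then (2 * A.card) ^ k else (2 * n) ^ k := by
      intro i
      split_ifs
      · exact card_clausesIn k A
      · rw [Finset.card_univ, Fintype.card_fun, Fintype.card_fin, Fintype.card_prod, Fintype.card_fin,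
          Fintype.card_bool, mul_comm]
    rw [Finset.prod_congr rfl (fun i _ => e i), Finset.prod_ite, Finset.prod_const, Finset.prod_const]
    have h1 : (Finset.univ.filter fun i : Fin M => i ∈ T') = T' := by ext i; simp
    have h2 : (Finset.univ.filter fun i : Fin M => ¬ i ∈ T').card = M - T'.card := by
      have : (Finset.univ.filter fun i : Fin M => ¬ i ∈ T') = T'ᶜ := by ext i; simp
      rw [this, Finset.card_compl, Fintype.card_fin]
    rw [h1, h2, ← pow_mul, ← pow_mul]
    push_cast
    ring
  have hcardU : (Fintype.card (Fin M → Fin k → Fin n × Bool) : ℝ) = ((2 * n : ℕ) : ℝ) ^ (k * M) := by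
    rw [Fintype.card_fun, Fintype.card_fin, Fintype.card_fun, Fintype.card_fin, Fintype.card_prod,
      Fintype.card_fin, Fintype.card_bool, ← pow_mul]
    push_cast
    ring
  unfold avg
  rw [hsum, hcardR, hcardU]
  have hT : T'.card ≤ M := by simpa using T'.card_le_univ
  have hsplit : k * M = k * T'.card + k * (M - T'.card) := by
    rw [← Nat.mul_add, Nat.add_sub_cancel' hT]
  rw [hsplit, pow_add, div_pow]
  have hn' : (n : ℝ) ≠ 0 := by exact_mod_cast hn.ne'
  have h2n : ((2 * n : ℕ) : ℝ) ≠ 0 := by positivity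
  have h2npow : ((2 * n : ℕ) : ℝ) ^ (k * (M - T'.card)) ≠ 0 := pow_ne_zero _ h2n
  field_simp
  push_cast
  ring

/-! ### The union bound -/

/-- The rectangle indicator `1[∀ i ∈ T', vars(x_i) ⊆ A]`. [folklore] -/
def rectInd (T' : Finset (Fin M)) (A : Finset (Fin n)) (x : Fin M → Fin k → Fin n × Bool) : ℝ :=
  if ∀ i ∈ T', ∀ j, (x i j).1 ∈ A then (1 : ℝ) else 0

/-- Rectangle indicators are nonnegative. [folklore] -/
theorem rectInd_nonneg (T' : Finset (Fin M)) (A : Finset (Fin n)) (x : Fin M → Fin k → Fin n × Bool) :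
    0 ≤ rectInd T' A x := by unfold rectInd; positivity

/-- The majorant of the union bound: over the number of clauses `c`, the slots `T'`, and the
variable sets `A` with `|A| ≤ kc/2`. [cite: Friedgut1999, §5 (proof of Cor. 5.3)] -/
def unionMajorant (k n M L : ℕ) (x : Fin M → Fin k → Fin n × Bool) : ℝ :=
  ∑ c ∈ Finset.Icc 1 L, ∑ T' ∈ Finset.powersetCard c (Finset.univ : Finset (Fin M)),
    ∑ A ∈ (Finset.univ : Finset (Fin n)).powerset.filter (fun A => A.card ≤ k * c / 2), rectInd T' A x

/-- The majorant is nonnegative. [folklore] -/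
theorem unionMajorant_nonneg (k n M L : ℕ) (x : Fin M → Fin k → Fin n × Bool) :
    0 ≤ unionMajorant k n M L x :=
  Finset.sum_nonneg fun _ _ => Finset.sum_nonneg fun _ _ => Finset.sum_nonneg fun _ _ => rectInd_nonneg _ _ _

/-- **Pointwise union bound**: a formula with an unsatisfiable sub-formula of `≤ L` clauses lies in
one of the rectangles. [cite: Friedgut1999, §5 (proof of Cor. 5.3)] -/
theorem ite_exists_small_unsat_le (L : ℕ) (x : Fin M → Fin k → Fin n × Bool) :
    (if ∃ T : Finset (Fin M), T.card ≤ L ∧ ¬ FamilySat (fun j : T => x j.1) then (1 : ℝ) else 0) ≤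
      unionMajorant k n M L x := by
  split_ifs with h
  · obtain ⟨T, hTL, hT⟩ := h
    obtain ⟨T', hT'T, hT'ne, hT'unsat, hT'min⟩ := exists_minimal_unsat x hT
    have hc1 : 1 ≤ T'.card := Finset.card_pos.2 hT'ne
    have hcL : T'.card ≤ L := (Finset.card_le_card hT'T).trans hTL
    have hspan := two_mul_card_spanVars_le x hT'unsat hT'min
    have hcmem : T'.card ∈ Finset.Icc 1 L := Finset.mem_Icc.2 ⟨hc1, hcL⟩
    have hT'mem : T' ∈ Finset.powersetCard T'.card (Finset.univ : Finset (Fin M)) :=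
      Finset.mem_powersetCard.2 ⟨Finset.subset_univ _, rfl⟩
    have hAmem : spanVars x T' ∈ (Finset.univ : Finset (Fin n)).powerset.filter
        (fun A => A.card ≤ k * T'.card / 2) := by
      refine Finset.mem_filter.2 ⟨Finset.mem_powerset.2 (Finset.subset_univ _), ?_⟩
      omega
    have hone : rectInd T' (spanVars x T') x = 1 := by
      unfold rectInd
      rw [if_pos]
      intro i hi j
      exact Finset.mem_image.2 ⟨(i, j), Finset.mem_product.2 ⟨hi, Finset.mem_univ _⟩, rfl⟩
    -- pick out the term `(c, T', A) = (|T'|, T', spanVars)`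
    set g3 : ℕ → Finset (Fin M) → Finset (Fin n) → ℝ := fun _ T'' A => rectInd T'' A x with hg3
    set g2 : ℕ → Finset (Fin M) → ℝ := fun c T'' =>
      ∑ A ∈ (Finset.univ : Finset (Fin n)).powerset.filter (fun A => A.card ≤ k * c / 2), g3 c T'' A with hg2
    set g1 : ℕ → ℝ := fun c => ∑ T'' ∈ Finset.powersetCard c (Finset.univ : Finset (Fin M)), g2 c T'' with hg1
    have e : unionMajorant k n M L x = ∑ c ∈ Finset.Icc 1 L, g1 c := rfl
    rw [e]
    have h3 : (1 : ℝ) ≤ g2 T'.card T' := by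
      rw [hg2, ← hone]
      exact Finset.single_le_sum (f := fun A => g3 T'.card T' A) (fun A _ => rectInd_nonneg _ _ _) hAmem
    have h2 : g2 T'.card T' ≤ g1 T'.card :=
      Finset.single_le_sum (f := fun T'' => g2 T'.card T'')
        (fun T'' _ => Finset.sum_nonneg fun A _ => rectInd_nonneg _ _ _) hT'mem
    have h1 : g1 T'.card ≤ ∑ c ∈ Finset.Icc 1 L, g1 c :=
      Finset.single_le_sum (f := g1)
        (fun c _ => Finset.sum_nonneg fun T'' _ => Finset.sum_nonneg fun A _ => rectInd_nonneg _ _ _) hcmem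
    linarith
  · exact unionMajorant_nonneg k n M L x

/-- The average of the majorant. [cite: Friedgut1999, §5 (proof of Cor. 5.3)] -/
theorem avg_unionMajorant (hn : 0 < n) (L : ℕ) :
    avg (unionMajorant k n M L) =
      ∑ c ∈ Finset.Icc 1 L, ∑ _T' ∈ Finset.powersetCard c (Finset.univ : Finset (Fin M)),
        ∑ A ∈ (Finset.univ : Finset (Fin n)).powerset.filter (fun A => A.card ≤ k * c / 2),
          ((A.card : ℝ) / n) ^ (k * c) := by
  unfold unionMajorant
  rw [avg_finset_sum]
  refine Finset.sum_congr rfl fun c _ => ?_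
  rw [avg_finset_sum]
  refine Finset.sum_congr rfl fun T' hT' => ?_
  rw [avg_finset_sum]
  refine Finset.sum_congr rfl fun A _ => ?_
  rw [(Finset.mem_powersetCard.1 hT').2.symm]
  exact avg_ite_rect hn T' A

/-- The explicit constant `A(k, L, C) = ∑_{c=0}^{L} C^c (kc+1) (kc)^{kc}`. [cite: Friedgut1999, §5] -/
def localUnsatConst (k L : ℕ) (Cst : ℝ) : ℝ :=
  ∑ c ∈ Finset.range (L + 1), Cst ^ c * ((k * c + 1 : ℕ) : ℝ) * ((k * c : ℕ) : ℝ) ^ (k * c)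

/-- `A(k, L, C) ≥ 0` for `C ≥ 0`. [folklore] -/
theorem localUnsatConst_nonneg (k L : ℕ) {Cst : ℝ} (hC : 0 ≤ Cst) : 0 ≤ localUnsatConst k L Cst :=
  Finset.sum_nonneg fun c _ => by positivity

/-- The number of subsets of `Fin n` with at most `D` elements is at most `(D+1) n^D` (`n ≥ 1`).
[folklore] -/
theorem card_filter_card_le_le (hn : 1 ≤ n) (D : ℕ) :
    ((Finset.univ : Finset (Fin n)).powerset.filter (fun A => A.card ≤ D)).card ≤ (D + 1) * n ^ D := by
  have h1 : ((Finset.univ : Finset (Fin n)).powerset.filter (fun A => A.card ≤ D)) =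
      (Finset.range (D + 1)).biUnion fun d => Finset.powersetCard d (Finset.univ : Finset (Fin n)) := by
    ext A
    simp only [Finset.mem_filter, Finset.mem_powerset, Finset.subset_univ, true_and, Finset.mem_biUnion,
      Finset.mem_range, Finset.mem_powersetCard]
    constructor
    · intro h; exact ⟨A.card, Nat.lt_succ_of_le h, rfl⟩
    · rintro ⟨d, hd, rfl⟩; exact Nat.le_of_lt_succ hd
  rw [h1]
  calc ((Finset.range (D + 1)).biUnion fun d => Finset.powersetCard d (Finset.univ : Finset (Fin n))).card
      ≤ ∑ d ∈ Finset.range (D + 1), (Finset.powersetCard d (Finset.univ : Finset (Fin n))).card :=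
        Finset.card_biUnion_le
    _ ≤ ∑ _d ∈ Finset.range (D + 1), n ^ D := by
        refine Finset.sum_le_sum fun d hd => ?_
        rw [Finset.card_powersetCard, Finset.card_univ, Fintype.card_fin]
        calc n.choose d ≤ n ^ d := Nat.choose_le_pow n d
          _ ≤ n ^ D := Nat.pow_le_pow_right hn (Nat.le_of_lt_succ (Finset.mem_range.1 hd))
    _ = (D + 1) * n ^ D := by rw [Finset.sum_const, Finset.card_range, smul_eq_mul]

/-- **One term of the union bound** (`k ≥ 3`, `M ≤ C n`, `1 ≤ c`):
`#{T' : |T'| = c} · ∑_{|A| ≤ kc/2} (|A|/n)^{kc} ≤ C^c (kc+1) (kc)^{kc} / n`, because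
`M^c n^{kc/2} (kc/2)^{kc} / n^{kc}` and `kc - kc/2 ≥ c + 1`. [cite: Friedgut1999, §5 (proof of Cor. 5.3)] -/
theorem unionBound_term_le (hk : 3 ≤ k) (hn : 1 ≤ n) {c : ℕ} (hc1 : 1 ≤ c) {Cst : ℝ} (hC : 0 ≤ Cst)
    (hM : (M : ℝ) ≤ Cst * n) :
    ∑ _T' ∈ Finset.powersetCard c (Finset.univ : Finset (Fin M)),
      ∑ A ∈ (Finset.univ : Finset (Fin n)).powerset.filter (fun A => A.card ≤ k * c / 2),
        ((A.card : ℝ) / n) ^ (k * c) ≤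
      Cst ^ c * ((k * c + 1 : ℕ) : ℝ) * ((k * c : ℕ) : ℝ) ^ (k * c) / n := by
  have hn0 : (0 : ℝ) < n := by exact_mod_cast hn
  set D := k * c / 2 with hD
  have hDle : D ≤ k * c := Nat.div_le_self _ _
  -- exponent bookkeeping: `k c ≥ c + D + 1`
  have hexp : c + D + 1 ≤ k * c := by
    have : 3 * c ≤ k * c := Nat.mul_le_mul_right c hk
    omega
  have hinner : ∀ A ∈ (Finset.univ : Finset (Fin n)).powerset.filter (fun A => A.card ≤ D),
      ((A.card : ℝ) / n) ^ (k * c) ≤ ((D : ℝ) / n) ^ (k * c) := by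
    intro A hA
    have hAD : (A.card : ℝ) ≤ D := by exact_mod_cast (Finset.mem_filter.1 hA).2
    exact pow_le_pow_left₀ (by positivity) (div_le_div_of_nonneg_right hAD hn0.le) _
  have hcount1 : ((Finset.powersetCard c (Finset.univ : Finset (Fin M))).card : ℝ) ≤ (M : ℝ) ^ c := by
    rw [Finset.card_powersetCard, Finset.card_univ, Fintype.card_fin]
    exact_mod_cast Nat.choose_le_pow M c
  have hcount2 : ((((Finset.univ : Finset (Fin n)).powerset.filter (fun A => A.card ≤ D)).card : ℝ)) ≤
      ((D + 1 : ℕ) : ℝ) * (n : ℝ) ^ D := by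
    exact_mod_cast card_filter_card_le_le hn D
  have hpowM : (M : ℝ) ^ c ≤ Cst ^ c * (n : ℝ) ^ c := by
    rw [← mul_pow]; exact pow_le_pow_left₀ (by positivity) hM c
  -- `n^{c + D} ≤ n^{kc} / n`
  have hnpow : (n : ℝ) ^ c * (n : ℝ) ^ D * n ≤ (n : ℝ) ^ (k * c) := by
    rw [← pow_add, ← pow_succ]
    exact pow_le_pow_right₀ (by exact_mod_cast hn) hexp
  calc ∑ _T' ∈ Finset.powersetCard c (Finset.univ : Finset (Fin M)),
        ∑ A ∈ (Finset.univ : Finset (Fin n)).powerset.filter (fun A => A.card ≤ D), ((A.card : ℝ) / n) ^ (k * c)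
      ≤ ∑ _T' ∈ Finset.powersetCard c (Finset.univ : Finset (Fin M)),
          ∑ _A ∈ (Finset.univ : Finset (Fin n)).powerset.filter (fun A => A.card ≤ D), ((D : ℝ) / n) ^ (k * c) :=
        Finset.sum_le_sum fun T' _ => Finset.sum_le_sum hinner
    _ = ((Finset.powersetCard c (Finset.univ : Finset (Fin M))).card : ℝ) *
          (((((Finset.univ : Finset (Fin n)).powerset.filter (fun A => A.card ≤ D)).card : ℝ)) *
            ((D : ℝ) / n) ^ (k * c)) := by
        rw [Finset.sum_const, Finset.sum_const, nsmul_eq_mul, nsmul_eq_mul]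
    _ ≤ (Cst ^ c * (n : ℝ) ^ c) * ((((D + 1 : ℕ) : ℝ) * (n : ℝ) ^ D) * ((D : ℝ) / n) ^ (k * c)) := by
        apply mul_le_mul (hcount1.trans hpowM) _ (by positivity) (by positivity)
        exact mul_le_mul_of_nonneg_right hcount2 (by positivity)
    _ = Cst ^ c * ((D + 1 : ℕ) : ℝ) * (D : ℝ) ^ (k * c) * (((n : ℝ) ^ c * (n : ℝ) ^ D) / (n : ℝ) ^ (k * c)) := by
        rw [div_pow]; ring
    _ ≤ Cst ^ c * ((D + 1 : ℕ) : ℝ) * (D : ℝ) ^ (k * c) * (1 / n) := by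
        apply mul_le_mul_of_nonneg_left _ (by positivity)
        rw [div_le_div_iff₀ (by positivity) hn0, one_mul]
        exact hnpow
    _ ≤ Cst ^ c * ((k * c + 1 : ℕ) : ℝ) * ((k * c : ℕ) : ℝ) ^ (k * c) * (1 / n) := by
        apply mul_le_mul_of_nonneg_right _ (by positivity)
        apply mul_le_mul _ _ (by positivity) (by positivity)
        · apply mul_le_mul_of_nonneg_left _ (by positivity)
          exact_mod_cast Nat.succ_le_succ hDle
        · exact pow_le_pow_left₀ (by positivity) (by exact_mod_cast hDle) _
    _ = _ := by rw [mul_one_div]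

/-- **Unsatisfiable sub-formulas of at most `L` clauses are rare** (Friedgut 1999, proof of
Cor. 5.3, for `k ≥ 3`): if `M ≤ C n` then
`Pr[F_k(n, M) has an unsatisfiable sub-formula of ≤ L clauses] ≤ A(k, L, C)/n`.
[cite: Friedgut1999, §5 (proof of Cor. 5.3)] -/
theorem avg_ite_exists_small_unsat_le (hk : 3 ≤ k) (hn : 1 ≤ n) (L : ℕ) {Cst : ℝ} (hC : 0 ≤ Cst)
    (hM : (M : ℝ) ≤ Cst * n) :
    avg (fun x : Fin M → Fin k → Fin n × Bool =>
      if ∃ T : Finset (Fin M), T.card ≤ L ∧ ¬ FamilySat (fun j : T => x j.1) then (1 : ℝ) else 0) ≤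
      localUnsatConst k L Cst / n := by
  have hn0 : (0 : ℝ) < n := by exact_mod_cast hn
  calc _ ≤ avg (unionMajorant k n M L) := avg_mono (ite_exists_small_unsat_le L)
    _ = _ := avg_unionMajorant hn L
    _ ≤ ∑ c ∈ Finset.Icc 1 L, Cst ^ c * ((k * c + 1 : ℕ) : ℝ) * ((k * c : ℕ) : ℝ) ^ (k * c) / n :=
        Finset.sum_le_sum fun c hc => unionBound_term_le hk hn (Finset.mem_Icc.1 hc).1 hC hM
    _ ≤ ∑ c ∈ Finset.range (L + 1), Cst ^ c * ((k * c + 1 : ℕ) : ℝ) * ((k * c : ℕ) : ℝ) ^ (k * c) / n := by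
        apply Finset.sum_le_sum_of_subset_of_nonneg
        · intro c hc
          rw [Finset.mem_range]
          exact Nat.lt_succ_of_le (Finset.mem_Icc.1 hc).2
        · intro c _ _; positivity
    _ = localUnsatConst k L Cst / n := by
        unfold localUnsatConst
        rw [Finset.sum_div]

end RandomKSat

end Literature.Computability.Complexity

end

/-!
# Random `k`-SAT: unit literals of clauses meeting a fixed variable set, and one slot of the hybrid

Preparations for the refutation of the second ("planted booster") alternative of the Bourgain
dichotomy (Part 4 of this file), following E. Friedgut, J. Amer. Math. Soc. 12 (1999), §5,
Claims 5.4–5.5 and **Lemma 5.7** ("For `A ⊆ {0,1}ⁿ` define `A` to be `(d, m, ε)`-coverable if the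
probability for the union of a random choice of `d` subcubes of co-dimension `m` to cover `A` is at
least `ε` … any `A` that is `(d,1,ε)`-coverable is `(f(n), k, ε)`-coverable"), in the
with-replacement literal model and in counting form:

* clauses are sorted relative to a set `V₀` of variables: `Meets` (some variable in `V₀`),
  `Inside` (all variables in `V₀`), type B = `Meets ∧ ¬Inside`; `unitLit V₀ c` is the literal of
  `c` at its first position outside `V₀`;
* `sum_typeB_ite_unitLit_mem` — **the unit literal of a uniform type-B clause is uniform among
  the literals outside `V₀`** (a sign-adjusted transposition of two outside variables is a
  bijection of type-B clauses transporting one fiber to the other: `litSwap`,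
  `card_typeB_filter_unitLit_eq`);
* `avg_ite_forall_mem` — `Pr[all m i.i.d. uniform coordinates lie in S] = (|S|/|α|)^m`;
* `single_slot_le` — **one step of Lemma 5.7**: for any set `S'` of surviving assignments, the
  probability that a uniform clause is of type B AND its unit literal is false on all of `S'`
  exceeds the probability that it is of type B AND `g` fresh uniform clauses jointly kill `S'` by
  at most `q_B (α₀ + (1 - (α₀/2)^k)^g)` (`q_B = Pr[type B]`, any `α₀ ∈ (0,1]`, provided
  `2|V₀| ≤ n`): a unit literal kills with probability `α = |dead literals|/|outside literals|`,
  one uniform clause with probability `≥ (α/2)^k`.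

## References

* E. Friedgut, *Sharp thresholds of graph properties, and the `k`-sat problem*, J. Amer. Math.
  Soc. 12 (1999), §5, Claims 5.4–5.5, Lemma 5.7 [Friedgut1999].
-/

noncomputable section

namespace Literature.Computability.Complexity

namespace RandomKSat

open Finset ProductSpace
open scoped Classical

variable {k n : ℕ}

/-! ### Literals, clauses, types relative to `V₀` -/

/-- The literal `(v, b)` is true under `σ` iff `σ v = b`. [cite: AchlioptasPeres2004, §1 (p. 1)] -/
def litTrue (σ : Fin n → Bool) (l : Fin n × Bool) : Prop := σ l.1 = l.2

/-- A clause (disjunction) is satisfied iff some literal is true. [cite: AchlioptasPeres2004, §1 (p. 1)] -/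
def ClauseSat (σ : Fin n → Bool) (c : Fin k → Fin n × Bool) : Prop := ∃ j, litTrue σ (c j)

/-- `FamilySat` in terms of `ClauseSat`. [folklore] -/
theorem familySat_iff {ι : Type*} (Φ : ι → Fin k → Fin n × Bool) :
    FamilySat Φ ↔ ∃ σ : Fin n → Bool, ∀ i, ClauseSat σ (Φ i) := Iff.rfl

/-- The clause has a variable in `V₀`. [cite: Friedgut1999, §5 (Claim 5.4)] -/
def Meets (V0 : Finset (Fin n)) (c : Fin k → Fin n × Bool) : Prop := ∃ j, (c j).1 ∈ V0

/-- All variables of the clause are in `V₀`. [cite: Friedgut1999, §5 (Claim 5.4)] -/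
def Inside (V0 : Finset (Fin n)) (c : Fin k → Fin n × Bool) : Prop := ∀ j, (c j).1 ∈ V0

/-- Type B: meets `V₀` but is not inside it (these clauses shrink when `V₀` is assigned).
[cite: Friedgut1999, §5 (Claim 5.4)] -/
def TypeB (V0 : Finset (Fin n)) (c : Fin k → Fin n × Bool) : Prop := Meets V0 c ∧ ¬ Inside V0 c

/-- The positions of a clause whose variable is outside `V₀`. [cite: Friedgut1999, §5] -/
def outPos (V0 : Finset (Fin n)) (c : Fin k → Fin n × Bool) : Finset (Fin k) :=
  Finset.univ.filter fun j => (c j).1 ∉ V0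

/-- The unit literal of a clause: its literal at the first position outside `V₀` (Friedgut: "Assume
that in the second stage the clauses added are not of size `k - 1` but of size `1`"); junk `c 0`
if the clause is inside `V₀`. [cite: Friedgut1999, §5 (before Lemma 5.6)] -/
def unitLit [NeZero k] (V0 : Finset (Fin n)) (c : Fin k → Fin n × Bool) : Fin n × Bool :=
  if h : (outPos V0 c).Nonempty then c ((outPos V0 c).min' h) else c 0

/-- The unit literal is a literal of the clause. [folklore] -/
theorem unitLit_mem [NeZero k] (V0 : Finset (Fin n)) (c : Fin k → Fin n × Bool) : ∃ j, unitLit V0 c = c j := by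
  unfold unitLit
  split_ifs with h
  · exact ⟨_, rfl⟩
  · exact ⟨0, rfl⟩

/-- For a clause not inside `V₀` the unit literal's variable is outside `V₀`. [folklore] -/
theorem unitLit_fst_not_mem [NeZero k] {V0 : Finset (Fin n)} {c : Fin k → Fin n × Bool}
    (h : ¬ Inside V0 c) : (unitLit V0 c).1 ∉ V0 := by
  have hne : (outPos V0 c).Nonempty := by
    obtain ⟨j, hj⟩ := not_forall.1 h
    exact ⟨j, Finset.mem_filter.2 ⟨Finset.mem_univ _, hj⟩⟩
  unfold unitLit
  rw [dif_pos hne]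
  exact (Finset.mem_filter.1 (Finset.min'_mem _ hne)).2

/-! ### The symmetry: a sign-adjusted transposition of two literals -/

/-- The literal map exchanging `a` and `b` (and their negations): transpose the variables of `a`
and `b` and, on these variables, shift the sign by `a.2 ⊕ b.2`. [folklore] -/
def litSwap (a b : Fin n × Bool) (l : Fin n × Bool) : Fin n × Bool :=
  (Equiv.swap a.1 b.1 l.1, if l.1 = a.1 ∨ l.1 = b.1 then xor l.2 (xor a.2 b.2) else l.2)

/-- `litSwap a b a = b`. [folklore] -/
theorem litSwap_apply_left (a b : Fin n × Bool) : litSwap a b a = b := by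
  unfold litSwap
  rw [Equiv.swap_apply_left, if_pos (Or.inl rfl)]
  ext
  · rfl
  · simp only
    cases a.2 <;> cases b.2 <;> rfl

/-- `litSwap a b` is an involution. [folklore] -/
theorem litSwap_litSwap (a b l : Fin n × Bool) : litSwap a b (litSwap a b l) = l := by
  obtain ⟨v, s⟩ := l
  unfold litSwap
  simp only [Equiv.swap_apply_self, Prod.mk.injEq, true_and]
  by_cases h : v = a.1 ∨ v = b.1
  · have h' : Equiv.swap a.1 b.1 v = a.1 ∨ Equiv.swap a.1 b.1 v = b.1 := by
      rcases h with h | h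
      · rw [h, Equiv.swap_apply_left]; exact Or.inr rfl
      · rw [h, Equiv.swap_apply_right]; exact Or.inl rfl
    rw [if_pos h', if_pos h]
    cases s <;> cases a.2 <;> cases b.2 <;> rfl
  · have h' : ¬ (Equiv.swap a.1 b.1 v = a.1 ∨ Equiv.swap a.1 b.1 v = b.1) := by
      push Not at h ⊢
      rw [Equiv.swap_apply_of_ne_of_ne h.1 h.2]
      exact h
    rw [if_neg h', if_neg h]

/-- `litSwap a b` does not move variables into or out of `V₀` when `a, b` are outside. [folklore] -/
theorem litSwap_fst_mem_iff {V0 : Finset (Fin n)} {a b : Fin n × Bool} (ha : a.1 ∉ V0) (hb : b.1 ∉ V0)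
    (l : Fin n × Bool) : (litSwap a b l).1 ∈ V0 ↔ l.1 ∈ V0 := by
  unfold litSwap
  simp only
  by_cases h1 : l.1 = a.1
  · rw [h1, Equiv.swap_apply_left]; exact ⟨fun h => absurd h hb, fun h => absurd h ha⟩
  · by_cases h2 : l.1 = b.1
    · rw [h2, Equiv.swap_apply_right]; exact ⟨fun h => absurd h ha, fun h => absurd h hb⟩
    · rw [Equiv.swap_apply_of_ne_of_ne h1 h2]

/-- The outside positions are invariant under the symmetry. [folklore] -/
theorem outPos_comp {V0 : Finset (Fin n)} {a b : Fin n × Bool} (ha : a.1 ∉ V0) (hb : b.1 ∉ V0)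
    (c : Fin k → Fin n × Bool) : outPos V0 (litSwap a b ∘ c) = outPos V0 c := by
  unfold outPos
  ext j
  simp only [Finset.mem_filter, Finset.mem_univ, true_and, Function.comp]
  rw [litSwap_fst_mem_iff ha hb]

/-- The unit literal is transported by the symmetry. [folklore] -/
theorem unitLit_comp [NeZero k] {V0 : Finset (Fin n)} {a b : Fin n × Bool} (ha : a.1 ∉ V0) (hb : b.1 ∉ V0)
    (c : Fin k → Fin n × Bool) : unitLit V0 (litSwap a b ∘ c) = litSwap a b (unitLit V0 c) := by
  unfold unitLit
  simp only [outPos_comp ha hb]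
  split_ifs <;> rfl

/-- Type B is invariant under the symmetry. [folklore] -/
theorem typeB_comp_iff {V0 : Finset (Fin n)} {a b : Fin n × Bool} (ha : a.1 ∉ V0) (hb : b.1 ∉ V0)
    (c : Fin k → Fin n × Bool) : TypeB V0 (litSwap a b ∘ c) ↔ TypeB V0 c := by
  unfold TypeB Meets Inside
  simp only [Function.comp, litSwap_fst_mem_iff ha hb]

/-- **All fibers of the unit literal over type-B clauses have the same size.** [folklore] -/
theorem card_typeB_filter_unitLit_eq [NeZero k] {V0 : Finset (Fin n)} {a b : Fin n × Bool}
    (ha : a.1 ∉ V0) (hb : b.1 ∉ V0) :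
    ((Finset.univ.filter fun c : Fin k → Fin n × Bool => TypeB V0 c ∧ unitLit V0 c = a).card) =
      ((Finset.univ.filter fun c : Fin k → Fin n × Bool => TypeB V0 c ∧ unitLit V0 c = b).card) := by
  apply Finset.card_bij (fun c _ => litSwap a b ∘ c)
  · intro c hc
    obtain ⟨hB, hu⟩ := (Finset.mem_filter.1 hc).2
    refine Finset.mem_filter.2 ⟨Finset.mem_univ _, (typeB_comp_iff ha hb c).2 hB, ?_⟩
    rw [unitLit_comp ha hb, hu, litSwap_apply_left]
  · intro c₁ _ c₂ _ h
    funext j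
    have := congrFun h j
    simp only [Function.comp] at this
    rw [← litSwap_litSwap a b (c₁ j), this, litSwap_litSwap]
  · intro c hc
    obtain ⟨hB, hu⟩ := (Finset.mem_filter.1 hc).2
    refine ⟨litSwap a b ∘ c, Finset.mem_filter.2 ⟨Finset.mem_univ _, (typeB_comp_iff ha hb c).2 hB, ?_⟩, ?_⟩
    · rw [unitLit_comp ha hb, hu]
      have := litSwap_litSwap a b a
      rw [litSwap_apply_left] at this
      exact this
    · funext j
      simp only [Function.comp, litSwap_litSwap]

/-- **The unit literal of a uniform type-B clause is uniform among the outside literals**, in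
counting form: for `F' ⊆ {outside literals}`,
`#{c ∈ B : unitLit c ∈ F'} · #{outside literals} = |F'| · |B|`. [cite: Friedgut1999, §5 (Lemma 5.7, "random choice of half cubes")] -/
theorem sum_typeB_ite_unitLit_mem [NeZero k] (V0 : Finset (Fin n)) (F' : Finset (Fin n × Bool))
    (hF' : ∀ l ∈ F', l.1 ∉ V0) :
    (∑ c ∈ Finset.univ.filter (fun c : Fin k → Fin n × Bool => TypeB V0 c),
        (if unitLit V0 c ∈ F' then (1 : ℝ) else 0)) *
      ((Finset.univ.filter fun l : Fin n × Bool => l.1 ∉ V0).card : ℝ) =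
      (F'.card : ℝ) * ((Finset.univ.filter fun c : Fin k → Fin n × Bool => TypeB V0 c).card : ℝ) := by
  set B := Finset.univ.filter (fun c : Fin k → Fin n × Bool => TypeB V0 c) with hB
  set Lit' := Finset.univ.filter (fun l : Fin n × Bool => l.1 ∉ V0) with hLit'
  set N : (Fin n × Bool) → ℕ := fun a => (Finset.univ.filter fun c : Fin k → Fin n × Bool =>
    TypeB V0 c ∧ unitLit V0 c = a).card with hN
  -- the count in the statement, fiberwise
  have hsum : ∑ c ∈ B, (if unitLit V0 c ∈ F' then (1 : ℝ) else 0) = ∑ a ∈ F', (N a : ℝ) := by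
    rw [Finset.sum_boole]
    have h := Finset.card_eq_sum_card_fiberwise (f := fun c : Fin k → Fin n × Bool => unitLit V0 c)
      (s := B.filter fun c => unitLit V0 c ∈ F') (t := F') (fun c hc => (Finset.mem_filter.1 hc).2)
    have e : ∀ a ∈ F', ((B.filter fun c => unitLit V0 c ∈ F').filter fun c => unitLit V0 c = a) =
        Finset.univ.filter fun c : Fin k → Fin n × Bool => TypeB V0 c ∧ unitLit V0 c = a := by
      intro a ha
      ext c
      simp only [hB, Finset.mem_filter, Finset.mem_univ, true_and]
      constructor
      · rintro ⟨⟨h1, _⟩, h3⟩; exact ⟨h1, h3⟩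
      · rintro ⟨h1, h3⟩; exact ⟨⟨h1, h3 ▸ ha⟩, h3⟩
    rw [Finset.sum_congr rfl (fun a ha => by rw [e a ha])] at h
    exact_mod_cast h
  -- `|B|` fiberwise over the outside literals
  have hBcard : (B.card : ℝ) = ∑ a ∈ Lit', (N a : ℝ) := by
    have h := Finset.card_eq_sum_card_fiberwise (f := fun c : Fin k → Fin n × Bool => unitLit V0 c)
      (s := B) (t := Lit') (fun c hc => by
        have hB' : TypeB V0 c := (Finset.mem_filter.1 hc).2
        exact Finset.mem_filter.2 ⟨Finset.mem_univ _, unitLit_fst_not_mem hB'.2⟩)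
    have e : ∀ a ∈ Lit', (B.filter fun c => unitLit V0 c = a) =
        Finset.univ.filter fun c : Fin k → Fin n × Bool => TypeB V0 c ∧ unitLit V0 c = a := by
      intro a _
      ext c
      simp only [hB, Finset.mem_filter, Finset.mem_univ, true_and]
    rw [Finset.sum_congr rfl (fun a ha => by rw [e a ha])] at h
    exact_mod_cast h
  -- all fibers over outside literals are equal
  by_cases hLe : Lit'.Nonempty
  · obtain ⟨b, hb⟩ := hLe
    have hb' : b.1 ∉ V0 := (Finset.mem_filter.1 hb).2
    have hconst : ∀ a ∈ Lit', N a = N b := fun a ha =>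
      card_typeB_filter_unitLit_eq (Finset.mem_filter.1 ha).2 hb'
    have hconstF : ∀ a ∈ F', N a = N b := fun a ha =>
      card_typeB_filter_unitLit_eq (hF' a ha) hb'
    have e1 : ∑ a ∈ F', (N a : ℝ) = ∑ _a ∈ F', (N b : ℝ) :=
      Finset.sum_congr rfl (fun a ha => by rw [hconstF a ha])
    have e2 : ∑ a ∈ Lit', (N a : ℝ) = ∑ _a ∈ Lit', (N b : ℝ) :=
      Finset.sum_congr rfl (fun a ha => by rw [hconst a ha])
    rw [hsum, hBcard, e1, e2, Finset.sum_const, Finset.sum_const, nsmul_eq_mul, nsmul_eq_mul]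
    ring
  · -- no outside literal: `F' = ∅`
    have hF'e : F' = ∅ := by
      rw [Finset.not_nonempty_iff_eq_empty] at hLe
      rw [Finset.eq_empty_iff_forall_notMem]
      intro l hl
      have : l ∈ Lit' := Finset.mem_filter.2 ⟨Finset.mem_univ _, hF' l hl⟩
      rw [hLe] at this
      exact Finset.notMem_empty l this
    rw [hF'e]
    simp

/-! ### Counting: all coordinates in a set -/

/-- **`Pr[all m i.i.d. uniform coordinates lie in S] = (|S|/|α|)^m`.** [folklore] -/
theorem avg_ite_forall_mem {α : Type*} [Fintype α] [Nonempty α] (S : Finset α) (m : ℕ)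
    [∀ f : Fin m → α, Decidable (∀ l, f l ∈ S)] :
    avg (fun f : Fin m → α => if ∀ l, f l ∈ S then (1 : ℝ) else 0) =
      ((S.card : ℝ) / Fintype.card α) ^ m := by
  unfold avg
  rw [Finset.sum_boole]
  have h1 : (Finset.univ.filter fun f : Fin m → α => ∀ l, f l ∈ S) = Fintype.piFinset fun _ : Fin m => S := by
    ext f
    simp [Fintype.mem_piFinset]
  rw [h1, Fintype.card_piFinset, Finset.prod_const, Finset.card_univ, Fintype.card_fin, Fintype.card_fun,
    Fintype.card_fin]
  push_cast
  rw [div_pow]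

/-! ### One slot of the hybrid argument (Friedgut's Lemma 5.7, one step) -/

/-- The outside literals that are false on every surviving assignment. [cite: Friedgut1999, §5 (Lemma 5.7)] -/
def deadLits (V0 : Finset (Fin n)) (S' : Finset (Fin n → Bool)) : Finset (Fin n × Bool) :=
  Finset.univ.filter fun l => l.1 ∉ V0 ∧ ∀ σ ∈ S', ¬ litTrue σ l

/-- A clause all of whose literals are dead is falsified by every survivor. [cite: Friedgut1999, §5 (Lemma 5.7)] -/
theorem clauseKill_of_forall_mem_deadLits {V0 : Finset (Fin n)} {S' : Finset (Fin n → Bool)}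
    {u : Fin k → Fin n × Bool} (hu : ∀ j, u j ∈ deadLits V0 S') : ∀ σ ∈ S', ¬ ClauseSat σ u := by
  intro σ hσ ⟨j, hj⟩
  exact (Finset.mem_filter.1 (hu j)).2.2 σ hσ hj

/-- The elementary inequality behind Lemma 5.7: for `α, α₀ ∈ [0,1]`, `0 < α₀`,
`α - (1 - (1 - (α/2)^k)^g) ≤ α₀ + (1 - (α₀/2)^k)^g`. [cite: Friedgut1999, §5 (Lemma 5.7)] -/
theorem sub_cover_le (k g : ℕ) {α α0 : ℝ} (hα : 0 ≤ α) (hα1 : α ≤ 1) (hα0 : 0 < α0) (hα01 : α0 ≤ 1) :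
    α - (1 - (1 - (α / 2) ^ k) ^ g) ≤ α0 + (1 - (α0 / 2) ^ k) ^ g := by
  have hb0 : 0 ≤ 1 - (α / 2) ^ k := by
    have : (α / 2) ^ k ≤ 1 := pow_le_one₀ (by positivity) (by linarith)
    linarith
  have hb1 : 1 - (α / 2) ^ k ≤ 1 := by
    have : 0 ≤ (α / 2) ^ k := by positivity
    linarith
  have hg1 : (1 - (α / 2) ^ k) ^ g ≤ 1 := pow_le_one₀ hb0 hb1
  have hg0' : 0 ≤ (1 - (α0 / 2) ^ k) ^ g := by
    apply pow_nonneg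
    have : (α0 / 2) ^ k ≤ 1 := pow_le_one₀ (by positivity) (by linarith)
    linarith
  rcases le_or_gt α α0 with h | h
  · linarith
  · -- `α ≥ α₀`: the cover failure probability is monotone
    have hmono : (1 - (α / 2) ^ k) ^ g ≤ (1 - (α0 / 2) ^ k) ^ g := by
      apply pow_le_pow_left₀ hb0
      have : (α0 / 2) ^ k ≤ (α / 2) ^ k := pow_le_pow_left₀ (by positivity) (by linarith) k
      linarith
    linarith

/-- **One slot of the hybrid** (Friedgut 1999, Lemma 5.7, the step "picking at random `f/d` cubes
of co-dimension `k` instead of the last half cube decreases the probability of ending with a cover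
of `A` by no more than …"): for every set `S'` of surviving assignments,
`Pr_c[c ∈ B ∧ unitLit(c) false on S'] ≤ Pr_{c, r₁..r_g}[c ∈ B ∧ ∀ σ ∈ S' ∃ l, σ falsifies r_l]
  + q_B (α₀ + (1 - (α₀/2)^k)^g)`, provided `2|V₀| ≤ n`. [cite: Friedgut1999, §5 (Lemma 5.7)] -/
theorem single_slot_le [NeZero k] {V0 : Finset (Fin n)} (hV0 : 2 * V0.card ≤ n) (hn : 1 ≤ n)
    (S' : Finset (Fin n → Bool)) (g : ℕ) {α0 : ℝ} (hα0 : 0 < α0) (hα01 : α0 ≤ 1) :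
    avg (fun c : Fin k → Fin n × Bool =>
      if TypeB V0 c ∧ (∀ σ ∈ S', ¬ litTrue σ (unitLit V0 c)) then (1 : ℝ) else 0) ≤
      avg (fun θ : (Fin k → Fin n × Bool) × (Fin g → Fin k → Fin n × Bool) =>
        if TypeB V0 θ.1 ∧ (∀ σ ∈ S', ∃ l, ¬ ClauseSat σ (θ.2 l)) then (1 : ℝ) else 0) +
      (((Finset.univ.filter fun c : Fin k → Fin n × Bool => TypeB V0 c).card : ℝ) /
          Fintype.card (Fin k → Fin n × Bool)) * (α0 + (1 - (α0 / 2) ^ k) ^ g) := by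
  have hn0 : (0 : ℝ) < n := by exact_mod_cast hn
  set C := Fin k → Fin n × Bool
  have hneC : Nonempty C := ⟨fun _ => (⟨0, hn⟩, false)⟩
  set B := Finset.univ.filter (fun c : C => TypeB V0 c) with hB
  set NC : ℝ := (Fintype.card C : ℝ) with hNC
  have hNC0 : 0 < NC := by rw [hNC]; exact_mod_cast Fintype.card_pos
  set qB : ℝ := (B.card : ℝ) / NC with hqB
  have hqB0 : 0 ≤ qB := by positivity
  set D := deadLits V0 S' with hD
  set Lit' := Finset.univ.filter (fun l : Fin n × Bool => l.1 ∉ V0) with hLit'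
  -- `|Lit'| = 2 (n - |V₀|) ≥ n`
  have hLit'card : (Lit'.card : ℝ) = 2 * ((n : ℝ) - V0.card) := by
    have h1 : Lit' = (V0ᶜ) ×ˢ (Finset.univ : Finset Bool) := by
      ext l
      simp [hLit', Finset.mem_product, Finset.mem_compl]
    rw [h1, Finset.card_product, Finset.card_compl, Fintype.card_fin, Finset.card_univ, Fintype.card_bool]
    have : V0.card ≤ n := by simpa using V0.card_le_univ
    push_cast [Nat.cast_sub this]
    ring
  have hLit'ge : (n : ℝ) ≤ Lit'.card := by
    rw [hLit'card]
    have : (2 * V0.card : ℝ) ≤ n := by exact_mod_cast hV0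
    linarith
  have hLit'pos : (0 : ℝ) < Lit'.card := hn0.trans_le hLit'ge
  have hDsub : ∀ l ∈ D, l.1 ∉ V0 := fun l hl => (Finset.mem_filter.1 hl).2.1
  have hDle : (D.card : ℝ) ≤ Lit'.card := by
    exact_mod_cast Finset.card_le_card (fun l hl => Finset.mem_filter.2 ⟨Finset.mem_univ _, hDsub l hl⟩)
  set α : ℝ := (D.card : ℝ) / Lit'.card with hα
  have hα0' : 0 ≤ α := by positivity
  have hα1 : α ≤ 1 := by rw [hα, div_le_one hLit'pos]; exact hDle
  -- LHS `= qB · α`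
  have hLHS : avg (fun c : C => if TypeB V0 c ∧ (∀ σ ∈ S', ¬ litTrue σ (unitLit V0 c)) then (1 : ℝ) else 0) = qB * α := by
    have e1 : ∀ c : C, (if TypeB V0 c ∧ (∀ σ ∈ S', ¬ litTrue σ (unitLit V0 c)) then (1 : ℝ) else 0) =
        (if TypeB V0 c then (if unitLit V0 c ∈ D then (1 : ℝ) else 0) else 0) := by
      intro c
      by_cases hBc : TypeB V0 c
      · have : (∀ σ ∈ S', ¬ litTrue σ (unitLit V0 c)) ↔ unitLit V0 c ∈ D := by
          simp only [hD, deadLits, Finset.mem_filter, Finset.mem_univ, true_and]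
          exact ⟨fun h => ⟨unitLit_fst_not_mem hBc.2, h⟩, fun h => h.2⟩
        simp only [hBc, true_and, if_true, this]
      · simp [hBc]
    have hX := sum_typeB_ite_unitLit_mem (k := k) V0 D hDsub
    unfold avg
    rw [Finset.sum_congr rfl (fun c _ => e1 c), ← Finset.sum_filter]
    rw [← hB, ← hLit', ← hNC] at *
    have hXeq : ∑ c ∈ B, (if unitLit V0 c ∈ D then (1 : ℝ) else 0) = (D.card : ℝ) * B.card / Lit'.card := by
      rw [eq_div_iff hLit'pos.ne']
      exact hX
    rw [hXeq, hqB, hα]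
    field_simp
  -- RHS₁ `= qB · P_R`
  set PR : ℝ := avg (fun rr : Fin g → C => if ∀ σ ∈ S', ∃ l, ¬ ClauseSat σ (rr l) then (1 : ℝ) else 0) with hPR
  have hRHS : avg (fun θ : C × (Fin g → C) =>
      if TypeB V0 θ.1 ∧ (∀ σ ∈ S', ∃ l, ¬ ClauseSat σ (θ.2 l)) then (1 : ℝ) else 0) = qB * PR := by
    have e1 : ∀ θ : C × (Fin g → C), (if TypeB V0 θ.1 ∧ (∀ σ ∈ S', ∃ l, ¬ ClauseSat σ (θ.2 l)) then (1 : ℝ) else 0) =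
        (if TypeB V0 θ.1 then (1 : ℝ) else 0) * (if ∀ σ ∈ S', ∃ l, ¬ ClauseSat σ (θ.2 l) then (1 : ℝ) else 0) := by
      intro θ
      by_cases h1 : TypeB V0 θ.1 <;> by_cases h2 : ∀ σ ∈ S', ∃ l, ¬ ClauseSat σ (θ.2 l) <;> simp [h1, h2]
    rw [avg_congr e1, avg_prod (fun (c : C) (rr : Fin g → C) =>
      (if TypeB V0 c then (1 : ℝ) else 0) * (if ∀ σ ∈ S', ∃ l, ¬ ClauseSat σ (rr l) then (1 : ℝ) else 0))]
    have e2 : ∀ c : C, avg (fun rr : Fin g → C => (if TypeB V0 c then (1 : ℝ) else 0) *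
        (if ∀ σ ∈ S', ∃ l, ¬ ClauseSat σ (rr l) then (1 : ℝ) else 0)) = (if TypeB V0 c then (1 : ℝ) else 0) * PR :=
      fun c => avg_mul_left _ _
    rw [avg_congr e2, avg_mul_right]
    congr 1
    rw [hqB, avg, Finset.sum_boole, hNC]
  -- `P_R ≥ 1 - (1 - p₁)^g` with `p₁ = Pr[a uniform clause is falsified by all survivors]`
  set Q := Finset.univ.filter (fun u : C => ∀ σ ∈ S', ¬ ClauseSat σ u) with hQ
  set p1 : ℝ := (Q.card : ℝ) / NC with hp1
  have hp1le : p1 ≤ 1 := by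
    rw [hp1, div_le_one hNC0, hNC]
    exact_mod_cast Finset.card_le_univ Q
  have hPRge : 1 - (1 - p1) ^ g ≤ PR := by
    have hcard0 : (Fintype.card C : ℝ) ≠ 0 := by rw [← hNC]; exact hNC0.ne'
    have hfail : avg (fun rr : Fin g → C => if ∀ l, rr l ∈ Qᶜ then (1 : ℝ) else 0) = (1 - p1) ^ g := by
      have h0 : avg (fun rr : Fin g → C => if ∀ l, rr l ∈ Qᶜ then (1 : ℝ) else 0) =
          (((Qᶜ).card : ℝ) / Fintype.card C) ^ g := avg_ite_forall_mem _ _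
      rw [h0, Finset.card_compl, hp1, hNC]
      congr 1
      have : Q.card ≤ Fintype.card C := Finset.card_le_univ Q
      rw [Nat.cast_sub this, sub_div, div_self hcard0]
    have hpt : ∀ rr : Fin g → C, 1 - (if ∀ l, rr l ∈ Qᶜ then (1 : ℝ) else 0) ≤
        (if ∀ σ ∈ S', ∃ l, ¬ ClauseSat σ (rr l) then (1 : ℝ) else 0) := by
      intro rr
      by_cases h : ∀ l, rr l ∈ Qᶜ
      · rw [if_pos h]; simp only [sub_self]; positivity
      · rw [if_neg h, sub_zero, if_pos]
        obtain ⟨l, hl⟩ := not_forall.1 h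
        rw [Finset.mem_compl, not_not] at hl
        have hkill : ∀ σ ∈ S', ¬ ClauseSat σ (rr l) := (Finset.mem_filter.1 hl).2
        exact fun σ hσ => ⟨l, hkill σ hσ⟩
    have h := avg_mono hpt
    rw [avg_sub, avg_const, hfail] at h
    exact h
  -- `p₁ ≥ (α/2)^k`
  have hp1ge : (α / 2) ^ k ≤ p1 := by
    have h1 : avg (fun u : C => if ∀ j, u j ∈ D then (1 : ℝ) else 0) ≤ p1 := by
      have hpt : ∀ u : C, (if ∀ j, u j ∈ D then (1 : ℝ) else 0) ≤ (if u ∈ Q then (1 : ℝ) else 0) := by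
        intro u
        split_ifs with hu hQu
        · exact le_rfl
        · exact absurd (Finset.mem_filter.2 ⟨Finset.mem_univ _, clauseKill_of_forall_mem_deadLits hu⟩) hQu
        · positivity
        · exact le_rfl
      refine (avg_mono hpt).trans (le_of_eq ?_)
      rw [hp1, avg, Finset.sum_boole, hNC]
      have : Finset.univ.filter (fun u : C => u ∈ Q) = Q := by ext u; simp
      rw [this]
    have hneL : Nonempty (Fin n × Bool) := ⟨(⟨0, hn⟩, false)⟩
    have h2 : avg (fun u : C => if ∀ j, u j ∈ D then (1 : ℝ) else 0) = ((D.card : ℝ) / (2 * n)) ^ k := by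
      have h0 : avg (fun u : C => if ∀ j, u j ∈ D then (1 : ℝ) else 0) =
          ((D.card : ℝ) / Fintype.card (Fin n × Bool)) ^ k := avg_ite_forall_mem _ _
      rw [h0, Fintype.card_prod, Fintype.card_fin, Fintype.card_bool]
      push_cast
      ring
    have h3 : α / 2 ≤ (D.card : ℝ) / (2 * n) := by
      rw [hα, div_div, div_le_div_iff₀ (by positivity) (by positivity)]
      have : (0 : ℝ) ≤ D.card := Nat.cast_nonneg _
      nlinarith
    calc (α / 2) ^ k ≤ ((D.card : ℝ) / (2 * n)) ^ k := pow_le_pow_left₀ (by positivity) h3 k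
      _ = _ := h2.symm
      _ ≤ p1 := h1
  -- combine
  have hPRge' : 1 - (1 - (α / 2) ^ k) ^ g ≤ PR := by
    have hmono : (1 - p1) ^ g ≤ (1 - (α / 2) ^ k) ^ g :=
      pow_le_pow_left₀ (by linarith) (by linarith) g
    linarith
  rw [hLHS, hRHS]
  have hfinal := sub_cover_le k g hα0' hα1 hα0 hα01
  have : qB * α - qB * PR ≤ qB * (α0 + (1 - (α0 / 2) ^ k) ^ g) := by
    rw [← mul_sub]
    exact mul_le_mul_of_nonneg_left (by linarith) hqB0
  rw [hqB] at this ⊢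
  linarith

end RandomKSat

end Literature.Computability.Complexity

end

/-!
# Random `k`-SAT: a planted satisfiable sub-formula cannot boost unsatisfiability

Refutation of the second alternative of the Bourgain dichotomy (`RandomKSat.ksat_dichotomy`):
the with-replacement rendering of Friedgut 1999, §5, Claims 5.4–5.5 and Lemmas 5.6–5.7. If
`H = x|_T` (`|T| = t`) is satisfiable, with variable set `V₀`, then
`satExt x T = Pr[H ∪ F_k(n, M - t) sat]` is at least `Pr[F_k(n, M - t + dg) sat]` minus three
explicit error terms (`satExt_ge_of_planted`):

1. (`Claim 5.4`, planting) extend by the satisfying assignment of `H` on `V₀`: the fresh clauses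
   inside `V₀` are rare (`≤ M (|V₀|/n)^k`), the ones avoiding `V₀` are untouched, the ones meeting
   `V₀` (type B) are implied by their unit literal outside `V₀` (`litArraySat_of_hybSat_empty`);
2. (`Lemma 5.7`, hybrid) replace, one slot at a time, "the unit literal of a type-B clause is
   true" by "`g` auxiliary uniform clauses are satisfied": by `single_slot_le` each slot costs
   `q_B (α₀ + (1-(α₀/2)^k)^g)` (`hybU_empty_le`);
3. (`Claim 5.5 / Lemma 5.6`, pooling) with at most `d` type-B slots (Markov: else
   `≤ M q_B/(d+1)`) the auxiliary clauses are among a pool of `dg` fresh uniform clauses, so the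
   unsatisfiability probability is at most that of `F_k(n, M - t + dg)` (`hybU_compl_le`).

## References

* E. Friedgut, *Sharp thresholds of graph properties, and the `k`-sat problem*, J. Amer. Math.
  Soc. 12 (1999), §5: Claims 5.4, 5.5, Lemmas 5.6, 5.7 [Friedgut1999].
-/

noncomputable section

namespace Literature.Computability.Complexity

namespace RandomKSat

open Finset ProductSpace
open scoped Classical

/-! ### Uniformity of projections -/

/-- **Pulling back along an injection preserves the uniform measure**:
`E_{ρ' : β' → A} G(ρ' ∘ e) = E_{ρ : β → A} G(ρ)` for an embedding `e : β ↪ β'`. [folklore] -/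
theorem avg_comp_embedding {β β' A : Type*} [Fintype β] [DecidableEq β] [Fintype β'] [DecidableEq β']
    [Fintype A] [Nonempty A] (e : β ↪ β') (G : (β → A) → ℝ) :
    avg (fun ρ' : β' → A => G (fun b => ρ' (e b))) = avg G := by
  set p : β' → Prop := fun j => j ∈ Set.range e with hp
  set E1 := Equiv.piEquivPiSubtypeProd p (fun _ => A) with hE1
  set eβ : β ≃ {j // p j} := Equiv.ofInjective e e.injective with heβ
  set G' : ({j // p j} → A) → ℝ := fun u => G (fun b => u (eβ b)) with hG'
  have h1 : (fun ρ' : β' → A => G (fun b => ρ' (e b))) = fun ρ' => G' ((E1 ρ').1) := by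
    funext ρ'; rfl
  rw [h1, ← avg_comp_equiv E1.symm (fun ρ' : β' → A => G' ((E1 ρ').1))]
  simp only [Equiv.apply_symm_apply]
  rw [avg_prod_fst G']
  set Φ : ({j // p j} → A) ≃ (β → A) := eβ.symm.arrowCongr (Equiv.refl A) with hΦ
  rw [← avg_comp_equiv Φ.symm G']
  refine avg_congr fun u => ?_
  rw [hG', hΦ]
  simp [Equiv.arrowCongr]

/-- The first components of a uniform pair-valued tuple form a uniform tuple. [folklore] -/
theorem avg_comp_fst {ι A B : Type*} [Fintype ι] [DecidableEq ι] [Fintype A] [Fintype B] [Nonempty B]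
    (G : (ι → A) → ℝ) : avg (fun ω : ι → A × B => G (fun i => (ω i).1)) = avg G := by
  set E := Equiv.arrowProdEquivProdArrow ι (fun _ => A) (fun _ => B) with hE
  have h1 : (fun ω : ι → A × B => G (fun i => (ω i).1)) = fun ω => G (E ω).1 := by
    funext ω; rfl
  rw [h1, ← avg_comp_equiv E.symm (fun ω : ι → A × B => G (E ω).1)]
  simp only [Equiv.apply_symm_apply]
  exact avg_prod_fst G

/-- One coordinate of a uniform tuple is uniform. [folklore] -/
theorem avg_apply_coord {ι Ω : Type*} [Fintype ι] [DecidableEq ι] [Fintype Ω] [Nonempty Ω]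
    (i : ι) (G : Ω → ℝ) : avg (fun ω : ι → Ω => G (ω i)) = avg G := by
  rw [avg_eq_avg_avg_update i (fun ω : ι → Ω => G (ω i))]
  simp only [Function.update_self]
  exact avg_const _

variable {k n M : ℕ}

/-! ### The hybrid systems -/

/-- The constraint of slot `i` in the hybrid `I`: clauses avoiding `V₀` must be satisfied; for a
type-B clause, either its unit literal is true (`i ∉ I`) or the `g` auxiliary clauses are all
satisfied (`i ∈ I`); clauses inside `V₀` impose nothing. [cite: Friedgut1999, §5 (Lemma 5.7)] -/
def SlotOK [NeZero k] (V0 : Finset (Fin n)) (I : Finset (Fin M)) (i : Fin M) {g : ℕ}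
    (θ : (Fin k → Fin n × Bool) × (Fin g → Fin k → Fin n × Bool)) (σ : Fin n → Bool) : Prop :=
  (¬ Meets V0 θ.1 → ClauseSat σ θ.1) ∧
  (TypeB V0 θ.1 → (i ∈ I → ∀ l, ClauseSat σ (θ.2 l)) ∧ (i ∉ I → litTrue σ (unitLit V0 θ.1)))

/-- The hybrid system `I` is satisfiable (slots in `T` are the planted ones and impose nothing
here). [cite: Friedgut1999, §5 (Lemma 5.7)] -/
def HybSat [NeZero k] (V0 : Finset (Fin n)) (T I : Finset (Fin M)) {g : ℕ}
    (ω : Fin M → (Fin k → Fin n × Bool) × (Fin g → Fin k → Fin n × Bool)) : Prop :=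
  ∃ σ : Fin n → Bool, ∀ i, i ∉ T → SlotOK V0 I i (ω i) σ

/-- The unsatisfiability probability of the hybrid `I`. [cite: Friedgut1999, §5 (Lemma 5.7)] -/
def hybU (k : ℕ) [NeZero k] (V0 : Finset (Fin n)) (T I : Finset (Fin M)) (g : ℕ) : ℝ :=
  avg fun ω : Fin M → (Fin k → Fin n × Bool) × (Fin g → Fin k → Fin n × Bool) =>
    if HybSat V0 T I ω then (0 : ℝ) else 1

/-- **One step of the hybrid** (Friedgut 1999, Lemma 5.7, via `single_slot_le`): switching one
more slot from "unit literal" to "`g` auxiliary clauses" lowers the unsatisfiability probability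
by at most `q_B (α₀ + (1 - (α₀/2)^k)^g)`. [cite: Friedgut1999, §5 (Lemma 5.7)] -/
theorem hybU_le_insert [NeZero k] (hn : 1 ≤ n) {V0 : Finset (Fin n)} (hV0 : 2 * V0.card ≤ n)
    (T : Finset (Fin M)) {I : Finset (Fin M)} {i : Fin M} (hiT : i ∉ T) (hiI : i ∉ I) (g : ℕ)
    {α0 : ℝ} (hα0 : 0 < α0) (hα01 : α0 ≤ 1) :
    hybU k V0 T I g ≤ hybU k V0 T (insert i I) g +
      (((Finset.univ.filter fun c : Fin k → Fin n × Bool => TypeB V0 c).card : ℝ) /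
          Fintype.card (Fin k → Fin n × Bool)) * (α0 + (1 - (α0 / 2) ^ k) ^ g) := by
  set C := Fin k → Fin n × Bool
  have hneC : Nonempty C := ⟨fun _ => (⟨0, hn⟩, false)⟩
  set Ω' := C × (Fin g → C)
  set qe : ℝ := (((Finset.univ.filter fun c : C => TypeB V0 c).card : ℝ) / Fintype.card C) *
    (α0 + (1 - (α0 / 2) ^ k) ^ g) with hqe
  -- the difference as an average of fiber averages
  set D : (Fin M → Ω') → ℝ := fun ω =>
    (if HybSat V0 T I ω then (0 : ℝ) else 1) - (if HybSat V0 T (insert i I) ω then (0 : ℝ) else 1) with hD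
  have hdiff : hybU k V0 T I g - hybU k V0 T (insert i I) g = avg D := by
    unfold hybU; rw [← avg_sub]
  suffices h : avg D ≤ qe by linarith
  rw [avg_eq_avg_avg_update i D]
  refine avg_le_of_le fun ω => ?_
  -- survivors of the other slots
  set S' : Finset (Fin n → Bool) := Finset.univ.filter fun σ =>
    ∀ i', i' ∉ T → i' ≠ i → SlotOK V0 I i' (ω i') σ with hS'
  have hother : ∀ (J : Finset (Fin M)) (hJ : ∀ i', i' ≠ i → (i' ∈ J ↔ i' ∈ I)) (θ : Ω'),
      (¬ HybSat V0 T J (Function.update ω i θ)) ↔ ∀ σ ∈ S', ¬ SlotOK V0 J i θ σ := by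
    intro J hJ θ
    constructor
    · intro h σ hσ hslot
      apply h
      refine ⟨σ, fun i' hi' => ?_⟩
      by_cases hii : i' = i
      · subst hii; rw [Function.update_self]; exact hslot
      · rw [Function.update_of_ne hii]
        have := (Finset.mem_filter.1 hσ).2 i' hi' hii
        -- `SlotOK V0 I i'` and `SlotOK V0 J i'` agree for `i' ≠ i`
        unfold SlotOK at this ⊢
        simp only [hJ i' hii]
        exact this
    · rintro h ⟨σ, hσ⟩
      have hσS : σ ∈ S' := by
        refine Finset.mem_filter.2 ⟨Finset.mem_univ _, fun i' hi' hii => ?_⟩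
        have := hσ i' hi'
        rw [Function.update_of_ne hii] at this
        unfold SlotOK at this ⊢
        simp only [hJ i' hii] at this
        exact this
      have := hσ i hiT
      rw [Function.update_self] at this
      exact h σ hσS this
  -- the fiber difference is the difference of the two type-B kill indicators
  have hfib : ∀ θ : Ω', D (Function.update ω i θ) =
      (if TypeB V0 θ.1 ∧ (∀ σ ∈ S', ¬ litTrue σ (unitLit V0 θ.1)) then (1 : ℝ) else 0) -
      (if TypeB V0 θ.1 ∧ (∀ σ ∈ S', ∃ l, ¬ ClauseSat σ (θ.2 l)) then (1 : ℝ) else 0) := by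
    intro θ
    simp only [hD]
    have h1 := hother I (fun i' _ => Iff.rfl) θ
    have h2 := hother (insert i I) (fun i' hii => by simp [Finset.mem_insert, hii]) θ
    -- unfold the two slot constraints at slot `i`
    have hs1 : ∀ σ, SlotOK V0 I i θ σ ↔ ((¬ Meets V0 θ.1 → ClauseSat σ θ.1) ∧
        (TypeB V0 θ.1 → litTrue σ (unitLit V0 θ.1))) := by
      intro σ; unfold SlotOK
      simp only [hiI, not_false_eq_true, false_imp_iff, true_and, forall_true_left]
    have hs2 : ∀ σ, SlotOK V0 (insert i I) i θ σ ↔ ((¬ Meets V0 θ.1 → ClauseSat σ θ.1) ∧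
        (TypeB V0 θ.1 → ∀ l, ClauseSat σ (θ.2 l))) := by
      intro σ; unfold SlotOK
      simp only [Finset.mem_insert, true_or, forall_true_left, not_true_eq_false, false_imp_iff, and_true]
    by_cases hB : TypeB V0 θ.1
    · have hM : Meets V0 θ.1 := hB.1
      have e1 : (¬ HybSat V0 T I (Function.update ω i θ)) ↔ ∀ σ ∈ S', ¬ litTrue σ (unitLit V0 θ.1) := by
        rw [h1]
        refine forall₂_congr fun σ _ => ?_
        rw [hs1 σ]
        simp only [hM, not_true_eq_false, false_imp_iff, true_and, hB, forall_true_left]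
      have e2 : (¬ HybSat V0 T (insert i I) (Function.update ω i θ)) ↔ ∀ σ ∈ S', ∃ l, ¬ ClauseSat σ (θ.2 l) := by
        rw [h2]
        refine forall₂_congr fun σ _ => ?_
        rw [hs2 σ]
        simp only [hM, not_true_eq_false, false_imp_iff, true_and, hB, forall_true_left, not_forall]
      have hI1 : HybSat V0 T I (Function.update ω i θ) ↔ ¬ (∀ σ ∈ S', ¬ litTrue σ (unitLit V0 θ.1)) := by
        constructor
        · intro h hcon; exact (e1.2 hcon) h
        · intro h; by_contra h'; exact h (e1.1 h')
      have hI2 : HybSat V0 T (insert i I) (Function.update ω i θ) ↔ ¬ (∀ σ ∈ S', ∃ l, ¬ ClauseSat σ (θ.2 l)) := by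
        constructor
        · intro h hcon; exact (e2.2 hcon) h
        · intro h; by_contra h'; exact h (e2.1 h')
      by_cases ha : ∀ σ ∈ S', ¬ litTrue σ (unitLit V0 θ.1)
      · by_cases hb : ∀ σ ∈ S', ∃ l, ¬ ClauseSat σ (θ.2 l)
        · rw [if_neg (e1.2 ha), if_neg (e2.2 hb), if_pos ⟨hB, ha⟩, if_pos ⟨hB, hb⟩]
        · rw [if_neg (e1.2 ha), if_pos (hI2.2 hb), if_pos ⟨hB, ha⟩, if_neg (fun h => hb h.2)]
      · by_cases hb : ∀ σ ∈ S', ∃ l, ¬ ClauseSat σ (θ.2 l)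
        · rw [if_pos (hI1.2 ha), if_neg (e2.2 hb), if_neg (fun h => ha h.2), if_pos ⟨hB, hb⟩]
        · rw [if_pos (hI1.2 ha), if_pos (hI2.2 hb), if_neg (fun h => ha h.2), if_neg (fun h => hb h.2)]
    · -- not type B: the two constraints coincide
      have e : (¬ HybSat V0 T I (Function.update ω i θ)) ↔ (¬ HybSat V0 T (insert i I) (Function.update ω i θ)) := by
        rw [h1, h2]
        refine forall₂_congr fun σ _ => ?_
        rw [hs1 σ, hs2 σ]
        simp only [hB, false_imp_iff, and_true]
      by_cases ha : HybSat V0 T I (Function.update ω i θ)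
      · have hb : HybSat V0 T (insert i I) (Function.update ω i θ) := by
          by_contra hb; exact (e.2 hb) ha
        rw [if_pos ha, if_pos hb, if_neg (fun h => hB h.1), if_neg (fun h => hB h.1)]
      · have hb : ¬ HybSat V0 T (insert i I) (Function.update ω i θ) := e.1 ha
        rw [if_neg ha, if_neg hb, if_neg (fun h => hB h.1), if_neg (fun h => hB h.1)]
        norm_num
  rw [avg_congr hfib, avg_sub]
  have hss := single_slot_le (k := k) hV0 hn S' g hα0 hα01
  rw [avg_prod_fst (fun c : C => if TypeB V0 c ∧ (∀ σ ∈ S', ¬ litTrue σ (unitLit V0 c)) then (1 : ℝ) else 0)]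
    at ⊢
  linarith

/-- **The whole hybrid** (Friedgut 1999, Lemma 5.7 iterated "`d` times"): for `J` disjoint from
`T`, `hybU ∅ ≤ hybU J + |J| q_B (α₀ + (1 - (α₀/2)^k)^g)`. [cite: Friedgut1999, §5 (Lemma 5.7)] -/
theorem hybU_empty_le [NeZero k] (hn : 1 ≤ n) {V0 : Finset (Fin n)} (hV0 : 2 * V0.card ≤ n)
    (T : Finset (Fin M)) (g : ℕ) {α0 : ℝ} (hα0 : 0 < α0) (hα01 : α0 ≤ 1) (J : Finset (Fin M))
    (hJ : Disjoint J T) :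
    hybU k V0 T ∅ g ≤ hybU k V0 T J g + J.card *
      ((((Finset.univ.filter fun c : Fin k → Fin n × Bool => TypeB V0 c).card : ℝ) /
          Fintype.card (Fin k → Fin n × Bool)) * (α0 + (1 - (α0 / 2) ^ k) ^ g)) := by
  induction J using Finset.induction_on with
  | empty => simp
  | insert i J hiJ ih =>
    have hdisj : Disjoint J T := Finset.disjoint_of_subset_left (Finset.subset_insert i J) hJ
    have hiT : i ∉ T := Finset.disjoint_left.1 hJ (Finset.mem_insert_self i J)
    have h1 := ih hdisj
    have h2 := hybU_le_insert (k := k) hn hV0 T hiT hiJ g hα0 hα01 (I := J)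
    rw [Finset.card_insert_of_notMem hiJ]
    push_cast
    nlinarith [h1, h2]

/-! ### Planting (Claim 5.4): from the hybrid `∅` to the planted formula -/

/-- **Planting the satisfying assignment of `H` on `V₀`**: if no fresh clause lies inside `V₀`
and the hybrid system `∅` is satisfiable (clauses avoiding `V₀`, unit literals of type-B clauses),
then `x|_T ∪ y|_{Tᶜ}` is satisfiable. [cite: Friedgut1999, §5 (Claim 5.4)] -/
theorem litArraySat_of_hybSat_empty [NeZero k] {x : Fin M → Fin k → Fin n × Bool} {T : Finset (Fin M)}
    (hxT : FamilySat (fun j : T => x j.1)) {g : ℕ}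
    {ω : Fin M → (Fin k → Fin n × Bool) × (Fin g → Fin k → Fin n × Bool)}
    (hno : ∀ i, i ∉ T → ¬ Inside (spanVars x T) (ω i).1)
    (hsat : HybSat (spanVars x T) T ∅ ω) :
    LitArraySat (T.piecewise x (fun i => (ω i).1)) := by
  set V0 := spanVars x T with hV0
  obtain ⟨τ0, hτ0⟩ := hxT
  obtain ⟨σ', hσ'⟩ := hsat
  refine ⟨fun v => if v ∈ V0 then τ0 v else σ' v, fun i => ?_⟩
  by_cases hi : i ∈ T
  · -- planted clause: satisfied by `τ₀`, all its variables are in `V₀`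
    obtain ⟨j, hj⟩ := hτ0 ⟨i, hi⟩
    refine ⟨j, ?_⟩
    simp only [Finset.piecewise_eq_of_mem _ _ _ hi]
    have hv : (x i j).1 ∈ V0 := Finset.mem_image.2 ⟨(i, j), Finset.mem_product.2 ⟨hi, Finset.mem_univ _⟩, rfl⟩
    simp only [hv, if_true]
    exact hj
  · simp only [Finset.piecewise_eq_of_notMem _ _ _ hi]
    have hslot := hσ' i hi
    unfold SlotOK at hslot
    obtain ⟨hA, hBc⟩ := hslot
    by_cases hM : Meets V0 (ω i).1
    · -- type B (not inside by hypothesis): the unit literal is true and outside `V₀`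
      have hB : TypeB V0 (ω i).1 := ⟨hM, hno i hi⟩
      have hlit := (hBc hB).2 (Finset.notMem_empty i)
      obtain ⟨j, hj⟩ := unitLit_mem V0 (ω i).1
      have hout := unitLit_fst_not_mem (k := k) (hno i hi)
      refine ⟨j, ?_⟩
      rw [← hj]
      unfold litTrue at hlit
      simp only [hout, if_false]
      exact hlit
    · -- avoids `V₀`: satisfied by `σ'` on variables outside `V₀`
      obtain ⟨j, hj⟩ := hA hM
      refine ⟨j, ?_⟩
      have hout : ((ω i).1 j).1 ∉ V0 := fun h => hM ⟨j, h⟩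
      unfold litTrue at hj
      simp only [hout, if_false]
      exact hj

/-- **The planted satisfiability probability dominates the hybrid `∅`**:
`satExt x T ≥ (1 - hybU ∅) - Pr[some fresh clause inside V₀]`. [cite: Friedgut1999, §5 (Claim 5.4)] -/
theorem satExt_ge_hybU_empty [NeZero k] (hn : 1 ≤ n) {x : Fin M → Fin k → Fin n × Bool} {T : Finset (Fin M)}
    (hxT : FamilySat (fun j : T => x j.1)) (g : ℕ) :
    (1 - hybU k (spanVars x T) T ∅ g) -
      avg (fun ω : Fin M → (Fin k → Fin n × Bool) × (Fin g → Fin k → Fin n × Bool) =>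
        if ∃ i, i ∉ T ∧ Inside (spanVars x T) (ω i).1 then (1 : ℝ) else 0) ≤ satExt x T := by
  have hneC : Nonempty (Fin k → Fin n × Bool) := ⟨fun _ => (⟨0, hn⟩, false)⟩
  have hne2 : Nonempty (Fin g → Fin k → Fin n × Bool) := inferInstance
  -- `satExt` as an average over `ω`
  have h1 : satExt x T = avg (fun ω : Fin M → (Fin k → Fin n × Bool) × (Fin g → Fin k → Fin n × Bool) =>
      if LitArraySat (T.piecewise x (fun i => (ω i).1)) then (1 : ℝ) else 0) := by
    unfold satExt
    rw [avg_comp_fst (fun y : Fin M → Fin k → Fin n × Bool => if LitArraySat (T.piecewise x y) then (1 : ℝ) else 0)]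
  have key : ∀ ω : Fin M → (Fin k → Fin n × Bool) × (Fin g → Fin k → Fin n × Bool),
      (1 - (if HybSat (spanVars x T) T ∅ ω then (0 : ℝ) else 1)) -
        (if ∃ i, i ∉ T ∧ Inside (spanVars x T) (ω i).1 then (1 : ℝ) else 0) ≤
      (if LitArraySat (T.piecewise x (fun i => (ω i).1)) then (1 : ℝ) else 0) := by
    intro ω
    by_cases hins : ∃ i, i ∉ T ∧ Inside (spanVars x T) (ω i).1
    · rw [if_pos hins]; split_ifs <;> norm_num
    · rw [if_neg hins]
      push Not at hins
      by_cases hsat : HybSat (spanVars x T) T ∅ ω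
      · rw [if_pos hsat, if_pos (litArraySat_of_hybSat_empty hxT hins hsat)]; norm_num
      · rw [if_neg hsat]; split_ifs <;> norm_num
  have h2 := avg_mono key
  rw [avg_sub, avg_sub, avg_const] at h2
  rw [h1]
  unfold hybU
  exact h2

/-- `Pr[a uniform clause lies inside V₀] = (|V₀|/n)^k`. [folklore] -/
theorem avg_ite_inside (hn : 1 ≤ n) (V0 : Finset (Fin n)) :
    avg (fun c : Fin k → Fin n × Bool => if Inside V0 c then (1 : ℝ) else 0) = ((V0.card : ℝ) / n) ^ k := by
  have hneL : Nonempty (Fin n × Bool) := ⟨(⟨0, hn⟩, false)⟩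
  have h0 : avg (fun c : Fin k → Fin n × Bool => if ∀ j, c j ∈ V0 ×ˢ (Finset.univ : Finset Bool) then (1 : ℝ) else 0) =
      (((V0 ×ˢ (Finset.univ : Finset Bool)).card : ℝ) / Fintype.card (Fin n × Bool)) ^ k :=
    avg_ite_forall_mem _ _
  have e : ∀ c : Fin k → Fin n × Bool, (Inside V0 c) ↔ ∀ j, c j ∈ V0 ×ˢ (Finset.univ : Finset Bool) := by
    intro c; unfold Inside; simp [Finset.mem_product]
  simp only [e]
  rw [h0, Finset.card_product, Finset.card_univ, Fintype.card_bool, Fintype.card_prod, Fintype.card_fin,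
    Fintype.card_bool]
  push_cast
  congr 1
  have hn0 : (n : ℝ) ≠ 0 := by exact_mod_cast (Nat.one_le_iff_ne_zero.1 hn)
  field_simp

/-- `Pr[some fresh clause inside V₀] ≤ M (|V₀|/n)^k`. [cite: Friedgut1999, §5 (Claim 5.4: "no clauses of size smaller than k-1")] -/
theorem avg_ite_exists_inside_le [NeZero k] (hn : 1 ≤ n) (V0 : Finset (Fin n)) (T : Finset (Fin M)) (g : ℕ) :
    avg (fun ω : Fin M → (Fin k → Fin n × Bool) × (Fin g → Fin k → Fin n × Bool) =>
      if ∃ i, i ∉ T ∧ Inside V0 (ω i).1 then (1 : ℝ) else 0) ≤ M * ((V0.card : ℝ) / n) ^ k := by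
  set C := Fin k → Fin n × Bool
  have hneC : Nonempty C := ⟨fun _ => (⟨0, hn⟩, false)⟩
  have hne' : Nonempty (C × (Fin g → C)) := inferInstance
  calc avg (fun ω : Fin M → C × (Fin g → C) => if ∃ i, i ∉ T ∧ Inside V0 (ω i).1 then (1 : ℝ) else 0)
      ≤ avg (fun ω : Fin M → C × (Fin g → C) => ∑ i, (if Inside V0 (ω i).1 then (1 : ℝ) else 0)) := by
        refine avg_mono fun ω => ?_
        split_ifs with h
        · obtain ⟨i, _, hi⟩ := h
          calc (1 : ℝ) = (if Inside V0 (ω i).1 then (1 : ℝ) else 0) := by rw [if_pos hi]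
            _ ≤ ∑ i', (if Inside V0 (ω i').1 then (1 : ℝ) else 0) :=
                Finset.single_le_sum (f := fun i' => if Inside V0 (ω i').1 then (1 : ℝ) else 0)
                  (fun i' _ => by positivity) (Finset.mem_univ i)
        · exact Finset.sum_nonneg fun i _ => by positivity
    _ = ∑ i : Fin M, avg (fun ω : Fin M → C × (Fin g → C) => if Inside V0 (ω i).1 then (1 : ℝ) else 0) :=
        avg_finset_sum _ _
    _ = ∑ _i : Fin M, ((V0.card : ℝ) / n) ^ k := by
        refine Finset.sum_congr rfl fun i _ => ?_
        rw [avg_apply_coord i (fun θ : C × (Fin g → C) => if Inside V0 θ.1 then (1 : ℝ) else 0),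
          avg_prod_fst (fun c : C => if Inside V0 c then (1 : ℝ) else 0), avg_ite_inside hn]
    _ = M * ((V0.card : ℝ) / n) ^ k := by
        rw [Finset.sum_const, Finset.card_univ, Fintype.card_fin, nsmul_eq_mul]

/-! ### Pooling (Claim 5.5): from the hybrid `Tᶜ` to `F_k(n, M - t + dg)` -/

/-- All fresh clauses and, for type-B slots, all their auxiliary clauses are simultaneously
satisfiable. [cite: Friedgut1999, §5 (Claim 5.5)] -/
def BigSat (V0 : Finset (Fin n)) (T : Finset (Fin M)) {g : ℕ}
    (y : Fin M → Fin k → Fin n × Bool) (r : Fin M → Fin g → Fin k → Fin n × Bool) : Prop :=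
  ∃ σ : Fin n → Bool, ∀ i, i ∉ T → ClauseSat σ (y i) ∧ (TypeB V0 (y i) → ∀ l, ClauseSat σ (r i l))

/-- `BigSat` implies the hybrid `Tᶜ`. [cite: Friedgut1999, §5 (Claim 5.5)] -/
theorem hybSat_compl_of_bigSat [NeZero k] (V0 : Finset (Fin n)) (T : Finset (Fin M)) {g : ℕ}
    {ω : Fin M → (Fin k → Fin n × Bool) × (Fin g → Fin k → Fin n × Bool)}
    (h : BigSat V0 T (fun i => (ω i).1) (fun i => (ω i).2)) : HybSat V0 T Tᶜ ω := by
  obtain ⟨σ, hσ⟩ := h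
  refine ⟨σ, fun i hi => ?_⟩
  obtain ⟨h1, h2⟩ := hσ i hi
  unfold SlotOK
  refine ⟨fun _ => h1, fun hB => ⟨fun _ => h2 hB, fun hic => ?_⟩⟩
  exact absurd (Finset.mem_compl.2 hi) hic

/-- The pool system: the fresh clauses and a pool of `d g` auxiliary clauses are simultaneously
satisfiable. [cite: Friedgut1999, §5 (Claim 5.5)] -/
def PoolSat (T : Finset (Fin M)) {d g : ℕ} (y : Fin M → Fin k → Fin n × Bool)
    (W : Fin d → Fin g → Fin k → Fin n × Bool) : Prop :=
  ∃ σ : Fin n → Bool, (∀ i, i ∉ T → ClauseSat σ (y i)) ∧ ∀ m l, ClauseSat σ (W m l)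

/-- The reduced form of `BigSat`: it only depends on the auxiliary clauses of the type-B slots.
[cite: Friedgut1999, §5 (Claim 5.5)] -/
def BigSat' (V0 : Finset (Fin n)) (T : Finset (Fin M)) {g : ℕ} (y : Fin M → Fin k → Fin n × Bool)
    (ρ : {i : Fin M // i ∈ (Finset.univ \ T).filter (fun i => TypeB V0 (y i))} → Fin g → Fin k → Fin n × Bool) : Prop :=
  ∃ σ : Fin n → Bool, (∀ i, i ∉ T → ClauseSat σ (y i)) ∧ ∀ b l, ClauseSat σ (ρ b l)

/-- `BigSat` in reduced form. [cite: Friedgut1999, §5 (Claim 5.5)] -/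
theorem bigSat_iff (V0 : Finset (Fin n)) (T : Finset (Fin M)) {g : ℕ} (y : Fin M → Fin k → Fin n × Bool)
    (r : Fin M → Fin g → Fin k → Fin n × Bool) :
    BigSat V0 T y r ↔ BigSat' V0 T y (fun b => r b.1) := by
  unfold BigSat BigSat'
  constructor
  · rintro ⟨σ, hσ⟩
    refine ⟨σ, fun i hi => (hσ i hi).1, fun b l => ?_⟩
    obtain ⟨hbT, hbB⟩ := Finset.mem_filter.1 b.2
    exact (hσ b.1 (Finset.mem_sdiff.1 hbT).2).2 hbB l
  · rintro ⟨σ, h1, h2⟩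
    refine ⟨σ, fun i hi => ⟨h1 i hi, fun hB l => ?_⟩⟩
    exact h2 ⟨i, Finset.mem_filter.2 ⟨Finset.mem_sdiff.2 ⟨Finset.mem_univ _, hi⟩, hB⟩⟩ l

/-- **Pooling the auxiliary clauses** (Friedgut 1999, Claim 5.5 / Lemma 5.6 in the present
rendering): for a fixed outcome `y` of the fresh clauses with at most `d` type-B slots, the
probability (over the auxiliary clauses) that `BigSat` fails is at most the probability that the
pool system with `dg` uniform clauses fails. [cite: Friedgut1999, §5 (Claim 5.5)] -/
theorem avg_not_bigSat_le_pool (hn : 1 ≤ n) (V0 : Finset (Fin n)) (T : Finset (Fin M)) (d g : ℕ)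
    (y : Fin M → Fin k → Fin n × Bool)
    (hd : ((Finset.univ \ T).filter (fun i => TypeB V0 (y i))).card ≤ d) :
    avg (fun r : Fin M → Fin g → Fin k → Fin n × Bool => if BigSat V0 T y r then (0 : ℝ) else 1) ≤
      avg (fun W : Fin d → Fin g → Fin k → Fin n × Bool => if PoolSat T y W then (0 : ℝ) else 1) := by
  have hneC : Nonempty (Fin k → Fin n × Bool) := ⟨fun _ => (⟨0, hn⟩, false)⟩
  have hneA : Nonempty (Fin g → Fin k → Fin n × Bool) := inferInstance
  set Bset := (Finset.univ \ T).filter (fun i => TypeB V0 (y i)) with hBset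
  -- an injection of the type-B slots into the pool indices
  have hcard : Fintype.card {i : Fin M // i ∈ Bset} ≤ d := by rw [Fintype.card_coe]; exact hd
  set ψ : {i : Fin M // i ∈ Bset} ↪ Fin d :=
    (Fintype.equivFin {i : Fin M // i ∈ Bset}).toEmbedding.trans (Fin.castLEEmb hcard) with hψ
  set G : ({i : Fin M // i ∈ Bset} → Fin g → Fin k → Fin n × Bool) → ℝ :=
    fun ρ => if BigSat' V0 T y ρ then (0 : ℝ) else 1 with hG
  -- both sides in reduced form
  have hL : avg (fun r : Fin M → Fin g → Fin k → Fin n × Bool => if BigSat V0 T y r then (0 : ℝ) else 1) = avg G := by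
    have h := avg_comp_embedding (A := Fin g → Fin k → Fin n × Bool)
      (Function.Embedding.subtype fun i : Fin M => i ∈ Bset) G
    refine Eq.trans (avg_congr fun r => ?_) h
    simp only [hG, Function.Embedding.coe_subtype]
    by_cases hB : BigSat V0 T y r
    · rw [if_pos hB, if_pos ((bigSat_iff V0 T y r).1 hB)]
    · rw [if_neg hB, if_neg (fun h' => hB ((bigSat_iff V0 T y r).2 h'))]
  set c0 : Fin g → Fin k → Fin n × Bool := fun _ => hneC.some with hc0
  set rW : (Fin d → Fin g → Fin k → Fin n × Bool) → (Fin M → Fin g → Fin k → Fin n × Bool) := fun W i =>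
    if h : i ∈ Bset then W (ψ ⟨i, h⟩) else c0 with hrW_def
  have hR : avg G = avg (fun W : Fin d → Fin g → Fin k → Fin n × Bool =>
      if BigSat V0 T y (rW W) then (0 : ℝ) else 1) := by
    have h := avg_comp_embedding (A := Fin g → Fin k → Fin n × Bool) ψ G
    refine (Eq.trans (avg_congr fun W => ?_) h).symm
    simp only [hG]
    have hfun : (fun b : {i : Fin M // i ∈ Bset} => rW W b.1) = fun b => W (ψ b) := by
      funext b
      simp only [hrW_def, b.2, dif_pos]
    by_cases hB : BigSat V0 T y (rW W)
    · rw [if_pos hB, if_pos]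
      rw [← hfun]; exact (bigSat_iff V0 T y (rW W)).1 hB
    · rw [if_neg hB, if_neg]
      rw [← hfun]; exact fun h' => hB ((bigSat_iff V0 T y (rW W)).2 h')
  rw [hL, hR]
  refine avg_mono fun W => ?_
  -- `PoolSat ⇒ BigSat (rW W)`
  by_cases hP : PoolSat T y W
  · have hB : BigSat V0 T y (rW W) := by
      obtain ⟨σ, hσ1, hσ2⟩ := hP
      refine ⟨σ, fun i hi => ⟨hσ1 i hi, fun hB l => ?_⟩⟩
      have hiB : i ∈ Bset := Finset.mem_filter.2 ⟨Finset.mem_sdiff.2 ⟨Finset.mem_univ _, hi⟩, hB⟩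
      simp only [hrW_def, hiB, dif_pos]
      exact hσ2 _ l
    rw [if_pos hB, if_pos hP]
  · rw [if_neg hP]
    split_ifs <;> norm_num

/-- The pool system is the satisfiability of one clause family over `{i ∉ T} ⊕ (Fin d × Fin g)`.
[cite: Friedgut1999, §5 (Claim 5.5)] -/
theorem poolSat_iff_familySat (T : Finset (Fin M)) {d g : ℕ} (y : Fin M → Fin k → Fin n × Bool)
    (W : Fin d → Fin g → Fin k → Fin n × Bool) :
    PoolSat T y W ↔ FamilySat (Sum.elim (fun i : {i : Fin M // i ∉ T} => y i.1)
      (fun p : Fin d × Fin g => W p.1 p.2)) := by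
  unfold PoolSat FamilySat ClauseSat litTrue
  constructor
  · rintro ⟨σ, h1, h2⟩
    refine ⟨σ, fun idx => ?_⟩
    rcases idx with i | p
    · exact h1 i.1 i.2
    · exact h2 p.1 p.2
  · rintro ⟨σ, h⟩
    exact ⟨σ, fun i hi => h (Sum.inl ⟨i, hi⟩), fun m l => h (Sum.inr (m, l))⟩

/-- **The pool system fails with probability `1 - Pr[F_k(n, M - |T| + dg) sat]`.**
[cite: Friedgut1999, §5 (Claim 5.5 / Lemma 5.6)] -/
theorem avg_avg_not_poolSat (hn : 1 ≤ n) (T : Finset (Fin M)) (d g : ℕ) :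
    avg (fun y : Fin M → Fin k → Fin n × Bool =>
      avg (fun W : Fin d → Fin g → Fin k → Fin n × Bool => if PoolSat T y W then (0 : ℝ) else 1)) =
      1 - litArraySatProb k n ((M - T.card) + d * g) := by
  have hneC : Nonempty (Fin k → Fin n × Bool) := ⟨fun _ => (⟨0, hn⟩, false)⟩
  set F : ({i : Fin M // i ∉ T} → Fin k → Fin n × Bool) → (Fin d × Fin g → Fin k → Fin n × Bool) → ℝ :=
    fun y' W' => if FamilySat (Sum.elim y' W') then (0 : ℝ) else 1 with hF
  -- (a)+(c): the inner average in terms of `F`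
  have hinner : ∀ y : Fin M → Fin k → Fin n × Bool,
      avg (fun W : Fin d → Fin g → Fin k → Fin n × Bool => if PoolSat T y W then (0 : ℝ) else 1) =
      avg (fun W' : Fin d × Fin g → Fin k → Fin n × Bool => F (fun i => y i.1) W') := by
    intro y
    rw [← avg_comp_equiv (Equiv.curry (Fin d) (Fin g) (Fin k → Fin n × Bool)).symm
      (fun W' : Fin d × Fin g → Fin k → Fin n × Bool => F (fun i => y i.1) W')]
    refine avg_congr fun W => ?_
    simp only [hF, poolSat_iff_familySat]
    rfl
  simp_rw [hinner]
  -- (b): the outer average only sees `y|_{Tᶜ}`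
  rw [show (fun y : Fin M → Fin k → Fin n × Bool =>
      avg (fun W' : Fin d × Fin g → Fin k → Fin n × Bool => F (fun i => y i.1) W')) =
      fun y => (fun y' : {i : Fin M // i ∉ T} → Fin k → Fin n × Bool =>
        avg (fun W' : Fin d × Fin g → Fin k → Fin n × Bool => F y' W'))
        (fun b => y ((Function.Embedding.subtype fun i : Fin M => i ∉ T) b)) from rfl]
  rw [avg_comp_embedding (Function.Embedding.subtype fun i : Fin M => i ∉ T)
    (fun y' : {i : Fin M // i ∉ T} → Fin k → Fin n × Bool =>
      avg (fun W' : Fin d × Fin g → Fin k → Fin n × Bool => F y' W'))]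
  -- (d): glue the two uniform families into one over the sum type
  rw [← avg_prod F]
  set e := Equiv.sumArrowEquivProdArrow {i : Fin M // i ∉ T} (Fin d × Fin g) (Fin k → Fin n × Bool) with he
  rw [← avg_comp_equiv e (fun pr => F pr.1 pr.2)]
  have hglue : ∀ Fam : ({i : Fin M // i ∉ T} ⊕ (Fin d × Fin g)) → Fin k → Fin n × Bool,
      F (e Fam).1 (e Fam).2 = if FamilySat Fam then (0 : ℝ) else 1 := by
    intro Fam
    simp only [hF]
    have : Sum.elim (e Fam).1 (e Fam).2 = Fam := by
      rw [he]
      funext idx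
      rcases idx with i | p <;> rfl
    rw [this]
  rw [avg_congr hglue]
  -- (e): the satisfiability probability of the glued family
  have h1 : avg (fun Fam : ({i : Fin M // i ∉ T} ⊕ (Fin d × Fin g)) → Fin k → Fin n × Bool =>
      if FamilySat Fam then (0 : ℝ) else 1) =
      1 - avg (fun Fam : ({i : Fin M // i ∉ T} ⊕ (Fin d × Fin g)) → Fin k → Fin n × Bool =>
        if FamilySat Fam then (1 : ℝ) else 0) := by
    have : (fun Fam : ({i : Fin M // i ∉ T} ⊕ (Fin d × Fin g)) → Fin k → Fin n × Bool =>
        if FamilySat Fam then (0 : ℝ) else 1) = fun Fam => 1 - (if FamilySat Fam then (1 : ℝ) else 0) := by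
      funext Fam; split_ifs <;> norm_num
    rw [this, avg_sub, avg_const]
  rw [h1, avg_ite_familySat]
  congr 2
  rw [Fintype.card_sum, Fintype.card_prod, Fintype.card_fin, Fintype.card_fin, Fintype.card_subtype_compl,
    Fintype.card_fin]
  congr 1
  rw [Fintype.card_coe]

/-- `Pr[type B] = |B|/|clauses|` as an average. [folklore] -/
theorem avg_ite_typeB (V0 : Finset (Fin n)) :
    avg (fun c : Fin k → Fin n × Bool => if TypeB V0 c then (1 : ℝ) else 0) =
      ((Finset.univ.filter fun c : Fin k → Fin n × Bool => TypeB V0 c).card : ℝ) /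
        Fintype.card (Fin k → Fin n × Bool) := by
  rw [avg, Finset.sum_boole]

/-- **`Pr[type B] ≤ k |V₀| / n`** (a clause meets `V₀` only if one of its `k` uniform variables
does). [cite: Friedgut1999, §5 (Claim 5.4: "The expected number of clauses of size k-1 that were added can be bounded by a constant")] -/
theorem typeB_frac_le (hn : 1 ≤ n) (V0 : Finset (Fin n)) :
    ((Finset.univ.filter fun c : Fin k → Fin n × Bool => TypeB V0 c).card : ℝ) /
        Fintype.card (Fin k → Fin n × Bool) ≤ k * (V0.card : ℝ) / n := by
  have hneL : Nonempty (Fin n × Bool) := ⟨(⟨0, hn⟩, false)⟩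
  rw [← avg_ite_typeB]
  have hcoord : ∀ j : Fin k, avg (fun c : Fin k → Fin n × Bool => if (c j).1 ∈ V0 then (1 : ℝ) else 0) =
      (V0.card : ℝ) / n := by
    intro j
    rw [avg_apply_coord j (fun l : Fin n × Bool => if l.1 ∈ V0 then (1 : ℝ) else 0), avg, Finset.sum_boole]
    have : (Finset.univ.filter fun l : Fin n × Bool => l.1 ∈ V0) = V0 ×ˢ (Finset.univ : Finset Bool) := by
      ext l; simp [Finset.mem_product]
    rw [this, Finset.card_product, Finset.card_univ, Fintype.card_bool, Fintype.card_prod, Fintype.card_fin,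
      Fintype.card_bool]
    push_cast
    have hn0 : (n : ℝ) ≠ 0 := by exact_mod_cast (Nat.one_le_iff_ne_zero.1 hn)
    field_simp
  calc avg (fun c : Fin k → Fin n × Bool => if TypeB V0 c then (1 : ℝ) else 0)
      ≤ avg (fun c : Fin k → Fin n × Bool => ∑ j, (if (c j).1 ∈ V0 then (1 : ℝ) else 0)) := by
        refine avg_mono fun c => ?_
        split_ifs with h
        · obtain ⟨j, hj⟩ := h.1
          calc (1 : ℝ) = (if (c j).1 ∈ V0 then (1 : ℝ) else 0) := by rw [if_pos hj]
            _ ≤ ∑ j', (if (c j').1 ∈ V0 then (1 : ℝ) else 0) :=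
                Finset.single_le_sum (f := fun j' => if (c j').1 ∈ V0 then (1 : ℝ) else 0)
                  (fun j' _ => by positivity) (Finset.mem_univ j)
        · exact Finset.sum_nonneg fun j _ => by positivity
    _ = ∑ j : Fin k, avg (fun c : Fin k → Fin n × Bool => if (c j).1 ∈ V0 then (1 : ℝ) else 0) :=
        avg_finset_sum _ _
    _ = k * (V0.card : ℝ) / n := by
        rw [Finset.sum_congr rfl (fun j _ => hcoord j), Finset.sum_const, Finset.card_univ, Fintype.card_fin,
          nsmul_eq_mul]
        ring

/-- **From the hybrid `Tᶜ` to the pool** (Friedgut 1999, Claim 5.5 with Markov on the number of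
type-B slots): `hybU Tᶜ ≤ M q_B/(d+1) + (1 - Pr[F_k(n, M - |T| + dg) sat])`.
[cite: Friedgut1999, §5 (Claims 5.4–5.5)] -/
theorem hybU_compl_le [NeZero k] (hn : 1 ≤ n) (V0 : Finset (Fin n)) (T : Finset (Fin M)) (d g : ℕ) :
    hybU k V0 T Tᶜ g ≤
      M * (((Finset.univ.filter fun c : Fin k → Fin n × Bool => TypeB V0 c).card : ℝ) /
          Fintype.card (Fin k → Fin n × Bool)) / (d + 1) +
      (1 - litArraySatProb k n ((M - T.card) + d * g)) := by
  have hneC : Nonempty (Fin k → Fin n × Bool) := ⟨fun _ => (⟨0, hn⟩, false)⟩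
  have hneA : Nonempty (Fin g → Fin k → Fin n × Bool) := inferInstance
  have hneP : Nonempty ((Fin k → Fin n × Bool) × (Fin g → Fin k → Fin n × Bool)) := inferInstance
  set qB : ℝ := ((Finset.univ.filter fun c : Fin k → Fin n × Bool => TypeB V0 c).card : ℝ) /
    Fintype.card (Fin k → Fin n × Bool) with hqB
  have hqB0 : 0 ≤ qB := by positivity
  set numB : (Fin M → (Fin k → Fin n × Bool) × (Fin g → Fin k → Fin n × Bool)) → ℝ := fun ω =>
    ∑ i ∈ Finset.univ \ T, (if TypeB V0 (ω i).1 then (1 : ℝ) else 0) with hnumB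
  have hnumB0 : ∀ ω, 0 ≤ numB ω := fun ω => Finset.sum_nonneg fun i _ => by positivity
  have hnumBcard : ∀ ω, numB ω = (((Finset.univ \ T).filter fun i => TypeB V0 (ω i).1).card : ℝ) := by
    intro ω; simp only [hnumB]; rw [Finset.sum_boole]
  -- pointwise split
  have hpt : ∀ ω : Fin M → (Fin k → Fin n × Bool) × (Fin g → Fin k → Fin n × Bool),
      (if HybSat V0 T Tᶜ ω then (0 : ℝ) else 1) ≤
      (if ((d : ℝ) + 1) ≤ numB ω then (1 : ℝ) else 0) +
      (if ((Finset.univ \ T).filter fun i => TypeB V0 (ω i).1).card ≤ d then (1 : ℝ) else 0) *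
        (if BigSat V0 T (fun i => (ω i).1) (fun i => (ω i).2) then (0 : ℝ) else 1) := by
    intro ω
    by_cases hH : HybSat V0 T Tᶜ ω
    · rw [if_pos hH]; positivity
    · rw [if_neg hH]
      have hB : ¬ BigSat V0 T (fun i => (ω i).1) (fun i => (ω i).2) := fun h => hH (hybSat_compl_of_bigSat V0 T h)
      rw [if_neg hB, mul_one]
      by_cases hd : ((Finset.univ \ T).filter fun i => TypeB V0 (ω i).1).card ≤ d
      · rw [if_pos hd]
        have : 0 ≤ (if ((d : ℝ) + 1) ≤ numB ω then (1 : ℝ) else 0) := by positivity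
        linarith
      · rw [if_neg hd, if_pos]
        · norm_num
        · rw [hnumBcard]; exact_mod_cast Nat.succ_le_of_lt (not_le.1 hd)
  -- Markov for the number of type-B slots
  have hMarkov : avg (fun ω : Fin M → (Fin k → Fin n × Bool) × (Fin g → Fin k → Fin n × Bool) =>
      if ((d : ℝ) + 1) ≤ numB ω then (1 : ℝ) else 0) ≤ M * qB / (d + 1) := by
    refine (avg_indicator_le_div hnumB0 (by positivity)).trans ?_
    apply div_le_div_of_nonneg_right _ (by positivity)
    simp only [hnumB]
    rw [avg_finset_sum]
    have e : ∀ i ∈ Finset.univ \ T, avg (fun ω : Fin M → (Fin k → Fin n × Bool) × (Fin g → Fin k → Fin n × Bool) =>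
        if TypeB V0 (ω i).1 then (1 : ℝ) else 0) = qB := by
      intro i _
      rw [avg_apply_coord i (fun θ : (Fin k → Fin n × Bool) × (Fin g → Fin k → Fin n × Bool) =>
          if TypeB V0 θ.1 then (1 : ℝ) else 0),
        avg_prod_fst (fun c : Fin k → Fin n × Bool => if TypeB V0 c then (1 : ℝ) else 0), avg_ite_typeB]
    rw [Finset.sum_congr rfl e, Finset.sum_const, nsmul_eq_mul]
    apply mul_le_mul_of_nonneg_right _ hqB0
    have : (Finset.univ \ T).card ≤ M := by
      calc (Finset.univ \ T).card ≤ (Finset.univ : Finset (Fin M)).card := Finset.card_le_card Finset.sdiff_subset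
        _ = M := by rw [Finset.card_univ, Fintype.card_fin]
    exact_mod_cast this
  -- the truncated unsatisfiability through the pool
  have hpool : avg (fun ω : Fin M → (Fin k → Fin n × Bool) × (Fin g → Fin k → Fin n × Bool) =>
      (if ((Finset.univ \ T).filter fun i => TypeB V0 (ω i).1).card ≤ d then (1 : ℝ) else 0) *
        (if BigSat V0 T (fun i => (ω i).1) (fun i => (ω i).2) then (0 : ℝ) else 1)) ≤
      1 - litArraySatProb k n ((M - T.card) + d * g) := by
    set E := Equiv.arrowProdEquivProdArrow (Fin M) (fun _ => Fin k → Fin n × Bool)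
      (fun _ => Fin g → Fin k → Fin n × Bool) with hE
    set Fy : (Fin M → Fin k → Fin n × Bool) → (Fin M → Fin g → Fin k → Fin n × Bool) → ℝ := fun y r =>
      (if ((Finset.univ \ T).filter fun i => TypeB V0 (y i)).card ≤ d then (1 : ℝ) else 0) *
        (if BigSat V0 T y r then (0 : ℝ) else 1) with hFy
    set F0 : (Fin M → (Fin k → Fin n × Bool) × (Fin g → Fin k → Fin n × Bool)) → ℝ := fun ω =>
      (if ((Finset.univ \ T).filter fun i => TypeB V0 (ω i).1).card ≤ d then (1 : ℝ) else 0) *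
        (if BigSat V0 T (fun i => (ω i).1) (fun i => (ω i).2) then (0 : ℝ) else 1) with hF0
    have h1 : avg F0 =
        avg (fun pr : (Fin M → Fin k → Fin n × Bool) × (Fin M → Fin g → Fin k → Fin n × Bool) => Fy pr.1 pr.2) := by
      rw [← avg_comp_equiv E.symm F0]
      refine avg_congr fun pr => ?_
      simp only [hF0, hFy, hE, Equiv.arrowProdEquivProdArrow_symm_apply]
    show avg F0 ≤ _
    rw [h1, avg_prod Fy, ← avg_avg_not_poolSat hn T d g]
    refine avg_mono fun y => ?_
    simp only [hFy]
    rw [avg_mul_left]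
    by_cases hd : ((Finset.univ \ T).filter fun i => TypeB V0 (y i)).card ≤ d
    · rw [if_pos hd, one_mul]
      exact avg_not_bigSat_le_pool hn V0 T d g y hd
    · rw [if_neg hd, zero_mul]
      exact avg_nonneg fun W => by positivity
  calc hybU k V0 T Tᶜ g ≤ _ := avg_mono hpt
    _ = _ := by rw [avg_add]
    _ ≤ _ := add_le_add hMarkov hpool

/-- **A planted satisfiable sub-formula cannot boost unsatisfiability** (Friedgut 1999, §5, proof
of Cor. 5.3 from Claims 5.4–5.5 and Lemmas 5.6–5.7, with-replacement rendering): if `x|_T` is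
satisfiable, `V₀` its variables, `2|V₀| ≤ n`, then for all `d, g` and `α₀ ∈ (0,1]`,
`satExt x T ≥ Pr[F_k(n, M-|T|+dg) sat] - M(|V₀|/n)^k - M (k|V₀|/n)(α₀ + (1-(α₀/2)^k)^g) - M (k|V₀|/n)/(d+1)`.
[cite: Friedgut1999, §5 (Cor. 5.3, Claims 5.4–5.5, Lemmas 5.6–5.7)] -/
theorem satExt_ge_of_planted [NeZero k] (hn : 1 ≤ n) {x : Fin M → Fin k → Fin n × Bool}
    {T : Finset (Fin M)} (hxT : FamilySat (fun j : T => x j.1)) (hV0 : 2 * (spanVars x T).card ≤ n)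
    (d g : ℕ) {α0 : ℝ} (hα0 : 0 < α0) (hα01 : α0 ≤ 1) :
    litArraySatProb k n ((M - T.card) + d * g)
      - M * (((spanVars x T).card : ℝ) / n) ^ k
      - M * (k * ((spanVars x T).card : ℝ) / n) * (α0 + (1 - (α0 / 2) ^ k) ^ g)
      - M * (k * ((spanVars x T).card : ℝ) / n) / (d + 1) ≤ satExt x T := by
  set V0 := spanVars x T with hV0def
  set qB : ℝ := ((Finset.univ.filter fun c : Fin k → Fin n × Bool => TypeB V0 c).card : ℝ) /
    Fintype.card (Fin k → Fin n × Bool) with hqB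
  set eg : ℝ := α0 + (1 - (α0 / 2) ^ k) ^ g with heg
  have hqB0 : 0 ≤ qB := by positivity
  have heg0 : 0 ≤ eg := by
    have : (α0 / 2) ^ k ≤ 1 := pow_le_one₀ (by positivity) (by linarith)
    have : 0 ≤ (1 - (α0 / 2) ^ k) ^ g := pow_nonneg (by linarith) g
    positivity
  have hM0 : (0 : ℝ) ≤ M := Nat.cast_nonneg _
  have h1 := satExt_ge_hybU_empty (k := k) hn hxT g
  have h2 := avg_ite_exists_inside_le (k := k) hn V0 T g
  have h3 := hybU_empty_le (k := k) hn hV0 T g hα0 hα01 Tᶜ disjoint_compl_left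
  have h4 := hybU_compl_le (k := k) hn V0 T d g
  have h5 := typeB_frac_le (k := k) hn V0
  have hTc : ((Tᶜ : Finset (Fin M)).card : ℝ) ≤ M := by
    have : (Tᶜ : Finset (Fin M)).card ≤ M := by
      rw [Finset.card_compl, Fintype.card_fin]; exact Nat.sub_le _ _
    exact_mod_cast this
  rw [← hV0def, ← hqB, ← heg] at *
  -- chain the estimates
  have e1 : (Tᶜ : Finset (Fin M)).card * (qB * eg) ≤ M * (k * (V0.card : ℝ) / n) * eg := by
    calc (Tᶜ : Finset (Fin M)).card * (qB * eg) ≤ M * (qB * eg) :=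
          mul_le_mul_of_nonneg_right hTc (by positivity)
      _ = M * qB * eg := by ring
      _ ≤ M * (k * (V0.card : ℝ) / n) * eg := by
          apply mul_le_mul_of_nonneg_right _ heg0
          exact mul_le_mul_of_nonneg_left h5 hM0
  have e2 : M * qB / (d + 1) ≤ M * (k * (V0.card : ℝ) / n) / (d + 1) := by
    apply div_le_div_of_nonneg_right _ (by positivity)
    exact mul_le_mul_of_nonneg_left h5 hM0
  linarith

end RandomKSat

end Literature.Computability.Complexity

end

/-!
# Random `k`-SAT: the two crude bounds on the satisfiability probability

Two elementary facts about `P(n, m) = Pr[F_k(n, m) satisfiable]` (`litArraySatProb k n m`) used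
to normalise the threshold window in Friedgut's theorem (Part 6 of this file):

* `litArraySatProb_le_first_moment` — **the first-moment bound** `P(n, m) ≤ 2ⁿ (1 - 2^{-k})^m`
  (Friedgut 1999, §5: "It is known that for any given `k` there are constants `c₁, c₂` such that
  `f(c₁ n) → 1`, `f(c₂ n) → 0`"; Achlioptas–Peres 2004, §1.1, `r_k ≤ 2^k log 2`): a fixed assignment
  satisfies a uniform clause with probability exactly `1 - 2^{-k}`;
* `litArraySatProb_ge_one_sub` — **`P(n, m) ≥ 1 - m²/n`**: if the first literals of the `m`
  clauses carry distinct variables the formula is satisfiable, and two given clauses collide with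
  probability `1/n`.

## References

* E. Friedgut, *Sharp thresholds of graph properties, and the `k`-sat problem*, J. Amer. Math.
  Soc. 12 (1999), §5 [Friedgut1999].
* D. Achlioptas, Y. Peres, J. Amer. Math. Soc. 17 (2004), §1.1 [AchlioptasPeres2004].
-/

noncomputable section

namespace Literature.Computability.Complexity

namespace RandomKSat

open Finset ProductSpace
open scoped Classical

variable {k n : ℕ}

/-! ### The first-moment upper bound -/

/-- A fixed assignment falsifies exactly `n` of the `2n` literals. [folklore] -/
theorem card_filter_not_litTrue (σ : Fin n → Bool) :
    (Finset.univ.filter fun l : Fin n × Bool => ¬ litTrue σ l).card = n := by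
  have h : (Finset.univ.filter fun l : Fin n × Bool => ¬ litTrue σ l) =
      (Finset.univ : Finset (Fin n)).image fun v => (v, !σ v) := by
    ext l
    simp only [Finset.mem_filter, Finset.mem_univ, true_and, Finset.mem_image, litTrue]
    constructor
    · intro hl
      refine ⟨l.1, ?_⟩
      ext
      · rfl
      · simp only
        cases h1 : σ l.1 <;> cases h2 : l.2 <;> simp_all
    · rintro ⟨v, rfl⟩
      simp
  rw [h, Finset.card_image_of_injective _ (fun v w hvw => by simpa using congrArg Prod.fst hvw),
    Finset.card_univ, Fintype.card_fin]

/-- A fixed assignment satisfies a uniform clause with probability `1 - 2^{-k}`. [folklore] -/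
theorem avg_ite_clauseSat (hn : 1 ≤ n) (σ : Fin n → Bool) :
    avg (fun c : Fin k → Fin n × Bool => if ClauseSat σ c then (1 : ℝ) else 0) = 1 - (1 / 2 : ℝ) ^ k := by
  have hneL : Nonempty (Fin n × Bool) := ⟨(⟨0, hn⟩, false)⟩
  have h0 : avg (fun c : Fin k → Fin n × Bool =>
      if ∀ j, c j ∈ Finset.univ.filter (fun l : Fin n × Bool => ¬ litTrue σ l) then (1 : ℝ) else 0) =
      (((Finset.univ.filter fun l : Fin n × Bool => ¬ litTrue σ l).card : ℝ) / Fintype.card (Fin n × Bool)) ^ k :=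
    avg_ite_forall_mem _ _
  rw [card_filter_not_litTrue, Fintype.card_prod, Fintype.card_fin, Fintype.card_bool] at h0
  have e : ∀ c : Fin k → Fin n × Bool, (if ClauseSat σ c then (1 : ℝ) else 0) =
      1 - (if ∀ j, c j ∈ Finset.univ.filter (fun l : Fin n × Bool => ¬ litTrue σ l) then (1 : ℝ) else 0) := by
    intro c
    have : ClauseSat σ c ↔ ¬ ∀ j, c j ∈ Finset.univ.filter (fun l : Fin n × Bool => ¬ litTrue σ l) := by
      unfold ClauseSat
      simp only [Finset.mem_filter, Finset.mem_univ, true_and, not_forall, not_not]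
    by_cases h : ClauseSat σ c
    · rw [if_pos h, if_neg (this.1 h)]; norm_num
    · rw [if_neg h, if_pos (not_not.1 (fun h' => h (this.2 h')))]; norm_num
  rw [avg_congr e, avg_sub, avg_const, h0]
  congr 1
  have hn0 : (n : ℝ) ≠ 0 := by exact_mod_cast Nat.one_le_iff_ne_zero.1 hn
  rw [show ((n : ℕ) : ℝ) / ((n * 2 : ℕ) : ℝ) = 1 / 2 by push_cast; field_simp]

/-- **The first-moment bound** `Pr[F_k(n, m) sat] ≤ 2ⁿ (1 - 2^{-k})^m` (union bound over the
`2ⁿ` assignments; Achlioptas–Peres 2004, §1.1). [cite: AchlioptasPeres2004, §1.1 (r_k ≤ 2^k log 2)] -/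
theorem litArraySatProb_le_first_moment (hn : 1 ≤ n) (k m : ℕ) :
    litArraySatProb k n m ≤ 2 ^ n * (1 - (1 / 2 : ℝ) ^ k) ^ m := by
  have hneC : Nonempty (Fin k → Fin n × Bool) := ⟨fun _ => (⟨0, hn⟩, false)⟩
  rw [← avg_ite_litArraySat]
  -- union bound over assignments
  have hpt : ∀ Φ : Fin m → Fin k → Fin n × Bool, (if LitArraySat Φ then (1 : ℝ) else 0) ≤
      ∑ σ : Fin n → Bool, (if ∀ i, Φ i ∈ Finset.univ.filter (fun c : Fin k → Fin n × Bool => ClauseSat σ c)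
        then (1 : ℝ) else 0) := by
    intro Φ
    split_ifs with h
    · obtain ⟨σ, hσ⟩ := h
      have hσ' : ∀ i, Φ i ∈ Finset.univ.filter (fun c : Fin k → Fin n × Bool => ClauseSat σ c) :=
        fun i => Finset.mem_filter.2 ⟨Finset.mem_univ _, hσ i⟩
      calc (1 : ℝ) = (if ∀ i, Φ i ∈ Finset.univ.filter (fun c : Fin k → Fin n × Bool => ClauseSat σ c)
          then (1 : ℝ) else 0) := by rw [if_pos hσ']
        _ ≤ _ := Finset.single_le_sum (f := fun σ' : Fin n → Bool =>
            if ∀ i, Φ i ∈ Finset.univ.filter (fun c : Fin k → Fin n × Bool => ClauseSat σ' c) then (1 : ℝ) else 0)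
            (fun σ' _ => by positivity) (Finset.mem_univ σ)
    · exact Finset.sum_nonneg fun σ _ => by positivity
  refine (avg_mono hpt).trans ?_
  rw [avg_finset_sum]
  have e : ∀ σ : Fin n → Bool, avg (fun Φ : Fin m → Fin k → Fin n × Bool =>
      if ∀ i, Φ i ∈ Finset.univ.filter (fun c : Fin k → Fin n × Bool => ClauseSat σ c) then (1 : ℝ) else 0) =
      (1 - (1 / 2 : ℝ) ^ k) ^ m := by
    intro σ
    have h0 : avg (fun Φ : Fin m → Fin k → Fin n × Bool =>
        if ∀ i, Φ i ∈ Finset.univ.filter (fun c : Fin k → Fin n × Bool => ClauseSat σ c) then (1 : ℝ) else 0) =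
        (((Finset.univ.filter fun c : Fin k → Fin n × Bool => ClauseSat σ c).card : ℝ) /
          Fintype.card (Fin k → Fin n × Bool)) ^ m := avg_ite_forall_mem _ _
    rw [h0]
    congr 1
    rw [← avg_ite_clauseSat hn σ, avg, Finset.sum_boole]
  rw [Finset.sum_congr rfl (fun σ _ => e σ), Finset.sum_const, Finset.card_univ, Fintype.card_fun,
    Fintype.card_fin, Fintype.card_bool, nsmul_eq_mul]
  push_cast
  exact le_rfl

/-- `(1 - 2^{-k})^{2^k j} ≤ e^{-j}`. [folklore] -/
theorem one_sub_pow_le_exp_neg (k j : ℕ) : (1 - (1 / 2 : ℝ) ^ k) ^ (2 ^ k * j) ≤ Real.exp (-(j : ℝ)) := by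
  have h1 : (1 - (1 / 2 : ℝ) ^ k) ≤ Real.exp (-(1 / 2 : ℝ) ^ k) := by
    have := Real.add_one_le_exp (-(1 / 2 : ℝ) ^ k)
    linarith
  have h0 : 0 ≤ 1 - (1 / 2 : ℝ) ^ k := by
    have : (1 / 2 : ℝ) ^ k ≤ 1 := pow_le_one₀ (by norm_num) (by norm_num)
    linarith
  calc (1 - (1 / 2 : ℝ) ^ k) ^ (2 ^ k * j) ≤ (Real.exp (-(1 / 2 : ℝ) ^ k)) ^ (2 ^ k * j) :=
        pow_le_pow_left₀ h0 h1 _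
    _ = Real.exp (-(j : ℝ)) := by
        rw [← Real.exp_nat_mul]
        congr 1
        push_cast
        rw [show (-(1 / 2 : ℝ) ^ k) = -((1 / 2 : ℝ) ^ k) by ring]
        have : (2 : ℝ) ^ k * (1 / 2 : ℝ) ^ k = 1 := by rw [← mul_pow]; norm_num
        calc (2 : ℝ) ^ k * j * -(1 / 2 : ℝ) ^ k = -((2 : ℝ) ^ k * (1 / 2) ^ k) * j := by ring
          _ = -(j : ℝ) := by rw [this]; ring

/-- **At `m = 2^{k+1} n` the formula is unsatisfiable with probability `> 1/2`** (`n ≥ 1`):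
`P(n, 2^{k+1} n) ≤ 2ⁿ e^{-2n} < 1/2`. [cite: AchlioptasPeres2004, §1.1] -/
theorem litArraySatProb_big_lt_half (hn : 1 ≤ n) (k : ℕ) : litArraySatProb k n (2 ^ k * (2 * n)) < 1 / 2 := by
  have h1 := litArraySatProb_le_first_moment hn k (2 ^ k * (2 * n))
  have h2 := one_sub_pow_le_exp_neg k (2 * n)
  have h3 : (2 : ℝ) ^ n * Real.exp (-((2 * n : ℕ) : ℝ)) < 1 / 2 := by
    -- `2^n e^{-2n} = (2/e²)^n` and `2/e² < 1/2`
    have he : Real.exp 1 > 2.7182818283 := Real.exp_one_gt_d9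
    have e1 : (2 : ℝ) ^ n * Real.exp (-((2 * n : ℕ) : ℝ)) = (2 / Real.exp 2) ^ n := by
      rw [div_pow, ← Real.exp_nat_mul, Real.exp_neg]
      push_cast
      rw [show (n : ℝ) * 2 = 2 * n by ring]
      field_simp
    rw [e1]
    have hbase : 2 / Real.exp 2 < 1 / 2 := by
      rw [div_lt_div_iff₀ (Real.exp_pos 2) (by norm_num)]
      have : Real.exp 2 = Real.exp 1 * Real.exp 1 := by rw [← Real.exp_add]; norm_num
      nlinarith
    have hbase0 : 0 ≤ 2 / Real.exp 2 := by positivity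
    calc (2 / Real.exp 2) ^ n ≤ (2 / Real.exp 2) ^ 1 := pow_le_pow_of_le_one hbase0 (by linarith) hn
      _ < 1 / 2 := by rw [pow_one]; exact hbase
  calc litArraySatProb k n (2 ^ k * (2 * n)) ≤ 2 ^ n * (1 - (1 / 2 : ℝ) ^ k) ^ (2 ^ k * (2 * n)) := h1
    _ ≤ 2 ^ n * Real.exp (-((2 * n : ℕ) : ℝ)) := mul_le_mul_of_nonneg_left h2 (by positivity)
    _ < 1 / 2 := h3

/-! ### The lower bound `P(n, m) ≥ 1 - m²/n` -/

/-- If the first literals of all clauses have distinct variables the formula is satisfiable.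
[folklore] -/
theorem litArraySat_of_injective_first [NeZero k] {m : ℕ} {Φ : Fin m → Fin k → Fin n × Bool}
    (h : Function.Injective fun i => (Φ i 0).1) : LitArraySat Φ := by
  refine ⟨fun v => if hv : ∃ i, (Φ i 0).1 = v then (Φ (Classical.choose hv) 0).2 else false, fun i => ⟨0, ?_⟩⟩
  have hv : ∃ i', (Φ i' 0).1 = (Φ i 0).1 := ⟨i, rfl⟩
  simp only [hv, dif_pos]
  have := Classical.choose_spec hv
  rw [h this]

/-- Two given distinct clause slots carry the same first variable with probability `1/n`.
[folklore] -/
theorem avg_ite_first_eq [NeZero k] (hn : 1 ≤ n) {m : ℕ} {i i' : Fin m} (hii : i ≠ i') :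
    avg (fun Φ : Fin m → Fin k → Fin n × Bool => if (Φ i 0).1 = (Φ i' 0).1 then (1 : ℝ) else 0) = 1 / n := by
  have hneL : Nonempty (Fin n × Bool) := ⟨(⟨0, hn⟩, false)⟩
  have hneC : Nonempty (Fin k → Fin n × Bool) := inferInstance
  -- fiber over the slot `i`
  rw [avg_eq_avg_avg_update i (fun Φ : Fin m → Fin k → Fin n × Bool => if (Φ i 0).1 = (Φ i' 0).1 then (1 : ℝ) else 0)]
  have hv : ∀ v : Fin n, avg (fun c : Fin k → Fin n × Bool => if (c 0).1 = v then (1 : ℝ) else 0) = 1 / n := by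
    intro v
    rw [avg_apply_coord (0 : Fin k) (fun l : Fin n × Bool => if l.1 = v then (1 : ℝ) else 0), avg, Finset.sum_boole]
    have : (Finset.univ.filter fun l : Fin n × Bool => l.1 = v) = ({v} : Finset (Fin n)) ×ˢ (Finset.univ : Finset Bool) := by
      ext ⟨a, b⟩
      simp only [Finset.mem_filter, Finset.mem_univ, true_and, Finset.mem_product, Finset.mem_singleton, and_true]
    rw [this, Finset.card_product, Finset.card_singleton, Finset.card_univ, Fintype.card_bool, Fintype.card_prod,
      Fintype.card_fin, Fintype.card_bool]
    push_cast
    have hn0 : (n : ℝ) ≠ 0 := by exact_mod_cast Nat.one_le_iff_ne_zero.1 hn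
    field_simp
  have e : ∀ Φ : Fin m → Fin k → Fin n × Bool,
      avg (fun c : Fin k → Fin n × Bool => if ((Function.update Φ i c) i 0).1 = ((Function.update Φ i c) i' 0).1
        then (1 : ℝ) else 0) = 1 / n := by
    intro Φ
    simp only [Function.update_self, Function.update_of_ne (Ne.symm hii)]
    exact hv _
  rw [avg_congr e, avg_const]

/-- **`Pr[F_k(n, m) sat] ≥ 1 - m²/n`.** [folklore] -/
theorem litArraySatProb_ge_one_sub [NeZero k] (hn : 1 ≤ n) (m : ℕ) :
    1 - (m : ℝ) ^ 2 / n ≤ litArraySatProb k n m := by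
  have hneL : Nonempty (Fin n × Bool) := ⟨(⟨0, hn⟩, false)⟩
  have hneC : Nonempty (Fin k → Fin n × Bool) := inferInstance
  rw [← avg_ite_litArraySat]
  -- pointwise: `1[sat] ≥ 1 - ∑_{i ≠ i'} 1[collision]`
  have hpt : ∀ Φ : Fin m → Fin k → Fin n × Bool,
      1 - ∑ p ∈ (Finset.univ : Finset (Fin m × Fin m)).filter (fun p => p.1 ≠ p.2),
        (if (Φ p.1 0).1 = (Φ p.2 0).1 then (1 : ℝ) else 0) ≤ (if LitArraySat Φ then (1 : ℝ) else 0) := by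
    intro Φ
    have hs0 : 0 ≤ ∑ p ∈ (Finset.univ : Finset (Fin m × Fin m)).filter (fun p => p.1 ≠ p.2),
        (if (Φ p.1 0).1 = (Φ p.2 0).1 then (1 : ℝ) else 0) := Finset.sum_nonneg fun p _ => by positivity
    by_cases hinj : Function.Injective fun i => (Φ i 0).1
    · rw [if_pos (litArraySat_of_injective_first hinj)]; linarith
    · -- a collision exists
      have : ∃ p ∈ (Finset.univ : Finset (Fin m × Fin m)).filter (fun p => p.1 ≠ p.2), (Φ p.1 0).1 = (Φ p.2 0).1 := by
        unfold Function.Injective at hinj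
        push Not at hinj
        obtain ⟨a, b, hab, hne⟩ := hinj
        exact ⟨(a, b), Finset.mem_filter.2 ⟨Finset.mem_univ _, hne⟩, hab⟩
      obtain ⟨p, hp, hpc⟩ := this
      have h1 : (1 : ℝ) ≤ ∑ p ∈ (Finset.univ : Finset (Fin m × Fin m)).filter (fun p => p.1 ≠ p.2),
          (if (Φ p.1 0).1 = (Φ p.2 0).1 then (1 : ℝ) else 0) := by
        calc (1 : ℝ) = (if (Φ p.1 0).1 = (Φ p.2 0).1 then (1 : ℝ) else 0) := by rw [if_pos hpc]
          _ ≤ _ := Finset.single_le_sum (f := fun p : Fin m × Fin m => if (Φ p.1 0).1 = (Φ p.2 0).1 then (1 : ℝ) else 0)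
              (fun p _ => by positivity) hp
      have : 0 ≤ (if LitArraySat Φ then (1 : ℝ) else 0) := by positivity
      linarith
  refine le_trans ?_ (avg_mono hpt)
  rw [avg_sub, avg_const, avg_finset_sum]
  have e : ∀ p ∈ (Finset.univ : Finset (Fin m × Fin m)).filter (fun p => p.1 ≠ p.2),
      avg (fun Φ : Fin m → Fin k → Fin n × Bool => if (Φ p.1 0).1 = (Φ p.2 0).1 then (1 : ℝ) else 0) = 1 / n :=
    fun p hp => avg_ite_first_eq hn (Finset.mem_filter.1 hp).2
  rw [Finset.sum_congr rfl e, Finset.sum_const, nsmul_eq_mul]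
  have hcard : (((Finset.univ : Finset (Fin m × Fin m)).filter (fun p => p.1 ≠ p.2)).card : ℝ) ≤ (m : ℝ) ^ 2 := by
    calc (((Finset.univ : Finset (Fin m × Fin m)).filter (fun p => p.1 ≠ p.2)).card : ℝ)
        ≤ ((Finset.univ : Finset (Fin m × Fin m)).card : ℝ) := by exact_mod_cast Finset.card_filter_le _ _
      _ = (m : ℝ) ^ 2 := by rw [Finset.card_univ, Fintype.card_prod, Fintype.card_fin]; push_cast; ring
  have hn0 : (0 : ℝ) < n := by exact_mod_cast hn
  have : (((Finset.univ : Finset (Fin m × Fin m)).filter (fun p => p.1 ≠ p.2)).card : ℝ) * (1 / n) ≤ (m : ℝ) ^ 2 / n := by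
    rw [mul_one_div]; exact div_le_div_of_nonneg_right hcard hn0.le
  linarith

end RandomKSat

end Literature.Computability.Complexity

end

/-!
# Friedgut's theorem: the satisfiability threshold of random `k`-SAT is sharp (`k ≥ 3`)

E. Friedgut, *Sharp thresholds of graph properties, and the `k`-sat problem*, J. Amer. Math.
Soc. 12 (1999), **Theorem 1.3**: *"For every fixed `k ≥ 2` there exists a function `c(n)` such
that for every `ε > 0`, `P_k(c - ε) → 1`, `P_k(c + ε) → 0`."* — here for `k ≥ 3`, in the
with-replacement literal model `F_k(n, m)` of `RandomKSatThreshold.lean` and in the multiplicative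
form used by Achlioptas–Peres (Thm. 3 / Cor. 1 of arXiv:cs/0305009): there is `r_k(n)` with
`Pr[F_k(n, ⌊(1-ε) r_k(n) n⌋) sat] → 1` and `Pr[F_k(n, ⌊(1+ε) r_k(n) n⌋) sat] → 0` for every `ε > 0`
(`friedgut_sharp_threshold`). We take `r_k(n) = m_{1/2}(n)/n`, `m_{1/2}(n)` the first `m` with
`Pr[F_k(n,m) sat] ≤ 1/2`.

The heart is the **window lemma** `not_coarse` (Friedgut §5, Cor. 5.3 with Bourgain's Prop. 1 in
place of Thm. 5.2, carried out in `F_k(n, m)` directly): for `n` large it is impossible that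
`Pr[F_k(n, m_a) sat] ≤ 1 - η` and `Pr[F_k(n, m_b) sat] ≥ η` with `m_b ≥ (1+ε) m_a`, `m_a ≥ M₀`,
`m_b ≤ C n`. Proof: pigeonhole a density `M ∈ (m_a, (1+ε)m_a]` where one extra clause, `L` fewer
clauses and `dg` extra clauses all change the probability little; there `I[f_M] ≤ K`,
`Var f_M ≥ v₀` (Part 1 of this file), so `ksat_dichotomy` applies; alternative 1 is refuted
by `avg_ite_exists_small_unsat_le` (`k ≥ 3`), alternative 2 by `satExt_ge_of_planted`.

## Results (all proved)

* `sum_drop_le`, `sum_window_below_le`, `sum_window_above_le` — telescoping bounds;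
* `not_coarse` — the window lemma;
* `mHalf`, `mHalf_spec`, `tendsto_mHalf_atTop`, `mHalf_le` — the median density and its range;
* `friedgut_sharp_threshold` — **Friedgut's Theorem 1.3 for `k ≥ 3`**.

## References

* E. Friedgut (appendix by J. Bourgain), J. Amer. Math. Soc. 12 (1999) 1017–1054, Thm. 1.3, §5
  (Cor. 5.3, Claims 5.4–5.5, Lemmas 5.6–5.7), Appendix Prop. 1 [Friedgut1999].
* D. Achlioptas, Y. Peres, J. Amer. Math. Soc. 17 (2004), Thm. 3 and Cor. 1 [AchlioptasPeres2004].
-/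

noncomputable section

namespace Literature.Computability.Complexity

namespace RandomKSat

open Finset Filter ProductSpace
open scoped Classical Topology

/-! ### Telescoping bounds for the antitone sequence `m ↦ P(n, m)` -/

/-- `∑_{j<N} (P(s+j) - P(s+j+1)) = P(s) - P(s+N) ≤ 1`. [folklore] -/
theorem sum_drop_le (k n s N : ℕ) :
    ∑ j ∈ Finset.range N, (litArraySatProb k n (s + j) - litArraySatProb k n (s + j + 1)) ≤ 1 := by
  have h := Finset.sum_range_sub' (fun j => litArraySatProb k n (s + j)) N
  simp only [add_zero] at h
  have e : ∀ j, s + (j + 1) = s + j + 1 := fun j => by ring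
  simp only [e] at h
  rw [h]
  linarith [litArraySatProb_le_one k n s, litArraySatProb_nonneg k n (s + N)]

/-- `∑_{j<N} (P(m_a+1+j-L) - P(m_a+1+j)) ≤ L` for `L ≤ m_a` (each unit drop is counted at most
`L` times). [folklore] -/
theorem sum_window_below_le (k n : ℕ) {ma L : ℕ} (hL : L ≤ ma) (N : ℕ) :
    ∑ j ∈ Finset.range N, (litArraySatProb k n (ma + 1 + j - L) - litArraySatProb k n (ma + 1 + j)) ≤ L := by
  have hinner : ∀ j, litArraySatProb k n (ma + 1 + j - L) - litArraySatProb k n (ma + 1 + j) =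
      ∑ l ∈ Finset.range L, (litArraySatProb k n (ma + 1 + j - (l + 1)) - litArraySatProb k n (ma + 1 + j - l)) := by
    intro j
    have h := Finset.sum_range_sub (fun l => litArraySatProb k n (ma + 1 + j - l)) L
    simp only [Nat.sub_zero] at h
    rw [h]
  simp_rw [hinner]
  rw [Finset.sum_comm]
  have hl : ∀ l ∈ Finset.range L, ∑ j ∈ Finset.range N,
      (litArraySatProb k n (ma + 1 + j - (l + 1)) - litArraySatProb k n (ma + 1 + j - l)) ≤ 1 := by
    intro l hl
    have hl' : l < L := Finset.mem_range.1 hl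
    have e : ∀ j, (ma + 1 + j - (l + 1) = (ma - l) + j) ∧ (ma + 1 + j - l = (ma - l) + j + 1) := by
      intro j; constructor <;> omega
    rw [Finset.sum_congr rfl (fun j _ => by rw [(e j).1, (e j).2])]
    exact sum_drop_le k n (ma - l) N
  calc _ ≤ ∑ _l ∈ Finset.range L, (1 : ℝ) := Finset.sum_le_sum hl
    _ = L := by rw [Finset.sum_const, Finset.card_range, nsmul_eq_mul, mul_one]

/-- `∑_{j<N} (P(m_a+1+j) - P(m_a+1+j+W)) ≤ W`. [folklore] -/
theorem sum_window_above_le (k n ma W N : ℕ) :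
    ∑ j ∈ Finset.range N, (litArraySatProb k n (ma + 1 + j) - litArraySatProb k n (ma + 1 + j + W)) ≤ W := by
  have hinner : ∀ j, litArraySatProb k n (ma + 1 + j) - litArraySatProb k n (ma + 1 + j + W) =
      ∑ w ∈ Finset.range W, (litArraySatProb k n (ma + 1 + j + w) - litArraySatProb k n (ma + 1 + j + w + 1)) := by
    intro j
    have h := Finset.sum_range_sub' (fun w => litArraySatProb k n (ma + 1 + j + w)) W
    simp only [add_zero] at h
    have e : ∀ w, ma + 1 + j + (w + 1) = ma + 1 + j + w + 1 := fun w => by ring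
    simp only [e] at h
    rw [h]
  simp_rw [hinner]
  rw [Finset.sum_comm]
  have hw : ∀ w ∈ Finset.range W, ∑ j ∈ Finset.range N,
      (litArraySatProb k n (ma + 1 + j + w) - litArraySatProb k n (ma + 1 + j + w + 1)) ≤ 1 := by
    intro w _
    have e : ∀ j, ma + 1 + j + w = (ma + 1 + w) + j := by intro j; ring
    rw [Finset.sum_congr rfl (fun j _ => by rw [e j])]
    exact sum_drop_le k n (ma + 1 + w) N
  calc _ ≤ ∑ _w ∈ Finset.range W, (1 : ℝ) := Finset.sum_le_sum hw
    _ = W := by rw [Finset.sum_const, Finset.card_range, nsmul_eq_mul, mul_one]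

/-- **Pigeonhole in the window**: if `N ≥ ε m_a` consecutive densities above `m_a` are given
nonnegative weights `a_j, b_j, c_j` with `∑ a ≤ 1`, `∑ b ≤ L`, `∑ c ≤ W`, and
`ε m_a/2 > 2L/τ + 9W/τ`, then some `j` has `a_j ≤ 2/(ε m_a)`, `b_j < τ/2`, `c_j ≤ τ/9`. [folklore] -/
theorem exists_good_index {N : ℕ} {ε ma τ Lr Wr : ℝ} (hε : 0 < ε) (hma : 0 < ma) (hτ : 0 < τ)
    (hN : ε * ma ≤ N) (hbig : 2 * Lr / τ + 9 * Wr / τ < ε * ma / 2)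
    (a b c : ℕ → ℝ) (ha0 : ∀ j, 0 ≤ a j) (hb0 : ∀ j, 0 ≤ b j) (hc0 : ∀ j, 0 ≤ c j)
    (ha : ∑ j ∈ Finset.range N, a j ≤ 1) (hb : ∑ j ∈ Finset.range N, b j ≤ Lr)
    (hc : ∑ j ∈ Finset.range N, c j ≤ Wr) :
    ∃ j, j < N ∧ a j ≤ 2 / (ε * ma) ∧ b j < τ / 2 ∧ c j ≤ τ / 9 := by
  by_contra hcon
  push Not at hcon
  have hpt : ∀ j ∈ Finset.range N, (1 : ℝ) ≤ (ε * ma / 2) * a j + (2 / τ) * b j + (9 / τ) * c j := by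
    intro j hj
    have hj' := Finset.mem_range.1 hj
    have h1 : 0 ≤ (ε * ma / 2) * a j := by have := ha0 j; positivity
    have h2 : 0 ≤ (2 / τ) * b j := by have := hb0 j; positivity
    have h3 : 0 ≤ (9 / τ) * c j := by have := hc0 j; positivity
    by_cases h : a j ≤ 2 / (ε * ma)
    · by_cases h' : b j < τ / 2
      · have hcj := hcon j hj' h h'
        have : 1 < (9 / τ) * c j := by
          rw [div_mul_eq_mul_div, lt_div_iff₀ hτ]; linarith
        linarith
      · push Not at h'
        have : 1 ≤ (2 / τ) * b j := by
          rw [div_mul_eq_mul_div, le_div_iff₀ hτ]; linarith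
        linarith
    · push Not at h
      have : 1 < (ε * ma / 2) * a j := by
        have hεma : 0 < ε * ma := mul_pos hε hma
        rw [div_lt_iff₀ hεma] at h
        nlinarith
      linarith
  have hsum := Finset.sum_le_sum hpt
  rw [Finset.sum_const, Finset.card_range, nsmul_eq_mul, mul_one, Finset.sum_add_distrib,
    Finset.sum_add_distrib, ← Finset.mul_sum, ← Finset.mul_sum, ← Finset.mul_sum] at hsum
  have h1 : (ε * ma / 2) * ∑ j ∈ Finset.range N, a j ≤ ε * ma / 2 := by
    have : 0 ≤ ε * ma / 2 := by positivity
    nlinarith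
  have h2 : (2 / τ) * ∑ j ∈ Finset.range N, b j ≤ 2 * Lr / τ := by
    rw [div_mul_eq_mul_div, div_le_div_iff_of_pos_right hτ]; nlinarith
  have h3 : (9 / τ) * ∑ j ∈ Finset.range N, c j ≤ 9 * Wr / τ := by
    rw [div_mul_eq_mul_div, div_le_div_iff_of_pos_right hτ]; nlinarith
  linarith

/-! ### The window lemma -/

/-- `|spanVars x T| ≤ k |T|`. [folklore] -/
theorem card_spanVars_le {k n M : ℕ} (x : Fin M → Fin k → Fin n × Bool) (T : Finset (Fin M)) :
    (spanVars x T).card ≤ k * T.card := by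
  unfold spanVars
  calc ((T ×ˢ (Finset.univ : Finset (Fin k))).image fun p => (x p.1 p.2).1).card
      ≤ (T ×ˢ (Finset.univ : Finset (Fin k))).card := Finset.card_image_le
    _ = k * T.card := by rw [Finset.card_product, Finset.card_univ, Fintype.card_fin, mul_comm]

/-- **Refutation of the planted-booster alternative** (Friedgut 1999, §5, Claims 5.4–5.5 and
Lemmas 5.6–5.7 via `satExt_ge_of_planted`): with the error terms made `≤ τ/9` each and the window
condition `P(M) - P(M + dg) ≤ τ/9`, a satisfiable `x|_T` with `|T| ≤ L` cannot have
`satExt x T ≤ P(M) - τ/2`. [cite: Friedgut1999, §5 (proof of Cor. 5.3)] -/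
theorem planted_alternative_false {k n M L d g : ℕ} [NeZero k] (hk2 : 2 ≤ k) (hn1 : 1 ≤ n)
    {τ Cst α0 : ℝ} (hτ : 0 < τ) (hα0 : 0 < α0) (hα01 : α0 ≤ 1) (hC : 0 ≤ Cst)
    (hMCst : (M : ℝ) ≤ Cst * n) (hnkL : 2 * k * L ≤ n)
    (hE1 : Cst * ((k : ℝ) * L) ^ k / n ≤ τ / 9)
    (hE2 : Cst * (k : ℝ) ^ 2 * L * (α0 + (1 - (α0 / 2) ^ k) ^ g) ≤ τ / 9)
    (hE3 : Cst * (k : ℝ) ^ 2 * L / (d + 1) ≤ τ / 9)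
    (hwin : litArraySatProb k n M - τ / 9 ≤ litArraySatProb k n (M + d * g))
    {x : Fin M → Fin k → Fin n × Bool} {T : Finset (Fin M)} (hTL : T.card ≤ L)
    (hxT : FamilySat (fun j : T => x j.1)) (hsat : satExt x T ≤ litArraySatProb k n M - τ / 2) : False := by
  have hn0r : (0 : ℝ) < n := by exact_mod_cast hn1
  have hVcard : (spanVars x T).card ≤ k * L := (card_spanVars_le x T).trans (Nat.mul_le_mul_left k hTL)
  have hV0 : 2 * (spanVars x T).card ≤ n := by
    calc 2 * (spanVars x T).card ≤ 2 * (k * L) := Nat.mul_le_mul_left 2 hVcard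
      _ = 2 * k * L := by ring
      _ ≤ n := hnkL
  have hplant := satExt_ge_of_planted hn1 hxT hV0 d g hα0 hα01
  set v : ℝ := ((spanVars x T).card : ℝ) with hv
  have hvle : v ≤ k * L := by rw [hv]; exact_mod_cast hVcard
  have hanti := litArraySatProb_antitone k n
  have hM0 : (0 : ℝ) ≤ M := Nat.cast_nonneg _
  -- main term
  have hmain : litArraySatProb k n M - τ / 9 ≤ litArraySatProb k n (M - T.card + d * g) :=
    hwin.trans (hanti (Nat.add_le_add_right (Nat.sub_le _ _) _))
  -- error terms
  have hE1' : M * (v / n) ^ k ≤ τ / 9 := by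
    have h1 : (v / n) ^ k ≤ (((k : ℝ) * L) / n) ^ k :=
      pow_le_pow_left₀ (by positivity) (div_le_div_of_nonneg_right hvle hn0r.le) k
    have h2 : (((k : ℝ) * L) / n) ^ k = ((k : ℝ) * L) ^ k / (n : ℝ) ^ k := div_pow _ _ _
    have hk2' : (n : ℝ) * n ≤ (n : ℝ) ^ k := by
      obtain ⟨e, he⟩ := Nat.exists_eq_add_of_le hk2
      rw [he, pow_add, pow_two]
      have h1 : (1 : ℝ) ≤ (n : ℝ) ^ e := one_le_pow₀ (by exact_mod_cast hn1)
      have h2 := mul_nonneg (mul_self_nonneg (n : ℝ)) (sub_nonneg.2 h1)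
      linarith only [h2]
    calc M * (v / n) ^ k ≤ (Cst * n) * ((((k : ℝ) * L) / n) ^ k) := mul_le_mul hMCst h1 (by positivity) (by positivity)
      _ = Cst * ((k : ℝ) * L) ^ k * (n / (n : ℝ) ^ k) := by rw [h2]; ring
      _ ≤ Cst * ((k : ℝ) * L) ^ k * (1 / n) := by
          apply mul_le_mul_of_nonneg_left _ (by positivity)
          rw [div_le_div_iff₀ (by positivity) hn0r]
          linarith only [hk2']
      _ = Cst * ((k : ℝ) * L) ^ k / n := by ring
      _ ≤ τ / 9 := hE1
  have hMk : M * (k * v / n) ≤ Cst * (k : ℝ) ^ 2 * L := by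
    calc M * (k * v / n) ≤ (Cst * n) * (k * (k * L) / n) := by
          apply mul_le_mul hMCst _ (by positivity) (by positivity)
          exact div_le_div_of_nonneg_right (mul_le_mul_of_nonneg_left hvle (by positivity)) hn0r.le
      _ = Cst * (k : ℝ) ^ 2 * L := by field_simp
  have heg0 : 0 ≤ α0 + (1 - (α0 / 2) ^ k) ^ g := by
    have : (α0 / 2) ^ k ≤ 1 := pow_le_one₀ (by positivity) (by linarith)
    have : 0 ≤ (1 - (α0 / 2) ^ k) ^ g := pow_nonneg (by linarith) g
    positivity
  have hE2' : M * (k * v / n) * (α0 + (1 - (α0 / 2) ^ k) ^ g) ≤ τ / 9 :=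
    (mul_le_mul_of_nonneg_right hMk heg0).trans hE2
  have hE3' : M * (k * v / n) / (d + 1) ≤ τ / 9 :=
    (div_le_div_of_nonneg_right hMk (by positivity)).trans hE3
  -- `satExt ≥ P(M) - 4τ/9 > P(M) - τ/2 ≥ satExt`
  linarith only [hplant, hmain, hE1', hE2', hE3', hsat, hτ]

/-- **The window lemma** (Friedgut 1999, §5, Cor. 5.3, with Bourgain's Prop. 1 and in the model
`F_k(n, m)`): for `k ≥ 3`, `ε, η > 0`, `η ≤ 1/2`, `C > 0` there are `M₀, n₀` such that for
`n ≥ n₀`, `m_a ≥ M₀`, `m_b ≥ (1+ε) m_a`, `m_b ≤ C n`: if `Pr[F_k(n, m_a) sat] ≤ 1 - η` then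
`Pr[F_k(n, m_b) sat] < η` — the satisfiability probability cannot linger in `[η, 1-η]` over a
window of multiplicative width `1 + ε`. [cite: Friedgut1999, §5 (Cor. 5.3) and Thm. 1.3] -/
theorem not_coarse {k : ℕ} (hk : 3 ≤ k) {ε η Cst : ℝ} (hε : 0 < ε) (hη : 0 < η) (hη1 : η ≤ 1 / 2)
    (hC : 0 < Cst) :
    ∃ M0 n0 : ℕ, ∀ n : ℕ, n0 ≤ n → ∀ ma mb : ℕ, M0 ≤ ma → (1 + ε) * (ma : ℝ) ≤ mb → (mb : ℝ) ≤ Cst * n →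
      litArraySatProb k n ma ≤ 1 - η → litArraySatProb k n mb < η := by
  haveI : NeZero k := ⟨Nat.pos_iff_ne_zero.1 (lt_of_lt_of_le (by norm_num) hk)⟩
  -- the constants of the dichotomy
  obtain ⟨K, hK⟩ : ∃ K : ℝ, K = 8 * (2 + ε) / ε := ⟨_, rfl⟩
  obtain ⟨v0, hv0⟩ : ∃ v0 : ℝ, v0 = 4 * η * (1 - η) := ⟨_, rfl⟩
  have hv0pos : 0 < v0 := by rw [hv0]; nlinarith
  obtain ⟨τ, hτ, hdich⟩ := ksat_dichotomy K v0 hv0pos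
  obtain ⟨L, hL⟩ : ∃ L : ℕ, L = ⌈4 * K / v0⌉₊ := ⟨_, rfl⟩
  rw [← hL] at hdich
  -- the constants of the planted refutation
  obtain ⟨A1, hA1⟩ : ∃ A1 : ℝ, A1 = Cst * k ^ 2 * L := ⟨_, rfl⟩
  have hA10 : 0 ≤ A1 := by rw [hA1]; positivity
  obtain ⟨d, hd⟩ : ∃ d : ℕ, d = ⌈9 * A1 / τ⌉₊ := ⟨_, rfl⟩
  have hdA : A1 / (d + 1) ≤ τ / 9 := by
    rw [div_le_iff₀ (by positivity)]
    have : 9 * A1 / τ ≤ d := by rw [hd]; exact Nat.le_ceil _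
    rw [div_le_iff₀ hτ] at this
    nlinarith only [this, hτ.le, hA10]
  obtain ⟨α0, hα0⟩ : ∃ α0 : ℝ, α0 = min 1 (τ / (18 * A1 + 1)) := ⟨_, rfl⟩
  have hα0pos : 0 < α0 := by rw [hα0]; exact lt_min one_pos (by positivity)
  have hα01 : α0 ≤ 1 := by rw [hα0]; exact min_le_left _ _
  have hα0A : A1 * α0 ≤ τ / 18 := by
    have h1 : α0 ≤ τ / (18 * A1 + 1) := by rw [hα0]; exact min_le_right _ _
    calc A1 * α0 ≤ A1 * (τ / (18 * A1 + 1)) := mul_le_mul_of_nonneg_left h1 hA10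
      _ ≤ τ / 18 := by
          rw [mul_div_assoc', div_le_div_iff₀ (by positivity) (by norm_num)]
          nlinarith only [hτ.le, hA10]
  obtain ⟨b, hb⟩ : ∃ b : ℝ, b = 1 - (α0 / 2) ^ k := ⟨_, rfl⟩
  have hb0 : 0 ≤ b := by
    have : (α0 / 2) ^ k ≤ 1 := pow_le_one₀ (by positivity) (by linarith)
    rw [hb]; linarith
  have hb1 : b < 1 := by
    have : 0 < (α0 / 2) ^ k := by positivity
    rw [hb]; linarith
  obtain ⟨g, hg⟩ := exists_pow_lt_of_lt_one (show 0 < τ / (18 * A1 + 1) by positivity) hb1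
  have hgA : A1 * b ^ g ≤ τ / 18 := by
    calc A1 * b ^ g ≤ A1 * (τ / (18 * A1 + 1)) := mul_le_mul_of_nonneg_left hg.le hA10
      _ ≤ τ / 18 := by
          rw [mul_div_assoc', div_le_div_iff₀ (by positivity) (by norm_num)]
          nlinarith only [hτ.le, hA10]
  have hE2c : Cst * (k : ℝ) ^ 2 * L * (α0 + (1 - (α0 / 2) ^ k) ^ g) ≤ τ / 9 := by
    rw [← hA1, ← hb, mul_add]; linarith only [hα0A, hgA]
  have hE3c : Cst * (k : ℝ) ^ 2 * L / (d + 1) ≤ τ / 9 := by rw [← hA1]; exact hdA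
  obtain ⟨W, hW⟩ : ∃ W : ℕ, W = d * g := ⟨_, rfl⟩
  -- `M₀` and `n₀`
  refine ⟨max (L + 1) (⌈(2 / ε) * (2 * L / τ + 9 * W / τ) + 2 / ε⌉₊ + 1),
    max (max 1 (2 * k * L)) (max (⌈9 * Cst * ((k : ℝ) * L) ^ k / τ⌉₊ + 1)
      (⌈2 * localUnsatConst k L Cst / τ⌉₊ + 1)), ?_⟩
  intro n hn ma mb hma hab hmb hPa
  -- unpack `n ≥ n₀`
  have hn1 : 1 ≤ n := le_trans (le_trans (le_max_left _ _) (le_max_left _ _)) hn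
  haveI : NeZero n := ⟨Nat.one_le_iff_ne_zero.1 hn1⟩
  have hn0r : (0 : ℝ) < n := by exact_mod_cast hn1
  have hnkL : 2 * k * L ≤ n := le_trans (le_trans (le_max_right _ _) (le_max_left _ _)) hn
  have hnE1 : Cst * ((k : ℝ) * L) ^ k / n ≤ τ / 9 := by
    have h1 : ⌈9 * Cst * ((k : ℝ) * L) ^ k / τ⌉₊ + 1 ≤ n :=
      le_trans (le_trans (le_max_left _ _) (le_max_right _ _)) hn
    have h2 : 9 * Cst * ((k : ℝ) * L) ^ k / τ ≤ n := by
      have := Nat.le_ceil (9 * Cst * ((k : ℝ) * L) ^ k / τ)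
      have h3 : (⌈9 * Cst * ((k : ℝ) * L) ^ k / τ⌉₊ : ℝ) + 1 ≤ n := by exact_mod_cast h1
      linarith only [this, h3]
    rw [div_le_iff₀ hn0r]
    rw [div_le_iff₀ hτ] at h2
    linarith only [h2]
  have hnA1 : localUnsatConst k L Cst / n < τ / 2 := by
    have h1 : ⌈2 * localUnsatConst k L Cst / τ⌉₊ + 1 ≤ n :=
      le_trans (le_trans (le_max_right _ _) (le_max_right _ _)) hn
    have h2 : 2 * localUnsatConst k L Cst / τ < n := by
      have := Nat.le_ceil (2 * localUnsatConst k L Cst / τ)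
      have h3 : (⌈2 * localUnsatConst k L Cst / τ⌉₊ : ℝ) + 1 ≤ n := by exact_mod_cast h1
      linarith only [this, h3]
    rw [div_lt_iff₀ hn0r]
    rw [div_lt_iff₀ hτ] at h2
    linarith only [h2]
  -- unpack `m_a ≥ M₀`
  have hmaL1 : L + 1 ≤ ma := le_trans (le_max_left _ _) hma
  have hmaL : L ≤ ma := le_trans (Nat.le_succ L) hmaL1
  have hma1 : 1 ≤ ma := le_trans (Nat.le_add_left 1 L) hmaL1
  have hmar : (0 : ℝ) < ma := by exact_mod_cast hma1
  have hmabig : 2 * L / τ + 9 * W / τ < ε * ma / 2 := by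
    have h1 : ⌈(2 / ε) * (2 * L / τ + 9 * W / τ) + 2 / ε⌉₊ + 1 ≤ ma := le_trans (le_max_right _ _) hma
    have h2 : (2 / ε) * (2 * L / τ + 9 * W / τ) + 2 / ε < ma := by
      have := Nat.le_ceil ((2 / ε) * (2 * L / τ + 9 * W / τ) + 2 / ε)
      have h3 : (⌈(2 / ε) * (2 * L / τ + 9 * W / τ) + 2 / ε⌉₊ : ℝ) + 1 ≤ ma := by exact_mod_cast h1
      linarith only [this, h3]
    have h6 : ((2 / ε) * (2 * L / τ + 9 * W / τ) + 2 / ε) * (ε / 2) < ma * (ε / 2) :=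
      mul_lt_mul_of_pos_right h2 (by positivity)
    have h7 : ((2 / ε) * (2 * L / τ + 9 * W / τ) + 2 / ε) * (ε / 2) = (2 * L / τ + 9 * W / τ) + 1 := by
      field_simp
    rw [h7] at h6
    linarith only [h6]
  -- contradiction hypothesis and the shrunk right end `m_b' = ⌈(1+ε) m_a⌉`
  by_contra hPb
  push Not at hPb
  obtain ⟨mb', hmb'⟩ : ∃ mb' : ℕ, mb' = ⌈(1 + ε) * (ma : ℝ)⌉₊ := ⟨_, rfl⟩
  have hmb'le : mb' ≤ mb := by rw [hmb']; exact Nat.ceil_le.2 hab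
  have hmb'ge : (1 + ε) * (ma : ℝ) ≤ mb' := by rw [hmb']; exact Nat.le_ceil _
  have hmb'lt : (mb' : ℝ) < (1 + ε) * ma + 1 := by rw [hmb']; exact Nat.ceil_lt_add_one (by positivity)
  have hanti := litArraySatProb_antitone k n
  have hPb' : η ≤ litArraySatProb k n mb' := hPb.trans (hanti hmb'le)
  have hmamb' : ma ≤ mb' := by
    have h1 : (0 : ℝ) ≤ ε * ma := by positivity
    have : (ma : ℝ) ≤ mb' := by linarith only [hmb'ge, h1]
    exact_mod_cast this
  obtain ⟨N, hN⟩ : ∃ N : ℕ, N = mb' - ma := ⟨_, rfl⟩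
  have hNr : (N : ℝ) = mb' - ma := by rw [hN]; push_cast [Nat.cast_sub hmamb']; ring
  have hNge : ε * ma ≤ N := by rw [hNr]; linarith only [hmb'ge]
  -- the three weights and their sums
  have ha0 : ∀ j, 0 ≤ litArraySatProb k n (ma + j) - litArraySatProb k n (ma + j + 1) := fun j =>
    sub_nonneg.2 (hanti (Nat.le_succ (ma + j)))
  have hb0' : ∀ j, 0 ≤ litArraySatProb k n (ma + 1 + j - L) - litArraySatProb k n (ma + 1 + j) := fun j =>
    sub_nonneg.2 (hanti (Nat.sub_le (ma + 1 + j) L))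
  have hc0 : ∀ j, 0 ≤ litArraySatProb k n (ma + 1 + j) - litArraySatProb k n (ma + 1 + j + W) := fun j =>
    sub_nonneg.2 (hanti (Nat.le_add_right (ma + 1 + j) W))
  obtain ⟨j, hjN, hja, hjb, hjc⟩ := exists_good_index hε hmar hτ hNge hmabig
    (fun j => litArraySatProb k n (ma + j) - litArraySatProb k n (ma + j + 1))
    (fun j => litArraySatProb k n (ma + 1 + j - L) - litArraySatProb k n (ma + 1 + j))
    (fun j => litArraySatProb k n (ma + 1 + j) - litArraySatProb k n (ma + 1 + j + W))
    ha0 hb0' hc0 (sum_drop_le k n ma N) (sum_window_below_le k n hmaL N) (sum_window_above_le k n ma W N)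
  -- the good density `M = m_a + 1 + j`
  obtain ⟨M, hMdef⟩ : ∃ M : ℕ, M = ma + 1 + j := ⟨_, rfl⟩
  have hmaM : ma ≤ M := by rw [hMdef, Nat.add_assoc]; exact Nat.le_add_right _ _
  have hMle : M ≤ mb' := by
    have h1 : ma + N = mb' := by rw [hN, Nat.add_sub_cancel' hmamb']
    calc M = ma + (j + 1) := by rw [hMdef]; ring
      _ ≤ ma + N := Nat.add_le_add_left (Nat.succ_le_of_lt hjN) ma
      _ = mb' := h1
  have hma1r : (1 : ℝ) ≤ ma := by exact_mod_cast hma1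
  have hMr : (M : ℝ) ≤ (2 + ε) * ma := by
    have : (M : ℝ) ≤ mb' := by exact_mod_cast hMle
    linarith only [this, hmb'lt, hma1r]
  have hMCst : (M : ℝ) ≤ Cst * n := by
    have : (M : ℝ) ≤ mb := by exact_mod_cast hMle.trans hmb'le
    linarith only [this, hmb]
  have hPM_lo : η ≤ litArraySatProb k n M := hPb'.trans (hanti hMle)
  have hPM_hi : litArraySatProb k n M ≤ 1 - η := (hanti hmaM).trans hPa
  -- hypotheses of the dichotomy at `M`
  have hI : totalInfl (unsatInd k n M) ≤ K := by
    have h1 := totalInfl_unsatInd_le k n (ma + j)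
    have e : ma + j + 1 = M := by rw [hMdef]; ring
    rw [e] at h1
    have hMr' : ((ma + j : ℕ) : ℝ) + 1 = M := by rw [← e]; push_cast; ring
    rw [hMr'] at h1
    calc totalInfl (unsatInd k n M) ≤ 4 * M * (litArraySatProb k n (ma + j) - litArraySatProb k n M) := h1
      _ = 4 * M * (litArraySatProb k n (ma + j) - litArraySatProb k n (ma + j + 1)) := by rw [e]
      _ ≤ 4 * ((2 + ε) * ma) * (2 / (ε * ma)) := by
          apply mul_le_mul (mul_le_mul_of_nonneg_left hMr (by norm_num)) hja (ha0 j) (by positivity)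
      _ = 8 * (2 + ε) / ε := by field_simp; ring
      _ = K := hK.symm
  have hvar : v0 ≤ variance (unsatInd k n M) := by
    rw [variance_unsatInd, hv0]
    have h1 := mul_nonneg (sub_nonneg.2 hPM_lo) (sub_nonneg.2 hPM_hi)
    nlinarith only [h1]
  have hdropL : litArraySatProb k n (M - L) < litArraySatProb k n M + τ / 2 := by
    rw [hMdef]; linarith only [hjb]
  -- the dichotomy
  rcases hdich k n M hI hvar hdropL with hAlt1 | ⟨x, T, hTL, hxT, hsat⟩
  · -- Alt 1: small unsatisfiable sub-formulas are too rare
    have := avg_ite_exists_small_unsat_le (M := M) hk hn1 L hC.le hMCst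
    linarith only [hAlt1, this, hnA1]
  · -- Alt 2: a planted satisfiable sub-formula cannot boost unsatisfiability
    have hwin : litArraySatProb k n M - τ / 9 ≤ litArraySatProb k n (M + d * g) := by
      rw [hMdef, ← hW]; linarith only [hjc]
    exact planted_alternative_false (le_trans (by norm_num) hk) hn1 hτ hα0pos hα01 hC.le hMCst hnkL hnE1 hE2c hE3c
      hwin hTL hxT hsat

/-! ### The median density `m_{1/2}(n)` -/

/-- `m_{1/2}(n)`: the least `m` with `Pr[F_k(n, m) sat] ≤ 1/2` (Friedgut: "Define `p(n)` to be the
critical `p` such that `µ_p(T(n)) = 1/2`"; junk `0` if there is none). [cite: Friedgut1999, §5 (proof of Cor. 5.3)] -/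
def mHalf (k n : ℕ) : ℕ := sInf {m : ℕ | litArraySatProb k n m ≤ 1 / 2}

/-- The defining properties of `m_{1/2}(n)` for `n ≥ 1`. [cite: Friedgut1999, §5] -/
theorem mHalf_spec {n : ℕ} (hn : 1 ≤ n) (k : ℕ) :
    litArraySatProb k n (mHalf k n) ≤ 1 / 2 ∧ ∀ m, m < mHalf k n → 1 / 2 < litArraySatProb k n m := by
  have hne : ({m : ℕ | litArraySatProb k n m ≤ 1 / 2} : Set ℕ).Nonempty :=
    ⟨2 ^ k * (2 * n), (litArraySatProb_big_lt_half hn k).le⟩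
  refine ⟨Nat.sInf_mem hne, fun m hm => ?_⟩
  have := Nat.notMem_of_lt_sInf hm
  simpa using this

/-- `m_{1/2}(n) ≤ 2^{k+1} n`. [cite: AchlioptasPeres2004, §1.1] -/
theorem mHalf_le {n : ℕ} (hn : 1 ≤ n) (k : ℕ) : mHalf k n ≤ 2 ^ k * (2 * n) :=
  Nat.sInf_le (litArraySatProb_big_lt_half hn k).le

/-- `m_{1/2}(n) → ∞`: for fixed `B`, `Pr[F_k(n, B) sat] ≥ 1 - B²/n > 1/2` for large `n`. [folklore] -/
theorem eventually_le_mHalf (k : ℕ) [NeZero k] (B : ℕ) : ∀ᶠ n : ℕ in atTop, B ≤ mHalf k n := by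
  filter_upwards [eventually_gt_atTop (2 * B ^ 2)] with n hn
  have hn1 : 1 ≤ n := by omega
  by_contra h
  push Not at h
  have h1 := (mHalf_spec hn1 k).1
  have h2 : litArraySatProb k n B ≤ litArraySatProb k n (mHalf k n) := litArraySatProb_antitone k n h.le
  have h3 := litArraySatProb_ge_one_sub (k := k) hn1 B
  have h4 : (B : ℝ) ^ 2 / n < 1 / 2 := by
    rw [div_lt_iff₀ (by exact_mod_cast hn1 : (0 : ℝ) < n)]
    have : ((2 * B ^ 2 : ℕ) : ℝ) < n := by exact_mod_cast hn
    push_cast at this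
    linarith
  linarith

/-! ### Friedgut's theorem -/

/-- The upper half of the sharp threshold: `Pr[F_k(n, ⌊(1+ε) m_{1/2}(n)⌋) sat] → 0`.
[cite: Friedgut1999, Thm. 1.3] -/
theorem tendsto_above_mHalf {k : ℕ} (hk : 3 ≤ k) {ε : ℝ} (hε : 0 < ε) :
    Tendsto (fun n : ℕ => litArraySatProb k n ⌊(1 + ε) * (mHalf k n : ℝ)⌋₊) atTop (𝓝 0) := by
  haveI : NeZero k := ⟨Nat.pos_iff_ne_zero.1 (lt_of_lt_of_le (by norm_num) hk)⟩
  rw [tendsto_order]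
  refine ⟨fun a ha => Eventually.of_forall fun n => lt_of_lt_of_le ha (litArraySatProb_nonneg _ _ _), fun a ha => ?_⟩
  set η : ℝ := min a (1 / 2) with hη
  have hη0 : 0 < η := lt_min ha (by norm_num)
  have hη1 : η ≤ 1 / 2 := min_le_right _ _
  obtain ⟨M0, n0, hwin⟩ := not_coarse hk (half_pos hε) hη0 hη1
    (show (0 : ℝ) < (1 + ε) * 2 ^ (k + 1) by positivity)
  filter_upwards [eventually_ge_atTop n0, eventually_ge_atTop 1, eventually_le_mHalf k (max M0 (⌈2 / ε⌉₊ + 1))]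
    with n hn hn1 hmH
  set ma := mHalf k n with hma
  have hM0 : M0 ≤ ma := le_trans (le_max_left _ _) hmH
  have hma2 : 2 / ε < ma := by
    have h1 : ⌈2 / ε⌉₊ + 1 ≤ ma := le_trans (le_max_right _ _) hmH
    have h2 := Nat.le_ceil (2 / ε)
    have h3 : (⌈2 / ε⌉₊ : ℝ) + 1 ≤ ma := by exact_mod_cast h1
    linarith
  have hmar : (0 : ℝ) < ma := lt_trans (by positivity) hma2
  set mb : ℕ := ⌊(1 + ε) * (ma : ℝ)⌋₊ with hmb
  have hmb1 : (1 + ε / 2) * (ma : ℝ) ≤ mb := by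
    have h1 : (1 + ε) * (ma : ℝ) - 1 < mb := by
      have := Nat.lt_floor_add_one ((1 + ε) * (ma : ℝ))
      linarith
    have h2 : 1 < ε / 2 * ma := by
      rw [div_lt_iff₀ hε] at hma2
      linarith
    linarith
  have hmb2 : (mb : ℝ) ≤ (1 + ε) * 2 ^ (k + 1) * n := by
    have h1 : (mb : ℝ) ≤ (1 + ε) * ma := Nat.floor_le (by positivity)
    have h2 : (ma : ℝ) ≤ 2 ^ k * (2 * n) := by exact_mod_cast mHalf_le hn1 k
    calc (mb : ℝ) ≤ (1 + ε) * ma := h1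
      _ ≤ (1 + ε) * (2 ^ k * (2 * n)) := mul_le_mul_of_nonneg_left h2 (by positivity)
      _ = (1 + ε) * 2 ^ (k + 1) * n := by rw [pow_succ]; ring
  have hPa : litArraySatProb k n ma ≤ 1 - η := by
    have := (mHalf_spec hn1 k).1
    rw [← hma] at this
    linarith
  have := hwin n hn ma mb hM0 hmb1 hmb2 hPa
  exact lt_of_lt_of_le this (min_le_left _ _)

/-- The lower half of the sharp threshold: `Pr[F_k(n, ⌊(1-ε) m_{1/2}(n)⌋) sat] → 1`.
[cite: Friedgut1999, Thm. 1.3] -/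
theorem tendsto_below_mHalf {k : ℕ} (hk : 3 ≤ k) {ε : ℝ} (hε : 0 < ε) :
    Tendsto (fun n : ℕ => litArraySatProb k n ⌊(1 - ε) * (mHalf k n : ℝ)⌋₊) atTop (𝓝 1) := by
  haveI : NeZero k := ⟨Nat.pos_iff_ne_zero.1 (lt_of_lt_of_le (by norm_num) hk)⟩
  by_cases hε1 : 1 ≤ ε
  · -- empty formulas
    have : (fun n : ℕ => litArraySatProb k n ⌊(1 - ε) * (mHalf k n : ℝ)⌋₊) = fun _ => 1 := by
      funext n
      rw [Nat.floor_of_nonpos (mul_nonpos_of_nonpos_of_nonneg (by linarith) (Nat.cast_nonneg _)),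
        litArraySatProb_zero_right]
    rw [this]
    exact tendsto_const_nhds
  push Not at hε1
  rw [tendsto_order]
  refine ⟨fun a ha => ?_, fun a ha => Eventually.of_forall fun n => lt_of_le_of_lt (litArraySatProb_le_one _ _ _) ha⟩
  set η : ℝ := min (1 - a) (1 / 2) with hη
  have hη0 : 0 < η := lt_min (by linarith) (by norm_num)
  have hη1 : η ≤ 1 / 2 := min_le_right _ _
  obtain ⟨M0, n0, hwin⟩ := not_coarse hk hε hη0 hη1 (show (0 : ℝ) < 2 ^ (k + 1) by positivity)
  filter_upwards [eventually_ge_atTop n0, eventually_ge_atTop 1,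
    eventually_le_mHalf k (max (⌈((M0 : ℝ) + 1) / (1 - ε)⌉₊ + 1) (⌈1 / ε ^ 2⌉₊ + 1))] with n hn hn1 hmH
  set ms := mHalf k n with hms
  have hms1 : ((M0 : ℝ) + 1) / (1 - ε) < ms := by
    have h1 : ⌈((M0 : ℝ) + 1) / (1 - ε)⌉₊ + 1 ≤ ms := le_trans (le_max_left _ _) hmH
    have h2 := Nat.le_ceil (((M0 : ℝ) + 1) / (1 - ε))
    have h3 : (⌈((M0 : ℝ) + 1) / (1 - ε)⌉₊ : ℝ) + 1 ≤ ms := by exact_mod_cast h1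
    linarith
  have hms2 : 1 / ε ^ 2 < ms := by
    have h1 : ⌈1 / ε ^ 2⌉₊ + 1 ≤ ms := le_trans (le_max_right _ _) hmH
    have h2 := Nat.le_ceil (1 / ε ^ 2)
    have h3 : (⌈1 / ε ^ 2⌉₊ : ℝ) + 1 ≤ ms := by exact_mod_cast h1
    linarith
  have hmsr : (0 : ℝ) < ms := lt_trans (by positivity) hms2
  have hmsn : 1 ≤ ms := by exact_mod_cast hmsr
  set ma : ℕ := ⌊(1 - ε) * (ms : ℝ)⌋₊ with hma
  set mb : ℕ := ms - 1 with hmb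
  have h1ε : 0 < 1 - ε := by linarith
  have hM0 : M0 ≤ ma := by
    have h1 : (1 - ε) * (ms : ℝ) - 1 < ma := by
      have := Nat.lt_floor_add_one ((1 - ε) * (ms : ℝ))
      linarith
    have h2 : (M0 : ℝ) + 1 < (1 - ε) * ms := by rwa [div_lt_iff₀ h1ε, mul_comm] at hms1
    have : (M0 : ℝ) < ma := by linarith
    exact_mod_cast this.le
  have hmbr : (mb : ℝ) = ms - 1 := by rw [hmb]; push_cast [Nat.cast_sub hmsn]; ring
  have hab : (1 + ε) * (ma : ℝ) ≤ mb := by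
    have h1 : (ma : ℝ) ≤ (1 - ε) * ms := Nat.floor_le (by positivity)
    have h2 : 1 < ε ^ 2 * ms := by
      rw [div_lt_iff₀ (by positivity)] at hms2
      linarith
    rw [hmbr]
    nlinarith
  have hmbC : (mb : ℝ) ≤ 2 ^ (k + 1) * n := by
    have h2 : (ms : ℝ) ≤ 2 ^ k * (2 * n) := by exact_mod_cast mHalf_le hn1 k
    rw [hmbr, pow_succ]
    linarith
  -- if `P(m_a) ≤ 1 - η` the window lemma would give `P(m_s - 1) < η ≤ 1/2`, absurd
  by_contra hcon
  push Not at hcon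
  have hPa : litArraySatProb k n ma ≤ 1 - η := by
    have : 1 - η ≥ a := by
      have := min_le_left (1 - a) (1 / 2)
      linarith
    linarith
  have h1 := hwin n hn ma mb hM0 hab hmbC hPa
  have h2 := (mHalf_spec hn1 k).2 mb (by rw [hmb]; exact Nat.sub_one_lt (by exact_mod_cast hmsr.ne'))
  linarith

/-- **Friedgut's theorem (J. AMS 1999, Thm. 1.3) for `k ≥ 3`**, in the with-replacement model
`F_k(n, m)` and in the multiplicative form of Achlioptas–Peres (Thm. 3 / Cor. 1): there is a
sequence `r_k(n)` (`= m_{1/2}(n)/n`) such that for every `ε > 0`,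
`Pr[F_k(n, ⌊(1-ε) r_k(n) n⌋) sat] → 1` and `Pr[F_k(n, ⌊(1+ε) r_k(n) n⌋) sat] → 0`.
[cite: Friedgut1999, Thm. 1.3 (k ≥ 3; §5 with Bourgain's appendix Prop. 1)] -/
theorem friedgut_sharp_threshold {k : ℕ} (hk : 3 ≤ k) :
    ∃ rk : ℕ → ℝ, ∀ ε : ℝ, 0 < ε →
      Tendsto (fun n : ℕ => litArraySatProb k n ⌊(1 - ε) * rk n * n⌋₊) atTop (𝓝 1) ∧
      Tendsto (fun n : ℕ => litArraySatProb k n ⌊(1 + ε) * rk n * n⌋₊) atTop (𝓝 0) := by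
  refine ⟨fun n => (mHalf k n : ℝ) / n, fun ε hε => ⟨?_, ?_⟩⟩
  · refine (tendsto_below_mHalf hk hε).congr' ?_
    filter_upwards [eventually_ge_atTop 1] with n hn
    have hn0 : (n : ℝ) ≠ 0 := by exact_mod_cast (Nat.one_le_iff_ne_zero.1 hn)
    simp only [mul_assoc, div_mul_cancel₀ _ hn0]
  · refine (tendsto_above_mHalf hk hε).congr' ?_
    filter_upwards [eventually_ge_atTop 1] with n hn
    have hn0 : (n : ℝ) ≠ 0 := by exact_mod_cast (Nat.one_le_iff_ne_zero.1 hn)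
    simp only [mul_assoc, div_mul_cancel₀ _ hn0]

end RandomKSat

end Literature.Computability.Complexity

end

/-!
# Achlioptas–Peres 2004, Theorem 2: the discharge

`AchlioptasPeres2004_threshold_lower_bound_holds : AchlioptasPeres2004_threshold_lower_bound`
(`RandomKSatThreshold.lean`): *there is `δ_k → 0` such that for all `k ≥ 3` and all
`r < 2^k log 2 - (k+1) log 2/2 - 1 - δ_k`, `Pr[F_k(n, ⌊rn⌋) satisfiable] → 1`* — exactly as
printed (D. Achlioptas, Y. Peres, J. Amer. Math. Soc. 17 (2004), Thm. 2; arXiv:cs/0305009 p. 2,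
proof pp. 15–16): the second-moment method gives uniformly positive probability for `k ≥ k₀`
(`achlioptasPeres2004_uniformlyPos`, `RandomKSatUniformlyPos.lean`, with `k₀ = 1024` and an
explicit `δ_k`), Friedgut's theorem (AP Thm. 3 = Friedgut 1999 Thm. 1.3, proved for `k ≥ 3` in
Part 6 above) upgrades it to high probability (AP Cor. 1,
`tendsto_one_of_uniformlyPos_of_sharpThresholdSeq`), and `δ_k` is taken vacuous (`2^k log 2`) for
`3 ≤ k < k₀`, as in the printed proof ("for `k < 166` take `δ_k` large").

## References

* D. Achlioptas, Y. Peres, *The threshold for random `k`-SAT is `2^k log 2 - O(k)`*, J. Amer.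
  Math. Soc. 17 (2004) 947–973, Thm. 2, Thm. 3, Cor. 1 [AchlioptasPeres2004].
* E. Friedgut (appendix by J. Bourgain), J. Amer. Math. Soc. 12 (1999) 1017–1054, Thm. 1.3
  [Friedgut1999].
-/

noncomputable section

namespace Literature.Computability.Complexity

open Finset Filter Real
open scoped Classical Topology

/-- **The reduction with Friedgut's theorem only for large `k`** (AP2004, proof of Thm. 2: the
sharp-threshold sequence is needed only at the `k ≥ k₀` where the second moment method is run):
variant of `achlioptasPeres2004_threshold_lower_bound_of_uniformlyPos` with `hF` restricted to
`k ≥ k₀`. [cite: AchlioptasPeres2004, Thm. 2 and Cor. 1 (arXiv:cs/0305009 pp. 2–3, 15–16)] -/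
theorem achlioptasPeres2004_threshold_lower_bound_of_uniformlyPos' (k₀ : ℕ)
    (hF : ∀ k : ℕ, k₀ ≤ k → ∃ rk : ℕ → ℝ, ∀ ε : ℝ, 0 < ε →
      Tendsto (fun n : ℕ => litArraySatProb k n ⌊(1 - ε) * rk n * n⌋₊) atTop (𝓝 1) ∧
      Tendsto (fun n : ℕ => litArraySatProb k n ⌊(1 + ε) * rk n * n⌋₊) atTop (𝓝 0))
    (ρ : ℕ → ℝ)
    (hpos : ∀ k : ℕ, k₀ ≤ k → ∀ r : ℝ, r < ρ k →
      ∃ c : ℝ, 0 < c ∧ ∀ᶠ n : ℕ in atTop, c ≤ litArraySatProb k n ⌊r * n⌋₊)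
    (hρ : Tendsto (fun k : ℕ => 2 ^ k * Real.log 2 - ((k : ℝ) + 1) * Real.log 2 / 2 - 1 - ρ k)
      atTop (𝓝 0)) :
    AchlioptasPeres2004_threshold_lower_bound := by
  set L : ℕ → ℝ := fun k => 2 ^ k * Real.log 2 - ((k : ℝ) + 1) * Real.log 2 / 2 - 1 with hL
  refine ⟨fun k => if k < k₀ then 2 ^ k * Real.log 2 else L k - ρ k, ?_, ?_⟩
  · apply hρ.congr'
    filter_upwards [eventually_ge_atTop k₀] with k hk
    simp only [not_lt.mpr hk, if_false, hL]
  · intro k _ r hr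
    by_cases hk' : k < k₀
    · -- vacuous range: the bound is negative, the formula is empty
      simp only [hk', if_true] at hr
      have hlog : 0 < Real.log 2 := Real.log_pos one_lt_two
      have hr0 : r < 0 := by
        have : 0 ≤ ((k : ℝ) + 1) * Real.log 2 / 2 := by positivity
        linarith
      have hfl : ∀ n : ℕ, ⌊r * n⌋₊ = 0 := fun n =>
        Nat.floor_of_nonpos (mul_nonpos_of_nonpos_of_nonneg hr0.le (Nat.cast_nonneg n))
      simp only [hfl, litArraySatProb_zero_right]
      exact tendsto_const_nhds
    · simp only [hk', if_false, hL] at hr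
      have hrρ : r < ρ k := by linarith
      obtain ⟨r'', hr'', hρ''⟩ := exists_between hrρ
      obtain ⟨c, hc, hcpos⟩ := hpos k (not_lt.mp hk') r'' hρ''
      obtain ⟨rk, hrk⟩ := hF k (not_lt.mp hk')
      exact tendsto_one_of_uniformlyPos_of_sharpThresholdSeq hrk hr'' hc hcpos

/-- **Achlioptas–Peres 2004, Theorem 2 — discharged.** There is a sequence `δ_k → 0` such that
for all `k ≥ 3` and all `r < 2^k log 2 - (k+1) log 2/2 - 1 - δ_k`, the random formula
`F_k(n, ⌊rn⌋)` is satisfiable with probability tending to `1`. Proof as printed: uniformly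
positive probability from the weighted second moment for `k ≥ 1024`
(`achlioptasPeres2004_uniformlyPos`), Friedgut's sharp-threshold theorem
(`RandomKSat.friedgut_sharp_threshold`, `k ≥ 3`) and Corollary 1, vacuous `δ_k` below `1024`.
[cite: AchlioptasPeres2004, Thm. 2 (arXiv:cs/0305009 p. 2), proof pp. 15–16; Friedgut1999, Thm. 1.3] -/
theorem AchlioptasPeres2004_threshold_lower_bound_holds : AchlioptasPeres2004_threshold_lower_bound :=
  achlioptasPeres2004_threshold_lower_bound_of_uniformlyPos' 1024
    (fun _ hk => RandomKSat.friedgut_sharp_threshold (le_trans (by norm_num) hk))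
    (fun k => (2 ^ k * Real.log 2 - ((k : ℝ) + 1) * Real.log 2 / 2 - 1) -
      2 * (15 * (k : ℝ) ^ 2 / 2 ^ k + (((k : ℝ) + 3) / 2 ^ k + 32 * (k : ℝ) ^ 2 * (50 / 81) ^ k +
        32 * (k : ℝ) * (5 / 9) ^ k)))
    (fun _ hk _ hr => achlioptasPeres2004_uniformlyPos hk hr) tendsto_two_mul_delta

end Literature.Computability.Complexity

end
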